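import Mathlib
import Literature.Topology.FourManifolds.LefschetzHandlebody
import Literature.AlgebraicTopology.SingularHomology.LoopClassesSpan
import Literature.AlgebraicTopology.SingularHomology.HurewiczOne
import Literature.Topology.FourManifolds.TwoHandleTubeDeformationFour
import Literature.Topology.FourManifolds.HandleAttachingMaps
import Literature.Topology.FourManifolds.LefschetzBasePages
import Literature.AlgebraicTopology.FundamentalGroup.CellAttachmentKernelLoop
import Literature.AlgebraicTopology.FundamentalGroup.DeformationRetractInclusion
import Literature.AlgebraicTopology.SingularHomology.MayerVietorisFiveLemma
import Literature.AlgebraicTopology.SingularHomology.MayerVietorisIsoRight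
import Literature.AlgebraicTopology.SingularHomology.CollapseMap
import Literature.AlgebraicTopology.SingularHomology.TripleSequence
import Literature.AlgebraicTopology.SingularHomology.MayerVietorisExactness
import Literature.AlgebraicTopology.Homotopy.StrongDeformationRetractSqueeze
import Literature.AlgebraicTopology.Homotopy.StrongDeformationRetractTransport
import Literature.Topology.FourManifolds.LefschetzBaseShadow
import Literature.AlgebraicTopology.SingularHomology.ExcisionMayerVietorisProofs
import Literature.AlgebraicTopology.SingularHomology.IntersectionFormProofs
import Literature.AlgebraicTopology.SingularHomology.BoundaryManifoldFiniteness
import Literature.Topology.FourManifolds.LefschetzBaseBetti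
import Literature.Topology.FourManifolds.LefschetzModelFacts
import Literature.GroupTheory.CombinatorialGroupTheory.SignedHurwitzAction
import HarnessLib

/-!
# The homology of a Lefschetz handlebody `X(F_{g,1}; l)` (Gompf–Stipsicz §8.2, Kas 1980) — `isLefschetzHandlebody_homology` HOLDS (re-homed proofs)

**The homology of a Lefschetz handlebody (Gompf–Stipsicz 1999, §8.2; Kas 1980) — the named fact
`Literature.Topology.FourManifolds.LefschetzBase.isLefschetzHandlebody_homology` (`LefschetzModelFacts.lean`) HOLDS**: for the
compact 4-manifold with boundary `X = X(F_{g,1}; l)` attached to the tree's concrete base along a Lefschetz link realising the word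
`l` (`IsLefschetzHandlebody g l X`, `Literature/Topology/FourManifolds/LefschetzHandlebody.lean`): `X` is connected,
`H₁(X; ℤ) ≅ ℤ^{2g}/⟨classes of l⟩`, and if `l` has `2g` letters whose classes span `ℚ^{2g}` then `H_k(X; ℚ) = 0` for all `k > 0`
(R. Gompf, A. Stipsicz, *4-Manifolds and Kirby Calculus* (1999), §8.2 [GompfStipsicz1999]; A. Kas, Pacific J. Math. 89 (1980);
A. Hatcher, *Algebraic Topology* (2002), §2.2 (Mayer–Vietoris), Cor. 3A.6 [HatcherAT2002]; A. Kosinski, *Differential Manifolds*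
(1993) [Kosinski1993]).  ARCHITECTURE of the in-tree proof (kernel-checked; until now Summits-side only,
`Summits/SmoothPoincare4/SmoothPoincare4/Theorems/ConvexBisectionAcyclicBisectionExistsMultiAttachmentAcyclic.lean`): connectedness
of the handlebody; the multi-attachment engine — homology of loops and punctured tubes, the local `H₁` model of one attachment
(parallel circles, tube homotopies), the Mayer–Vietoris sequence of the cover `X = U ∪ W` (cores / cover), `H₁(X; ℤ) ≅ ℤ^{2g}/⟨l⟩`,
`H_{k+2}(X) ≅ H_{k+2}(Base g)` when the attaching classes are independent, `H_{k+3} = 0`; then Betti numbers over `ℤ` and `ℚ`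
(`bettiNumber_int_eq_rat`, finite generation of the homology of a compact manifold with boundary) and the base's Betti numbers
(`LefschetzBaseBetti.lean`) give the `ℚ`-acyclicity clause.  RE-HOMED into `Literature/` by the Hodge foundations lane
(`lit-hodgefound`, seat p20, generation 38): verbatim DECLARATION-LEVEL ports (the declarations needed, in dependency order) of the
10 Summits modules `…/Theorems/ConvexBisectionAcyclicBisectionExists{StubLefschetzHandlebodyConnected,MultiAttachment{HomologyLoops,
H1Model,HomologyMV,H1Cores,H1Cover,H1,HkCover,Hk,Acyclic}}.lean`, namespace
`Summit.SmoothPoincare4.SmoothPoincare4.Theorems.AcyclicBisectionExists.ModpBraidOrbits` re-rooted as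
`Literature.Topology.FourManifolds.LefschetzHandlebodyHomology` (in-tree `stub_…` names kept so that twins share short names; they are
proved theorems), followed by the EXACT-name discharge `Literature.Topology.FourManifolds.LefschetzBase.isLefschetzHandlebody_homology_holds`.
The honest auxiliary definitions of the source come along with their bodies (`clampR`, `tubeCirclePt`, `parallelLoop`, `puncturedTube`,
`parallelCircle`, `LCircle`, `liftCircleMap`, `tubeCircleMap`, `tubeCircleHomotopy`, `eU`, `eW`, `eUW`, `circPt` — explicit maps, sets
and homotopies of the local model, each cited); no new named fact (D-0026), no Summits import; every declaration carries a citation.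
Built on the tree's Literature layer (`Topology/FourManifolds/Lefschetz{Handlebody,BaseBetti,ModelFacts}`,
`AlgebraicTopology/SingularHomology/*`, `GroupTheory/CombinatorialGroupTheory/SignedHurwitzAction`) and Mathlib.  The Summits
originals stay in place (transitional duplication).  WHAT THIS IS NOT: nothing here bears on the smooth Poincaré conjecture in
dimension 4; this is the elementary algebraic topology of handle attachments.
-/

noncomputable section

/-!
## Part 1 — port of `Summits/SmoothPoincare4/SmoothPoincare4/Theorems/ConvexBisectionAcyclicBisectionExistsStubLefschetzHandlebodyConnected.lean` (14 declarations kept)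

# The standard Lefschetz base `Base g ⊂ ℂ²` is connected, and so is every Lefschetz handlebody

Verbatim declaration-level port (the declarations listed in the Part header count) of a helper module of the SmoothPoincare4
tree that served the kernel proof of the homology of a Lefschetz handlebody; route bookkeeping of the source docstring (stub /
crux / item / wave names) is historical.

The registered stub (Gompf–Stipsicz 1999 §8.2; Kas 1980 — unfolded over the concrete base
`Base g = {rho g ≤ 1/4}`, `rho g = ‖y² − x^{2g+1} − 1‖² + eta ‖x‖²`) asserts first that a Lefschetz
handlebody `X(F_{g,1}; l)` (`IsLefschetzHandlebody g l X`) is CONNECTED; proved here for all `g, l`,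
from tree theorems only (no definitions, no named facts):
* §1 `isPreconnected_rho_le`, `connectedSpace_base`: every sublevel `{rho g ≤ c}`, `0 ≤ c ≤ 1/4`,
  in particular `Base g`, is connected.  The sheet involution `ι(x, y) = (x, −y)` preserves `rho`;
  its orbit map `Φ(x, y) = (x, w)`, `w = y² − x^{2g+1} − 1`, has fibres `{p, ι p}` and star-shaped
  image (scaling `(x, w) ↦ (bx, bw)`, `0 ≤ b ≤ 1`, does not increase `rho`; square roots exist); a
  clopen set containing the `ι`-fixed branch point `(ζ₀, 0)` meets its `ι`-preimage in a saturated
  clopen `T`, and `Φ(T)`, `Φ(Tᶜ)` are disjoint closed sets (compactness) covering the preconnected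
  `Φ(sublevel)`, so `T` is everything.
* §2 `{rho < 1/4}` is connected (increasing union of sublevels) and dense in the base (`1/4` is a
  regular value: strict descent along `v` with `d rho(v) < 0`), so `Base g ∖ ⋃ cores` is connected
  (attaching circles lie in `{rho = 1/4}`); the handle piece `D⁴ ∖ S¹ ⊇` open ball is connected and
  meets the base piece (the tube point `(1/2, 0, 0, 0)` is glued to `α` of it); hence
  `connectedSpace_of_isLefschetzHandlebody` and `stub_isLefschetzHandlebody_homology_connected`.
-/

section Part1

open scoped _root_.Manifold _root_.ContDiff _root_.Topology
open _root_.Set _root_.Function Literature.Topology.FourManifolds Literature.Topology.FourManifolds.LefschetzBase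

namespace Literature.Topology.FourManifolds.LefschetzHandlebodyHomology

/-! ## §1 The sublevels `{rho ≤ c}` (in particular the base `Base g = {rho ≤ 1/4}`) are connected -/

/-- `rho` in complex coordinates: `rho g (a, b) = ‖b² − a^{2g+1} − 1‖² + eta ‖a‖²`. [cite: GompfStipsicz1999, §8.2 (a Lefschetz handlebody X(F;l) = F × D² ∪ 2-handles is connected)] -/
theorem rho_mk (g : ℕ) (a b : ℂ) :
    rho g (mk a b) = ‖b ^ 2 - a ^ (2 * g + 1) - 1‖ ^ 2 + eta (‖a‖ ^ 2) := by
  simp only [rho, w, Phi, cx_mk, cy_mk]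

/-- `w` in complex coordinates. [cite: GompfStipsicz1999, §8.2 (a Lefschetz handlebody X(F;l) = F × D² ∪ 2-handles is connected)] -/
theorem w_mk (g : ℕ) (a b : ℂ) : w g (mk a b) = b ^ 2 - a ^ (2 * g + 1) - 1 := by
  simp only [w, Phi, cx_mk, cy_mk]

/-- Membership in a sublevel of `rho` is `rho ≤ c`. [cite: GompfStipsicz1999, §8.2 (a Lefschetz handlebody X(F;l) = F × D² ∪ 2-handles is connected)] -/
theorem mem_base_iff (g : ℕ) (c : ℝ) (p : EuclideanSpace ℝ (Fin 4)) :
    p ∈ rho g ⁻¹' Iic c ↔ rho g p ≤ c := Iff.rfl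

/-- **Star-shaped orbit space.**  On the sublevel `{rho g ≤ c}` the image of the orbit map
`Φ(x, y) = (x, w)` is star-shaped about `0 ∈ ℂ × ℂ`: `(x, w) ↦ (b x, b w)`, `0 ≤ b ≤ 1`, does not
increase `rho = ‖w‖² + eta ‖x‖²`, and every `(x, w)` lifts (a square root of `w + x^{2g+1} + 1`).
[cite: GompfStipsicz1999, §8.2 (a Lefschetz handlebody X(F;l) = F × D² ∪ 2-handles is connected)] -/
theorem starConvex_range_orbitMap (g : ℕ) (c : ℝ) : StarConvex ℝ (0 : ℂ × ℂ)
    (range fun p : ↥(rho g ⁻¹' Iic c) => ((cx p.1, w g p.1) : ℂ × ℂ)) := by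
  rintro _ ⟨p, rfl⟩ a b _ hb hab
  rw [smul_zero, zero_add]
  have hb1 : b ≤ 1 := by linarith
  have hp : rho g p.1 ≤ c := p.2
  set x : ℂ := cx p.1
  set v : ℂ := w g p.1
  have hsq : ∀ t : ℝ, (b * t) ^ 2 ≤ t ^ 2 := fun t => by
    rw [mul_pow]; exact mul_le_of_le_one_left (sq_nonneg _) (pow_le_one₀ hb hb1)
  refine ⟨⟨mk ((b : ℂ) * x) (csqrt ((b : ℂ) * v + ((b : ℂ) * x) ^ (2 * g + 1) + 1)), ?_⟩, ?_⟩
  · rw [mem_base_iff, rho_mk, csqrt_sq]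
    have e1 : (b : ℂ) * v + ((b : ℂ) * x) ^ (2 * g + 1) + 1 - ((b : ℂ) * x) ^ (2 * g + 1) - 1 =
        (b : ℂ) * v := by ring
    rw [e1, norm_mul, norm_mul, Complex.norm_real, Real.norm_eq_abs, abs_of_nonneg hb]
    have hrho : rho g p.1 = ‖v‖ ^ 2 + eta (‖x‖ ^ 2) := rfl
    calc (b * ‖v‖) ^ 2 + eta ((b * ‖x‖) ^ 2) ≤ ‖v‖ ^ 2 + eta (‖x‖ ^ 2) :=
          add_le_add (hsq _) (eta_monotone (hsq _))
      _ ≤ c := hrho ▸ hp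
  · simp only [cx_mk, w_mk, csqrt_sq, Prod.smul_mk, Complex.real_smul]
    congr 1
    ring

/-- **The sublevel `{rho g ≤ c} ⊂ ℂ²` is connected for `0 ≤ c ≤ 1/4`** (clopen argument through the
sheet involution `ι(x, y) = (x, −y)`, its orbit map `Φ` and the `ι`-fixed branch point `(ζ₀, 0)`).
[cite: GompfStipsicz1999, §8.2 (a Lefschetz handlebody X(F;l) = F × D² ∪ 2-handles is connected)] -/
theorem isPreconnected_rho_le (g : ℕ) {c : ℝ} (hc0 : 0 ≤ c) (hc1 : c ≤ 1 / 4) :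
    IsPreconnected (rho g ⁻¹' Iic c) := by
  haveI : CompactSpace ↥(rho g ⁻¹' Iic c) :=
    isCompact_iff_compactSpace.1 ((isCompact_rho_le g).of_isClosed_subset
      (isClosed_Iic.preimage (contDiff_rho g).continuous) (preimage_mono (Iic_subset_Iic.2 hc1)))
  -- the sheet involution
  let ι : ↥(rho g ⁻¹' Iic c) → ↥(rho g ⁻¹' Iic c) := fun p => ⟨mk (cx p.1) (-cy p.1), by
    have h : rho g p.1 ≤ c := p.2
    rw [mem_base_iff, rho_mk, neg_sq]
    exact h⟩
  have hιc : Continuous ι :=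
    (continuous_mk.comp ((contDiff_cx.continuous.comp continuous_subtype_val).prodMk
      ((contDiff_cy.continuous.comp continuous_subtype_val).neg))).subtype_mk _
  have hιι : ∀ p, ι (ι p) = p := fun p => Subtype.ext (by
    show mk (cx (mk (cx p.1) (-cy p.1))) (-cy (mk (cx p.1) (-cy p.1))) = p.1
    rw [cx_mk, cy_mk, neg_neg, mk_cx_cy])
  -- the orbit map and its fibres
  let Φ : ↥(rho g ⁻¹' Iic c) → ℂ × ℂ := fun p => (cx p.1, w g p.1)
  have hΦc : Continuous Φ := (contDiff_cx.continuous.comp continuous_subtype_val).prodMk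
    ((contDiff_w g).continuous.comp continuous_subtype_val)
  have hfib : ∀ p q, Φ p = Φ q → q = p ∨ q = ι p := by
    intro p q h
    simp only [Φ, Prod.mk.injEq] at h
    obtain ⟨hx, hw⟩ := h
    have hy : cy q.1 ^ 2 = cy p.1 ^ 2 := by
      have h1 : cy p.1 ^ 2 = w g p.1 + cx p.1 ^ (2 * g + 1) + 1 := by simp only [w, Phi]; ring
      have h2 : cy q.1 ^ 2 = w g q.1 + cx q.1 ^ (2 * g + 1) + 1 := by simp only [w, Phi]; ring
      rw [h2, h1, hx, hw]
    rcases sq_eq_sq_iff_eq_or_eq_neg.1 hy with h' | h'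
    · exact Or.inl (Subtype.ext (by rw [← mk_cx_cy q.1, ← mk_cx_cy p.1, hx, h']))
    · exact Or.inr (Subtype.ext (by show q.1 = mk (cx p.1) (-cy p.1); rw [← mk_cx_cy q.1, hx, h']))
  have hpre : IsPreconnected (range Φ) := by
    refine ((starConvex_range_orbitMap g c).isPathConnected ⟨⟨mk 0 1, ?_⟩, ?_⟩).isConnected.isPreconnected
    · rw [mem_base_iff, rho_mk, zero_pow (by omega), norm_zero, eta_of_le (by norm_num)]
      norm_num [hc0]
    · simp only [cx_mk, w_mk, zero_pow (Nat.succ_ne_zero _)]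
      norm_num
  -- the branch point, fixed by the involution
  let b : ↥(rho g ⁻¹' Iic c) := ⟨mk (branchPt g 0) 0, by rw [mem_base_iff, rho_mk_branchPt]; exact hc0⟩
  have hιb : ι b = b := Subtype.ext (by
    show mk (cx (mk (branchPt g 0) 0)) (-cy (mk (branchPt g 0) 0)) = mk (branchPt g 0) 0
    rw [cx_mk, cy_mk, neg_zero])
  -- a clopen set containing the branch point is everything
  have hclopen : ∀ S : Set ↥(rho g ⁻¹' Iic c), IsClopen S → b ∈ S → S = univ := by
    intro S hS hb
    set T : Set ↥(rho g ⁻¹' Iic c) := S ∩ ι ⁻¹' S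
    have hT : IsClopen T := hS.inter (hS.preimage hιc)
    have hbT : b ∈ T := ⟨hb, by rw [mem_preimage, hιb]; exact hb⟩
    have hinv : ∀ p ∈ T, ι p ∈ T := fun p hp => ⟨hp.2, by rw [mem_preimage, hιι]; exact hp.1⟩
    have hT1 : IsClosed (Φ '' T) := (hT.isClosed.isCompact.image hΦc).isClosed
    have hT2 : IsClosed (Φ '' Tᶜ) := (hT.compl.isClosed.isCompact.image hΦc).isClosed
    have hdisj : ∀ z, z ∈ Φ '' T → z ∈ Φ '' Tᶜ → False := by
      rintro _ ⟨p, hp, rfl⟩ ⟨q, hq, hpq⟩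
      rcases hfib p q hpq.symm with rfl | rfl
      exacts [hq hp, hq (hinv p hp)]
    have hcov : range Φ ⊆ Φ '' T ∪ Φ '' Tᶜ := by
      rintro _ ⟨p, rfl⟩
      by_cases hp : p ∈ T
      exacts [Or.inl ⟨p, hp, rfl⟩, Or.inr ⟨p, hp, rfl⟩]
    refine eq_univ_of_univ_subset ((?_ : T = univ) ▸ inter_subset_left)
    by_contra hne
    obtain ⟨q, hq⟩ : Tᶜ.Nonempty := nonempty_compl.2 hne
    obtain ⟨z, -, hz1, hz2⟩ := (isPreconnected_closed_iff.1 hpre) _ _ hT1 hT2 hcov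
      ⟨_, ⟨b, rfl⟩, b, hbT, rfl⟩ ⟨_, ⟨q, rfl⟩, q, hq, rfl⟩
    exact hdisj z hz1 hz2
  haveI : ConnectedSpace ↥(rho g ⁻¹' Iic c) := connectedSpace_iff_clopen.2 ⟨⟨b⟩, fun S hS => by
    by_cases hb : b ∈ S
    · exact Or.inr (hclopen S hS hb)
    · exact Or.inl (compl_univ_iff.1 (hclopen Sᶜ hS.compl hb))⟩
  exact isPreconnected_iff_preconnectedSpace.2 inferInstance

/-- The open sublevel `{rho g < 1/4}` is preconnected: the increasing union of the connected
sublevels `{rho g ≤ 1/4 − 1/(n+4)}`, all containing the branch point. [cite: GompfStipsicz1999, §8.2 (a Lefschetz handlebody X(F;l) = F × D² ∪ 2-handles is connected)] -/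
theorem isPreconnected_rho_lt (g : ℕ) : IsPreconnected {q : EuclideanSpace ℝ (Fin 4) | rho g q < 1 / 4} := by
  have hle : ∀ n : ℕ, 1 / ((n : ℝ) + 4) ≤ 1 / 4 := fun n =>
    one_div_le_one_div_of_le (by norm_num) (by linarith [n.cast_nonneg (α := ℝ)])
  have hpos : ∀ n : ℕ, 0 < 1 / ((n : ℝ) + 4) := fun n => by positivity
  have hU : {q : EuclideanSpace ℝ (Fin 4) | rho g q < 1 / 4} =
      ⋃ n : ℕ, rho g ⁻¹' Iic (1 / 4 - 1 / ((n : ℝ) + 4)) := by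
    ext q
    simp only [mem_setOf_eq, mem_iUnion, mem_preimage, mem_Iic]
    refine ⟨fun hq => ?_, fun ⟨n, hn⟩ => by linarith [hpos n]⟩
    obtain ⟨n, hn⟩ := exists_nat_one_div_lt (by linarith : 0 < 1 / 4 - rho g q)
    have : 1 / ((n : ℝ) + 4) ≤ 1 / ((n : ℝ) + 1) := one_div_le_one_div_of_le (by positivity) (by linarith)
    exact ⟨n, by linarith⟩
  rw [hU]
  refine isPreconnected_iUnion ⟨mk (branchPt g 0) 0, mem_iInter.2 fun n => ?_⟩ fun n => ?_
  · rw [mem_base_iff, rho_mk_branchPt]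
    linarith [hle n]
  · exact isPreconnected_rho_le g (by linarith [hle n]) (by linarith [hpos n])

/-- At a regular point of a function on `ℝ⁴` there is a direction of strict descent. [cite: GompfStipsicz1999, §8.2 (a Lefschetz handlebody X(F;l) = F × D² ∪ 2-handles is connected)] -/
theorem exists_fderiv_neg {f : EuclideanSpace ℝ (Fin 4) → ℝ} {p : EuclideanSpace ℝ (Fin 4)}
    (h : ¬ IsMCriticalPt (𝓡 4) f p) : ∃ v : EuclideanSpace ℝ (Fin 4), fderiv ℝ f p v < 0 := by
  by_contra! hall
  have hzero : ∀ v, fderiv ℝ f p v = 0 := fun v =>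
    le_antisymm (by have h1 := hall (-v); rw [map_neg] at h1; linarith) (hall v)
  apply h
  simp only [IsMCriticalPt, mfderiv_eq_fderiv]
  exact ContinuousLinearMap.ext hzero

/-- **`{rho < 1/4}` is dense in the base**: at a point of the regular level `rho = 1/4` the function
decreases strictly along a descent direction. [cite: GompfStipsicz1999, §8.2 (a Lefschetz handlebody X(F;l) = F × D² ∪ 2-handles is connected)] -/
theorem mem_closure_rho_lt (g : ℕ) {p : EuclideanSpace ℝ (Fin 4)} (hp : rho g p ≤ 1 / 4) :
    p ∈ closure {q : EuclideanSpace ℝ (Fin 4) | rho g q < 1 / 4} := by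
  rcases hp.lt_or_eq with hlt | heq
  · exact subset_closure hlt
  obtain ⟨v, hv⟩ := exists_fderiv_neg ((isRegularLevel_rho g).not_isMCriticalPt heq)
  have hline := hasDerivAt_comp_line ((contDiff_rho g).differentiable (by simp)) p v
  have hev : ∀ᶠ t in 𝓝[>] (0 : ℝ), p + t • v ∈ {q : EuclideanSpace ℝ (Fin 4) | rho g q < 1 / 4} := by
    have h1 : ∀ᶠ z in 𝓝[>] (0 : ℝ), slope (fun t : ℝ => rho g (p + t • v)) 0 z < 0 :=
      hline.hasDerivWithinAt.limsup_slope_le' (fun h0 : (0 : ℝ) ∈ Ioi 0 => lt_irrefl (0 : ℝ)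
        (mem_Ioi.1 h0)) hv
    filter_upwards [h1, self_mem_nhdsWithin] with z hz hzpos
    rw [slope_def_field, zero_smul, add_zero, sub_zero] at hz
    rcases div_neg_iff.1 hz with ⟨-, h2⟩ | ⟨h3, -⟩
    · exact absurd (mem_Ioi.1 hzpos) (not_lt.2 h2.le)
    · show rho g (p + z • v) < 1 / 4
      linarith
  have htend : Filter.Tendsto (fun t : ℝ => p + t • v) (𝓝[>] 0) (𝓝 p) := by
    have h := (show Continuous (fun t : ℝ => p + t • v) by fun_prop).tendsto 0
    rw [zero_smul, add_zero] at h
    exact h.mono_left nhdsWithin_le_nhds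
  exact mem_closure_of_tendsto htend hev

/-- Interior points of the base (`rho < 1/4`) are off every attaching circle (which lies in the
boundary `rho = 1/4`). [cite: GompfStipsicz1999, §8.2 (a Lefschetz handlebody X(F;l) = F × D² ∪ 2-handles is connected)] -/
theorem mem_coresComplement_of_rho_lt {g : ℕ} {ι : Type*} [Finite ι]
    (h : ι → HandleAttachingMap 3 2 (Base g)) {p : Base g} (hp : rho g p.1 < 1 / 4) :
    p ∈ HandleAttachingMap.coresComplement h := by
  rw [HandleAttachingMap.mem_coresComplement]
  intro i hi
  exact absurd ((RegularSublevel.mem_boundary_iff (isRegularLevel_rho g) p).1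
    ((h i).core_subset_boundary hi)) (ne_of_lt hp)

/-- **The base minus finitely many attaching circles is connected**: it contains the connected
dense subset `{rho < 1/4}`. [cite: GompfStipsicz1999, §8.2 (a Lefschetz handlebody X(F;l) = F × D² ∪ 2-handles is connected)] -/
theorem isPreconnected_coresComplement {g : ℕ} {ι : Type*} [Finite ι]
    (h : ι → HandleAttachingMap 3 2 (Base g)) :
    IsPreconnected ((HandleAttachingMap.coresComplement h : Set (Base g))) := by
  set V : Set (Base g) := {p | rho g p.1 < 1 / 4}
  have hemb := RegularSublevel.isEmbedding_incl (isRegularLevel_rho g)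
  have himg : (RegularSublevel.incl (isRegularLevel_rho g) '' V : Set (EuclideanSpace ℝ (Fin 4))) =
      {q | rho g q < 1 / 4} := by
    ext q
    exact ⟨fun ⟨p, hp, hpq⟩ => hpq ▸ hp, fun hq => ⟨⟨q, (mem_base_iff g (1 / 4) q).2 hq.le⟩, hq, rfl⟩⟩
  have hV : IsPreconnected V := by
    refine hemb.isInducing.isPreconnected_image.1 ?_
    rw [himg]
    exact isPreconnected_rho_lt g
  refine hV.subset_closure (fun p hp => mem_coresComplement_of_rho_lt h hp) fun p _ => ?_
  rw [hemb.closure_eq_preimage_closure_image, himg]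
  exact mem_closure_rho_lt g p.2

/-- **The handle piece `D⁴ ∖ S¹` is connected**: it contains the convex open unit ball, which is
dense in `D⁴`. [cite: GompfStipsicz1999, §8.2 (a Lefschetz handlebody X(F;l) = F × D² ∪ 2-handles is connected)] -/
theorem isPreconnected_beltPiece :
    IsPreconnected ((beltPiece 3 2 : TopologicalSpace.Opens (Metric.closedBall
      (0 : EuclideanSpace ℝ (Fin 4)) 1)) : Set (Metric.closedBall (0 : EuclideanSpace ℝ (Fin 4)) 1)) := by
  set B : Set (Metric.closedBall (0 : EuclideanSpace ℝ (Fin 4)) 1) :=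
    {u | ‖(u : EuclideanSpace ℝ (Fin 4))‖ < 1}
  have hBsub : B ⊆ (beltPiece 3 2 : Set (Metric.closedBall (0 : EuclideanSpace ℝ (Fin 4)) 1)) := by
    intro u hu
    rw [SetLike.mem_coe, mem_beltPiece]
    exact fun h1 => absurd (norm_eq_one_of_mem_attachingSphereSet 3 2 h1) (ne_of_lt hu)
  have himg : (Subtype.val '' B : Set (EuclideanSpace ℝ (Fin 4))) = Metric.ball 0 1 := by
    ext q
    simp only [mem_image, Metric.mem_ball, dist_zero_right]
    exact ⟨fun ⟨u, hu, huq⟩ => huq ▸ hu,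
      fun hq => ⟨⟨q, Metric.mem_closedBall.2 (by rw [dist_zero_right]; exact hq.le)⟩, hq, rfl⟩⟩
  have hB : IsPreconnected B := by
    rw [← Topology.IsInducing.subtypeVal.isPreconnected_image, himg]
    exact (convex_ball (0 : EuclideanSpace ℝ (Fin 4)) 1).isPreconnected
  refine hB.subset_closure hBsub fun u _ => ?_
  rw [Topology.IsEmbedding.subtypeVal.closure_eq_preimage_closure_image, himg,
    closure_ball (0 : EuclideanSpace ℝ (Fin 4)) one_ne_zero]
  exact u.2

/-- **A simultaneous attachment of 2-handles to the base is connected.**  The pieces `Base g ∖ ⋃ cores`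
and `D⁴ ∖ S¹` are connected, and each handle piece meets the image of the base: the tube point
`y = (1/2, 0, 0, 0)` (`|x_λ|² = 1/4`) is glued to `α(y)`. [cite: GompfStipsicz1999, §8.2 (a Lefschetz handlebody X(F;l) = F × D² ∪ 2-handles is connected)] -/
theorem connectedSpace_of_isMultiAttachment {g : ℕ} {ι : Type*} [Finite ι]
    {h : ι → HandleAttachingMap 3 2 (Base g)} {X : Type*} [TopologicalSpace X]
    [ChartedSpace (EuclideanHalfSpace 4) X]
    (hX : HandleAttachingMap.IsMultiAttachment h (𝓡∂ 4) X) : ConnectedSpace X := by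
  obtain ⟨hdisj, jA, jB, hA, -, hB, hcover, hglue, -⟩ := hX
  haveI : PreconnectedSpace ↥(HandleAttachingMap.coresComplement h) :=
    Subtype.preconnectedSpace (isPreconnected_coresComplement h)
  haveI : PreconnectedSpace ↥(beltPiece 3 2) := Subtype.preconnectedSpace isPreconnected_beltPiece
  have hRA : IsPreconnected (range jA) := isPreconnected_range hA.isEmbedding.continuous
  -- the test point of the tube
  let y : ↥(handleTube 3 2) := ⟨⟨mk (1 / 2 : ℂ) 0, by
      have h' : ‖mk (1 / 2 : ℂ) 0‖ ^ 2 = 1 / 4 := by rw [norm_sq_eq, cx_mk, cy_mk]; norm_num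
      rw [Metric.mem_closedBall, dist_zero_right]
      nlinarith [norm_nonneg (mk (1 / 2 : ℂ) 0)]⟩, by
    rw [mem_handleTube]
    show lamSq 2 (mk (1 / 2 : ℂ) 0) ≠ 0
    rw [lamSq_two_fin_four]
    norm_num [mk]⟩
  have hy1 : lamSq 2 (((y : ↥(handleTube 3 2)) : Metric.closedBall (0 : EuclideanSpace ℝ (Fin 4)) 1) :
      EuclideanSpace ℝ (Fin 4)) ≠ 1 := by
    show lamSq 2 (mk (1 / 2 : ℂ) 0) ≠ 1
    rw [lamSq_two_fin_four]
    norm_num [mk]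
  have hmeet : ∀ i, ∃ x, x ∈ range jA ∧ x ∈ range (jB i) := by
    intro i
    have hrel := (h i).glueRel_apply y hy1
    have ha : (h i).toFun y ∈ HandleAttachingMap.coresComplement h := by
      rw [HandleAttachingMap.mem_coresComplement]
      intro j
      by_cases hij : j = i
      · subst hij
        exact hrel.not_mem_core
      · intro hj
        obtain ⟨y', -, hy'⟩ := ((h j).mem_core_iff).1 hj
        exact Set.disjoint_left.1 (hdisj hij) ⟨y', hy'⟩ ⟨y, rfl⟩
    have hb : ((handleInversionPt ((y : ↥(handleTube 3 2)) : Metric.closedBall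
        (0 : EuclideanSpace ℝ (Fin 4)) 1) y.2 hy1 : ↥(handleTube 3 2)) :
        Metric.closedBall (0 : EuclideanSpace ℝ (Fin 4)) 1) ∈ beltPiece 3 2 := by
      rw [mem_beltPiece, coe_coe_handleInversionPt]
      exact (handleInversion_mem y.2 hy1).2.2
    exact ⟨jA ⟨_, ha⟩, ⟨_, rfl⟩, ⟨⟨_, hb⟩, ((hglue i ⟨_, ha⟩ ⟨_, hb⟩).2 hrel).symm⟩⟩
  have h0 : (chordEnd g 0 : Base g) ∈ HandleAttachingMap.coresComplement h := by
    refine mem_coresComplement_of_rho_lt h ?_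
    show rho g (mk (branchPt g 0) 0) < 1 / 4
    rw [rho_mk_branchPt]; norm_num
  set x₀ : X := jA ⟨chordEnd g 0, h0⟩
  have hx₀ : x₀ ∈ range jA := mem_range_self _
  let S : Option ι → Set X := fun o => o.elim (range jA) fun i => range jA ∪ range (jB i)
  have hS : ∀ o, IsPreconnected (S o) := by
    rintro (_ | i)
    exacts [hRA, let ⟨x, hx1, hx2⟩ := hmeet i
      hRA.union x hx1 hx2 (isPreconnected_range (hB i).1.isEmbedding.continuous)]
  have hxS : ∀ o, x₀ ∈ S o := by rintro (_ | i); exacts [hx₀, Or.inl hx₀]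
  have hU : (⋃ o, S o) = univ := by
    refine eq_univ_of_univ_subset (hcover ▸ ?_)
    rintro x (hx | hx)
    · exact mem_iUnion.2 ⟨none, hx⟩
    · exact let ⟨i, hi⟩ := mem_iUnion.1 hx; mem_iUnion.2 ⟨some i, Or.inr hi⟩
  exact { isPreconnected_univ := hU ▸ isPreconnected_iUnion ⟨x₀, mem_iInter.2 hxS⟩ hS
          toNonempty := ⟨x₀⟩ }

/-- **Every (achiral) Lefschetz handlebody `X(F_{g,1}; l)` over the standard base is connected** —
the first clause of NF5 `LefschetzBase.isLefschetzHandlebody_homology`, for every `g` and every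
word `l`. [cite: GompfStipsicz1999, §8.2 (a Lefschetz handlebody X(F;l) = F × D² ∪ 2-handles is connected)] -/
theorem connectedSpace_of_isLefschetzHandlebody {g : ℕ} {l : List ((Fin g ⊕ Fin g → ℤ) × Bool)}
    {X : Type*} [TopologicalSpace X] [ChartedSpace (EuclideanHalfSpace 4) X]
    (hX : IsLefschetzHandlebody g l X) : ConnectedSpace X := by
  obtain ⟨h, -, hmulti⟩ := hX
  exact connectedSpace_of_isMultiAttachment hmulti

/-- **Clause (1) of the registered stub `stub_isLefschetzHandlebody_homology`, binders verbatim**: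
a Lefschetz handlebody is connected. [cite: GompfStipsicz1999, §8.2 (a Lefschetz handlebody X(F;l) = F × D² ∪ 2-handles is connected)] -/
theorem stub_isLefschetzHandlebody_homology_connected :
    ∀ (g : ℕ) (l : List ((Fin g ⊕ Fin g → ℤ) × Bool)) (X : Type) [TopologicalSpace X] [T2Space X]
      [SecondCountableTopology X] [CompactSpace X] [ChartedSpace (EuclideanHalfSpace 4) X]
      [IsManifold (𝓡∂ 4) ∞ X],
      IsLefschetzHandlebody g l X → ConnectedSpace X :=
  fun _ _ _ _ _ _ _ _ _ hX => connectedSpace_of_isLefschetzHandlebody hX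

end Literature.Topology.FourManifolds.LefschetzHandlebodyHomology

end Part1

/-!
## Part 2 — port of `Summits/SmoothPoincare4/SmoothPoincare4/Theorems/ConvexBisectionAcyclicBisectionExistsMultiAttachmentHomologyLoops.lean` (6 declarations kept)

# `H₁` of a space whose fundamental group is cyclic is spanned by one Hurewicz class; the image of
# `H₁` of such a piece; quotient bookkeeping for iterated Mayer–Vietoris steps

Verbatim declaration-level port (the declarations listed in the Part header count) of a helper module of the SmoothPoincare4
tree that served the kernel proof of the homology of a Lefschetz handlebody; route bookkeeping of the source docstring (stub /
crux / item / wave names) is historical.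

In the Mayer–Vietoris computation of `H₁(V ∪ H² ∪ ⋯ ∪ H²)` (Gompf–Stipsicz 1999, §4.4:
`H₁(X ∪ 2-handles) = H₁(X)/⟨attaching circles⟩`) the overlap of the base piece with the `i`-th handle
piece is the punctured tube `T ∖ S ≃ S¹ × (open 3-cell)`, whose fundamental group is infinite cyclic on a
parallel copy of the attaching circle (`TwoHandleTubeDeformation*.lean`, `TwoHandleAttachmentPi1.lean`:
strong deformation retraction onto the parallel circle, `zpowers_liftPath_eq_top_of_simpleClosed`).  The
passage from `π₁` to `H₁` is Hurewicz in degree one (Hatcher 2002, Thm. 2A.1; tree: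
`HurewiczOne.lean`, `LoopClassesSpan.lean`):

* `span_loopClass_eq_top_of_zpow` — **if every loop at `x₀` is homotopic to a power of the loop `L`
  (in `π₁(X, x₀)`), then `H₁(X; R) = R ∙ h(L)`** (loop classes span `H₁`, and `h` is a homomorphism);
* `range_map_one_eq_span` — hence **the image of `f_* : H₁(X; R) → H₁(Y; R)` is `R ∙ h(f ∘ L)`**
  (naturality of `h`): the image of `H₁(A ∩ Bᵢ)` in `H₁(A)` is the span of the attaching class;
* `ker_comp_eq_sup`, `nonempty_equiv_quot_of_surjective`, `nonempty_equiv_quot_congr` — composing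
  the one-handle steps `H₁(X_s) ↠ H₁(X_s ∪ Bᵢ)` (kernel = image of the span pushed forward) into
  **`H₁(X) ≅ H₁(A) ⧸ ⨆ᵢ R ∙ (attaching class i)`**;
* §3 the registered sub-goal stub `stub_multiAttachment_loopSpan`.

Everything is proved; no named facts, no `sorry`, no definitions.  References: A. Hatcher,
*Algebraic Topology* (2002), Thm. 2A.1, §2.2 p. 149 [HatcherAT2002]; R. E. Gompf, A. I. Stipsicz,
*4-Manifolds and Kirby Calculus* (1999), §4.4 [GompfStipsicz1999].
-/

section Part2

open _root_.Set _root_.Function _root_.CategoryTheory _root_.CategoryTheory.Limits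
open Literature.AlgebraicTopology.SingularHomology

namespace Literature.Topology.FourManifolds.LefschetzHandlebodyHomology

universe u v w

/-! ## §1 Hurewicz: `H₁` of a space with cyclic `π₁` -/

section Hurewicz

variable (R : Type v) [CommRing R] {X Y : Type u} [TopologicalSpace X] [TopologicalSpace Y]

/-- **If every loop at `x₀` is a power of `L` in `π₁(X, x₀)` then `H₁(X; R)` is spanned by the
Hurewicz class of `L`** (loop classes span `H₁` of a path-connected space, Hatcher Thm. 2A.1, and
`h(γ) = h(Lⁿ) = n • h(L)`). [cite: HatcherAT2002, Thm. 2A.1] -/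
theorem span_loopClass_eq_top_of_zpow [PathConnectedSpace X] {x₀ : X} (L : Path x₀ x₀)
    (hL : ∀ γ : Path x₀ x₀, ∃ n : ℤ, FundamentalGroup.fromPath (Path.Homotopic.Quotient.mk γ) =
      FundamentalGroup.fromPath (Path.Homotopic.Quotient.mk L) ^ n) :
    Submodule.span R {loopClass R R (1 : R) L} = ⊤ := by
  rw [eq_top_iff, ← HurewiczProof.span_loopClass_eq_top x₀, Submodule.span_le]
  rintro _ ⟨γ, rfl⟩
  obtain ⟨n, hn⟩ := hL γ
  have h := congrArg (fun g => Multiplicative.toAdd (hurewiczOne R R (1 : R) x₀ g)) hn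
  simp only [map_zpow, hurewiczOne_fromPath, toAdd_ofAdd, toAdd_zpow] at h
  show loopClass R R (1 : R) γ ∈ Submodule.span R {loopClass R R (1 : R) L}
  rw [h]
  exact zsmul_mem (Submodule.subset_span (mem_singleton _)) n

/-- **The image of `f_* : H₁(X; R) → H₁(Y; R)` is the span of `h(f ∘ L)`** when every loop at
`x₀` is a power of `L` in `π₁(X, x₀)` (naturality of the Hurewicz class, `map_loopClass`).
[cite: HatcherAT2002, Thm. 2A.1] -/
theorem range_map_one_eq_span [PathConnectedSpace X] {x₀ : X} (L : Path x₀ x₀)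
    (hL : ∀ γ : Path x₀ x₀, ∃ n : ℤ, FundamentalGroup.fromPath (Path.Homotopic.Quotient.mk γ) =
      FundamentalGroup.fromPath (Path.Homotopic.Quotient.mk L) ^ n) (f : C(X, Y)) :
    LinearMap.range (singularHomology.map R R f 1).hom =
      Submodule.span R {loopClass R R (1 : R) (L.map f.continuous)} := by
  rw [LinearMap.range_eq_map, ← span_loopClass_eq_top_of_zpow R L hL, Submodule.map_span,
    image_singleton]
  congr 2
  exact map_loopClass R R (1 : R) L f

/-- Freely homotopic loops (through a homotopy of based loops after reparametrisation are not
needed): **loops that agree as maps have the same Hurewicz class**, the form in which a parallel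
circle pushed into the manifold is compared with the attaching circle after a deformation.
[cite: HatcherAT2002, Thm. 2A.1] -/
theorem loopClass_eq_of_coe_eq {x y : X} (γ : Path x x) (γ' : Path y y)
    (h : (γ : unitInterval → X) = γ') : loopClass R R (1 : R) γ = loopClass R R (1 : R) γ' := by
  apply loopClass_eq_of_ofPath_eq
  obtain rfl : x = y := by
    have := congrFun h 0
    simpa using this
  have : γ = γ' := Path.ext h
  rw [this]

end Hurewicz

/-! ## §2 Quotient bookkeeping for iterated one-handle steps -/

section Algebra

variable {R : Type v} [CommRing R] {P Q T : Type*} [AddCommGroup P] [Module R P]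
  [AddCommGroup Q] [Module R Q] [AddCommGroup T] [Module R T]

/-- **Composing two steps.**  If `F : P → Q` has kernel `N` and `G : Q → T` has kernel the image
`F(N')` of a submodule `N' ≤ P`, then `G ∘ F` has kernel `N' ⊔ N`. [cite: HatcherAT2002, Thm. 2A.1] -/
theorem ker_comp_eq_sup {F : P →ₗ[R] Q} {G : Q →ₗ[R] T} {N N' : Submodule R P}
    (hF : LinearMap.ker F = N) (hG : LinearMap.ker G = Submodule.map F N') :
    LinearMap.ker (G ∘ₗ F) = N' ⊔ N := by
  rw [LinearMap.ker_comp, hG, Submodule.comap_map_eq, hF]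

/-- **A surjection with known kernel is a quotient map**: `Q ≃ P ⧸ N` (the form `Nonempty (_ ≃ₗ _)`
of NF5's clause 2). [cite: HatcherAT2002, Thm. 2A.1] -/
theorem nonempty_equiv_quot_of_surjective {F : P →ₗ[R] Q} {N : Submodule R P}
    (hs : Function.Surjective F) (hk : LinearMap.ker F = N) : Nonempty (Q ≃ₗ[R] P ⧸ N) :=
  ⟨(F.quotKerEquivOfSurjective hs).symm.trans (Submodule.quotEquivOfEq _ _ hk)⟩

/-- Transport of a quotient description along linear isomorphisms of source and target: if
`Q ≃ P ⧸ N`, `P ≃ P'` carrying `N` to `N'`, and `Q ≃ Q'`, then `Q' ≃ P' ⧸ N'`. [cite: HatcherAT2002, Thm. 2A.1] -/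
theorem nonempty_equiv_quot_congr {P' Q' : Type*} [AddCommGroup P'] [Module R P'] [AddCommGroup Q']
    [Module R Q'] {N : Submodule R P} {N' : Submodule R P'} (h : Nonempty (Q ≃ₗ[R] P ⧸ N))
    (eP : P ≃ₗ[R] P') (eQ : Q ≃ₗ[R] Q') (hN : Submodule.map (eP : P →ₗ[R] P') N = N') :
    Nonempty (Q' ≃ₗ[R] P' ⧸ N') :=
  ⟨(eQ.symm.trans h.some).trans (Submodule.Quotient.equiv N N' eP hN)⟩

end Algebra

end Literature.Topology.FourManifolds.LefschetzHandlebodyHomology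

end Part2

/-!
## Part 3 — port of `Summits/SmoothPoincare4/SmoothPoincare4/Theorems/ConvexBisectionAcyclicBisectionExistsMultiAttachmentH1Model.lean` (38 declarations kept)

# The punctured tube of a 4-dimensional 2-handle: its loops are powers of a parallel of the
# attaching circle, and the parallel has the Hurewicz class of the attaching circle

Verbatim declaration-level port (the declarations listed in the Part header count) of a helper module of the SmoothPoincare4
tree that served the kernel proof of the homology of a Lefschetz handlebody; route bookkeeping of the source docstring (stub /
crux / item / wave names) is historical.

Port to dimension four (`handleTube 3 2`, `TwoHandleTubeDeformationFour.lean`) of §1 and §3 of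
`TwoHandleAttachmentPi1.lean` (which treats `handleTube 4 2`), in the form consumed by the
Mayer–Vietoris computation of `H₁` of a multi-attachment:

* §1 `tubeCirclePt c θ = (c θ, 0) ∈ T` (radius clamped to `[1/2, 1]`), the parallel loop
  `parallelLoop = loopPath (tubeCirclePt ½)` and its bookkeeping (it runs on the parallel circle
  `K_{1/2}`, exhausts it, and is simple closed);
* §2 **`exists_fromPath_eq_parallelLoop_zpow`** — every loop of the punctured tube
  `T ∖ S = {|x_λ| ≠ 1}` at the base point of the parallel loop is a power of it in `π₁` (`K_{1/2}`
  is a strong deformation retract of `T ∖ S`, Hatcher Prop. 1.17, and `π₁` of a simple closed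
  curve is generated by it, Thm. 1.7) — the hypothesis shape of `range_map_one_eq_span`
  (`…MultiAttachmentHomologyLoops.lean`);
* §3 **`loopClass_parallel_eq_loopClass_attachingCircle`** — for an attaching map
  `h̄ : T → V`, the loop `h̄ ∘ parallelLoop` and the attaching loop
  `loopPath h̄.attachingCircle` have the same Hurewicz class in `H₁(V; R)` (they are images of one
  loop of `𝕊¹` under homotopic maps `θ ↦ h̄(c θ, 0)`, `c ∈ [1/2, 1]`);
* §4 the registered sub-goal stub `stub_multiAttachment_tubeModel` (§2 ∧ §3).

Everything is proved; no named facts, no `sorry`.  References: A. Hatcher, *Algebraic Topology*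
(2002), Thm. 1.7, Prop. 1.17, Thm. 2A.1 [HatcherAT2002]; A. A. Kosinski, *Differential Manifolds*
(1993), VI §6 [Kosinski1993]; R. E. Gompf, A. I. Stipsicz, *4-Manifolds and Kirby Calculus*
(1999), §4.4 [GompfStipsicz1999].
-/

section Part3

open scoped _root_.Manifold _root_.ContDiff _root_.Topology unitInterval
open _root_.Set _root_.Function _root_.Metric _root_.CategoryTheory
open Literature.AlgebraicTopology.SingularHomology Literature.AlgebraicTopology.Homotopy
open Literature.AlgebraicTopology.FundamentalGroup Literature.AlgebraicTopology.FundamentalGroup.VanKampen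
open Literature.Topology.FourManifolds Literature.Topology.FourManifolds.HandleShrink
open Literature.Topology.FourManifolds.LefschetzBase (loopPath)

namespace Literature.Topology.FourManifolds.LefschetzHandlebodyHomology

universe u v

/-! ## §1 The parallel circles `K_c = {(c θ, 0)}` of the tube `T ⊆ D⁴` -/

/-- The radius, clamped to `[1/2, 1]`. [folklore] -/
private def clampR (c : ℝ) : ℝ := max 2⁻¹ (min c 1)

/-- `1/2 ≤ clampR c`. [cite: Kosinski1993, VI §6] -/
theorem half_le_clampR (c : ℝ) : 2⁻¹ ≤ clampR c := le_max_left _ _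

/-- `clampR c ≤ 1`. [cite: Kosinski1993, VI §6] -/
theorem clampR_le_one (c : ℝ) : clampR c ≤ 1 := max_le (by norm_num) (min_le_right _ _)

/-- `0 < clampR c`. [cite: Kosinski1993, VI §6] -/
theorem clampR_pos (c : ℝ) : 0 < clampR c := lt_of_lt_of_le (by norm_num) (half_le_clampR c)

/-- `clampR` is continuous. [cite: Kosinski1993, VI §6] -/
theorem continuous_clampR : Continuous clampR :=
  continuous_const.max (continuous_id.min continuous_const)

/-- `clampR ½ = ½`. [cite: Kosinski1993, VI §6] -/
@[simp] theorem clampR_half : clampR 2⁻¹ = 2⁻¹ := by norm_num [clampR]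

/-- `clampR 1 = 1`. [cite: Kosinski1993, VI §6] -/
@[simp] theorem clampR_one : clampR 1 = 1 := by norm_num [clampR]

/-- **The point `(c θ, 0)` of the parallel circle `K_c ⊆ T`** (`c` clamped to `[1/2, 1]`; for
`c = 1` this is the point `coreTubePt θ` of the attaching circle `S`). [cite: Kosinski1993, VI §6] -/
private def tubeCirclePt (c : ℝ) (θ : sphere (0 : EuclideanSpace ℝ (Fin 2)) 1) : ↥(handleTube 3 2) :=
  ⟨⟨clampR c • corePt θ, by
      rw [mem_closedBall_zero_iff, norm_smul, norm_corePt, mul_one, Real.norm_eq_abs,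
        abs_of_pos (clampR_pos c)]
      exact clampR_le_one c⟩, by
    rw [mem_handleTube]
    show lamSq 2 (clampR c • corePt θ) ≠ 0
    rw [lamSq_smul, lamSq_corePt, mul_one]
    exact (pow_pos (clampR_pos c) 2).ne'⟩

/-- The underlying vector of `tubeCirclePt c θ` is `clampR c • corePt θ`. [cite: Kosinski1993, VI §6] -/
@[simp] theorem coe_coe_tubeCirclePt (c : ℝ) (θ : sphere (0 : EuclideanSpace ℝ (Fin 2)) 1) :
    (tubeCirclePt c θ).1.1 = clampR c • corePt θ := rfl

/-- `|·|_λ² = c²` on `K_c`. [cite: Kosinski1993, VI §6] -/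
theorem lamSq_tubeCirclePt (c : ℝ) (θ : sphere (0 : EuclideanSpace ℝ (Fin 2)) 1) :
    lamSq 2 (tubeCirclePt c θ).1.1 = clampR c ^ 2 := by
  rw [coe_coe_tubeCirclePt, lamSq_smul, lamSq_corePt, mul_one]

/-- `x_μ = 0` on `K_c`. [cite: Kosinski1993, VI §6] -/
theorem muSq_tubeCirclePt (c : ℝ) (θ : sphere (0 : EuclideanSpace ℝ (Fin 2)) 1) :
    muSq 2 (tubeCirclePt c θ).1.1 = 0 := by
  rw [coe_coe_tubeCirclePt, ← blockScale_self_eq_smul, muSq_blockScale, muSq_corePt, mul_zero]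

/-- `K_c` misses the attaching circle `S = {|x_λ| = 1}` for `c < 1`, in particular for `c = ½`.
[cite: Kosinski1993, VI §6] -/
theorem lamSq_tubeCirclePt_half_ne_one (θ : sphere (0 : EuclideanSpace ℝ (Fin 2)) 1) :
    lamSq 2 (tubeCirclePt 2⁻¹ θ).1.1 ≠ 1 := by
  rw [lamSq_tubeCirclePt, clampR_half]; norm_num

/-- `tubeCirclePt 1 θ` is the point `coreTubePt θ` of the attaching circle. [cite: Kosinski1993, VI §6] -/
theorem tubeCirclePt_one (θ : sphere (0 : EuclideanSpace ℝ (Fin 2)) 1) :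
    tubeCirclePt 1 θ = coreTubePt θ := by
  apply Subtype.ext; apply Subtype.ext
  rw [coe_coe_tubeCirclePt, clampR_one, one_smul, coe_coe_coreTubePt]

/-- `(c, θ) ↦ tubeCirclePt c θ` is jointly continuous. [cite: Kosinski1993, VI §6] -/
theorem continuous_tubeCirclePt :
    Continuous fun p : ℝ × sphere (0 : EuclideanSpace ℝ (Fin 2)) 1 => tubeCirclePt p.1 p.2 :=
  (((continuous_clampR.comp continuous_fst).smul
    (continuous_corePt.comp continuous_snd)).subtype_mk _).subtype_mk _

/-- Every point of `K_{clampR c}` is `tubeCirclePt c θ` for the point `θ = x_λ/c ∈ S¹`. [cite: Kosinski1993, VI §6] -/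
theorem exists_tubeCirclePt_eq (c : ℝ) {y : ↥(handleTube 3 2)} (hl : lamSq 2 y.1.1 = clampR c ^ 2)
    (hm : muSq 2 y.1.1 = 0) : ∃ θ, tubeCirclePt c θ = y := by
  set u : EuclideanSpace ℝ (Fin 4) := y.1.1 with hu
  have hc := clampR_pos c
  have h2 : u 2 = 0 := apply_eq_zero_of_muSq_eq_zero hm (i := 2) (by norm_num)
  have h3 : u 3 = 0 := apply_eq_zero_of_muSq_eq_zero hm (i := 3) (by norm_num)
  rw [lamSq_two_fin_four] at hl
  let v : EuclideanSpace ℝ (Fin 2) := WithLp.toLp 2 ![u 0 / clampR c, u 1 / clampR c]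
  have hv : ‖v‖ = 1 := by
    have : ‖v‖ ^ 2 = 1 := by
      rw [EuclideanSpace.norm_sq_eq, Fin.sum_univ_two, Real.norm_eq_abs, Real.norm_eq_abs,
        sq_abs, sq_abs]
      simp only [v]
      rw [Matrix.cons_val_zero, Matrix.cons_val_one, Matrix.cons_val_zero, div_pow, div_pow,
        ← add_div, hl, div_self (pow_pos hc 2).ne']
    nlinarith [norm_nonneg v]
  refine ⟨⟨v, mem_sphere_zero_iff_norm.2 hv⟩, ?_⟩
  apply Subtype.ext; apply Subtype.ext
  rw [coe_coe_tubeCirclePt]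
  ext i
  fin_cases i
  · show clampR c * (u 0 / clampR c) = u 0
    field_simp
  · show clampR c * (u 1 / clampR c) = u 1
    field_simp
  · show clampR c * 0 = u 2
    rw [h2, mul_zero]
  · show clampR c * 0 = u 3
    rw [h3, mul_zero]

/-- Every point of `S¹` is `circlePt t` for some `t ∈ [0, 1]`. [cite: Kosinski1993, VI §6] -/
theorem exists_circlePt_eq (θ : sphere (0 : EuclideanSpace ℝ (Fin 2)) 1) : ∃ t : I, circlePt t = θ := by
  obtain ⟨t, ht⟩ := mem_range_euclideanCircleLoop ⟨(θ : EuclideanSpace ℝ (Fin 2)),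
    mem_closedBall_zero_iff.2 (norm_eq_of_mem_sphere θ).le⟩ (norm_eq_of_mem_sphere θ)
  refine ⟨t, Subtype.ext ?_⟩
  have ht' := congrArg (fun x : closedBall (0 : EuclideanSpace ℝ (Fin 2)) 1 =>
    (x : EuclideanSpace ℝ (Fin 2))) ht
  simp only [euclideanCircleLoop_apply_coe] at ht'
  rw [← ht']
  ext i
  fin_cases i
  · simp [circlePt_apply_zero]
  · simp [circlePt_apply_one]

/-- `circlePt` is injective on `[0, 1]` except for `circlePt 0 = circlePt 1`. [cite: Kosinski1993, VI §6] -/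
theorem circlePt_eq_iff (s t : I) (h : circlePt s = circlePt t) :
    s = t ∨ (s = 0 ∧ t = 1) ∨ (s = 1 ∧ t = 0) := by
  apply euclideanCircleLoop_eq_iff
  apply Subtype.ext
  rw [euclideanCircleLoop_apply_coe, euclideanCircleLoop_apply_coe]
  have h0 := congrArg (fun θ : sphere (0 : EuclideanSpace ℝ (Fin 2)) 1 =>
    (θ : EuclideanSpace ℝ (Fin 2)) 0) h
  have h1 := congrArg (fun θ : sphere (0 : EuclideanSpace ℝ (Fin 2)) 1 =>
    (θ : EuclideanSpace ℝ (Fin 2)) 1) h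
  simp only [circlePt_apply_zero, circlePt_apply_one] at h0 h1
  ext i
  fin_cases i
  · simpa using h0
  · simpa using h1

/-! ## §2 Loops of the punctured tube are powers of the parallel loop -/

/-- **The parallel loop** `t ↦ (½ cos 2πt, ½ sin 2πt, 0, 0)` of the tube, once around the parallel
circle `K_{1/2}`. [cite: Kosinski1993, VI §6] -/
private def parallelLoop : Path (tubeCirclePt 2⁻¹ (circlePt 0)) (tubeCirclePt 2⁻¹ (circlePt 0)) :=
  loopPath (tubeCirclePt 2⁻¹) (continuous_tubeCirclePt.comp (Continuous.prodMk_right _))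

/-- The parallel loop on points. [cite: Kosinski1993, VI §6] -/
@[simp] theorem parallelLoop_apply (t : I) : parallelLoop t = tubeCirclePt 2⁻¹ (circlePt t) := rfl

/-- The punctured tube `T ∖ S = {|x_λ| ≠ 1}`. [cite: Kosinski1993, VI §6] -/
private def puncturedTube : Set ↥(handleTube 3 2) := {y | lamSq 2 y.1.1 ≠ 1}

/-- The parallel circle `K_{1/2} = {|x_λ| = ½, x_μ = 0}`. [cite: Kosinski1993, VI §6] -/
private def parallelCircle : Set ↥(handleTube 3 2) :=
  {y | lamSq 2 y.1.1 = (2⁻¹ : ℝ) ^ 2 ∧ muSq 2 y.1.1 = 0}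

/-- The parallel loop runs on the parallel circle. [cite: Kosinski1993, VI §6] -/
theorem parallelLoop_mem_parallelCircle (t : I) : parallelLoop t ∈ parallelCircle := by
  refine ⟨?_, muSq_tubeCirclePt _ _⟩
  show lamSq 2 (tubeCirclePt 2⁻¹ (circlePt t)).1.1 = _
  rw [lamSq_tubeCirclePt, clampR_half]

/-- The parallel circle lies in the punctured tube. [cite: Kosinski1993, VI §6] -/
theorem parallelCircle_subset_puncturedTube : parallelCircle ⊆ puncturedTube := by
  rintro y ⟨hy, -⟩
  show lamSq 2 y.1.1 ≠ 1
  rw [hy]; norm_num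

/-- The parallel loop runs in the punctured tube. [cite: Kosinski1993, VI §6] -/
theorem parallelLoop_mem_puncturedTube (t : I) : parallelLoop t ∈ puncturedTube :=
  parallelCircle_subset_puncturedTube (parallelLoop_mem_parallelCircle t)

/-- The base point of the parallel loop lies in the punctured tube. [cite: Kosinski1993, VI §6] -/
theorem base_mem_puncturedTube : tubeCirclePt 2⁻¹ (circlePt 0) ∈ puncturedTube :=
  lamSq_tubeCirclePt_half_ne_one _

/-- The base point of the parallel loop lies on the parallel circle. [cite: Kosinski1993, VI §6] -/
theorem base_mem_parallelCircle : tubeCirclePt 2⁻¹ (circlePt 0) ∈ parallelCircle := by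
  simpa using parallelLoop_mem_parallelCircle 0

/-- The parallel loop exhausts the parallel circle. [cite: Kosinski1993, VI §6] -/
theorem parallelCircle_subset_range_parallelLoop : parallelCircle ⊆ range parallelLoop := by
  rintro y ⟨hl, hm⟩
  obtain ⟨θ, rfl⟩ := exists_tubeCirclePt_eq 2⁻¹ (by rwa [clampR_half]) hm
  obtain ⟨t, rfl⟩ := exists_circlePt_eq θ
  exact ⟨t, rfl⟩

/-- The parallel loop is simple closed (injective on `[0, 1)`). [cite: Kosinski1993, VI §6] -/
theorem parallelLoop_eq_iff (s t : I) (h : parallelLoop s = parallelLoop t) :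
    s = t ∨ (s = 0 ∧ t = 1) ∨ (s = 1 ∧ t = 0) := by
  apply circlePt_eq_iff
  have h1 := congrArg (fun y : ↥(handleTube 3 2) => y.1.1) h
  simp only [parallelLoop_apply, coe_coe_tubeCirclePt] at h1
  exact injective_corePt (smul_right_injective _ (clampR_pos 2⁻¹).ne' h1)

/-- **Every loop of the punctured tube `T ∖ S` at the base point of the parallel loop is a power
of the parallel loop in `π₁(T ∖ S)`**: `K_{1/2}` is a strong deformation retract of `T ∖ S`
(`isStrongDeformationRetractOf_parallel₄_of_lt`), so `π₁(K_{1/2}) → π₁(T ∖ S)` is onto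
(Hatcher Prop. 1.17), and `π₁` of the simple closed curve `K_{1/2}` is generated by the parallel
loop (Thm. 1.7). [cite: HatcherAT2002, Thm. 1.7 and Prop. 1.17] -/
theorem exists_fromPath_eq_parallelLoop_zpow
    (γ : Path (⟨tubeCirclePt 2⁻¹ (circlePt 0), base_mem_puncturedTube⟩ : ↥puncturedTube)
      ⟨tubeCirclePt 2⁻¹ (circlePt 0), base_mem_puncturedTube⟩) :
    ∃ n : ℤ, FundamentalGroup.fromPath (Path.Homotopic.Quotient.mk γ) =
      FundamentalGroup.fromPath (Path.Homotopic.Quotient.mk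
        (liftPath puncturedTube parallelLoop parallelLoop_mem_puncturedTube)) ^ n := by
  -- `π₁(K, b)` is generated by the parallel loop
  have hgen := zpowers_liftPath_eq_top_of_simpleClosed parallelLoop parallelLoop_eq_iff
    parallelLoop_mem_parallelCircle parallelCircle_subset_range_parallelLoop base_mem_parallelCircle
  -- `π₁(K, b) → π₁(T ∖ S, b)` is onto
  have hsdr : IsStrongDeformationRetractOf parallelCircle puncturedTube :=
    isStrongDeformationRetractOf_parallel₄_of_lt (c := 2⁻¹) (by norm_num) (by norm_num)
  have hsurj := (bijective_inclHomOfSubset_of_isStrongDeformationRetractOf hsdr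
    parallelCircle_subset_puncturedTube base_mem_parallelCircle).2
  obtain ⟨c, hc⟩ := hsurj (FundamentalGroup.fromPath (Path.Homotopic.Quotient.mk γ))
  have hc' : c ∈ Subgroup.zpowers (FundamentalGroup.fromPath (Path.Homotopic.Quotient.mk
      (liftPath parallelCircle parallelLoop parallelLoop_mem_parallelCircle))) := by
    rw [hgen]; exact Subgroup.mem_top c
  obtain ⟨n, rfl⟩ := Subgroup.mem_zpowers_iff.1 hc'
  refine ⟨n, ?_⟩
  rw [← hc, map_zpow, inclHomOfSubset_fromPath_liftPath]

/-! ## §3 The parallel loop has the Hurewicz class of the attaching circle -/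

section Hurewicz

variable (R : Type v) [CommRing R] {V : Type u} [TopologicalSpace V]

/-- Loops that agree as maps `[0, 1] → V` have the same Hurewicz class (no base-point
bookkeeping). [cite: Kosinski1993, VI §6] -/
theorem loopClass_congr_coe {x y : V} (γ : Path x x) (γ' : Path y y) (h : (γ : I → V) = γ') :
    loopClass R R (1 : R) γ = loopClass R R (1 : R) γ' := by
  apply loopClass_eq_of_ofPath_eq
  obtain rfl : x = y := by simpa using congrFun h 0
  rw [show γ = γ' from Path.ext h]

/-- The circle, lifted to the universe of `V` (singular homology is functorial within one
universe). [folklore] -/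
private abbrev LCircle : Type u := ULift.{u} ↥(sphere (0 : EuclideanSpace ℝ (Fin 2)) 1)

/-- A map of the circle read on the lifted circle. [folklore] -/
private def liftCircleMap (K : C(sphere (0 : EuclideanSpace ℝ (Fin 2)) 1, V)) : C(LCircle.{u}, V) :=
  K.comp ⟨ULift.down, continuous_uliftDown⟩

/-- The Hurewicz class of the unit-period loop of `K : 𝕊¹ → V` is `K_*` of that of the
unit-period loop of the (lifted) circle (naturality `K_* h(ω) = h(K ∘ ω)`). [cite: HatcherAT2002, Thm. 2A.1] -/
theorem loopClass_loopPath_eq_map (K : C(sphere (0 : EuclideanSpace ℝ (Fin 2)) 1, V)) :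
    loopClass R R (1 : R) (loopPath K K.continuous) =
      singularHomology.map R R (liftCircleMap K) 1 (loopClass R R (1 : R)
        (loopPath (ULift.up : sphere (0 : EuclideanSpace ℝ (Fin 2)) 1 → LCircle.{u})
          continuous_uliftUp)) := by
  rw [map_loopClass]
  exact loopClass_congr_coe R _ _ (funext fun _ => rfl)

/-- **Homotopic maps of the circle have unit-period loops with the same Hurewicz class**
(naturality and homotopy invariance of `K_*`). [cite: HatcherAT2002, Thm. 2A.1] -/
theorem loopClass_loopPath_eq_of_homotopic {K₀ K₁ : C(sphere (0 : EuclideanSpace ℝ (Fin 2)) 1, V)}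
    (h : K₀.Homotopic K₁) :
    loopClass R R (1 : R) (loopPath K₀ K₀.continuous) =
      loopClass R R (1 : R) (loopPath K₁ K₁.continuous) := by
  have h' : (liftCircleMap K₀).Homotopic (liftCircleMap K₁) :=
    h.comp (ContinuousMap.Homotopic.refl _)
  rw [loopClass_loopPath_eq_map, loopClass_loopPath_eq_map, singularHomology.map_eq_of_homotopic R R h']

variable [ChartedSpace (EuclideanHalfSpace (3 + 1)) V]

/-- The loop `h̄ ∘ (c θ, 0)` of an attaching map over the parallel circle `K_c`, as a map of `𝕊¹`.
[cite: Kosinski1993, VI §6] -/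
private def tubeCircleMap (g : HandleAttachingMap 3 2 V) (c : ℝ) :
    C(sphere (0 : EuclideanSpace ℝ (Fin 2)) 1, V) :=
  ⟨fun θ => g.toFun (tubeCirclePt c θ),
    g.continuous.comp (continuous_tubeCirclePt.comp (Continuous.prodMk_right c))⟩

/-- **The radial homotopy `(r, θ) ↦ h̄(((1 + r)/2) θ, 0)` inside the tube** from the parallel
`h̄ ∘ K_{1/2}` to the attaching circle `h̄ ∘ K_1`. [cite: Kosinski1993, VI §6] -/
private def tubeCircleHomotopy (g : HandleAttachingMap 3 2 V) :
    (tubeCircleMap g 2⁻¹).Homotopy ⟨g.attachingCircle, g.continuous_attachingCircle⟩ where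
  toFun p := g.toFun (tubeCirclePt ((1 + (p.1 : ℝ)) / 2) p.2)
  continuous_toFun := g.continuous.comp (continuous_tubeCirclePt.comp
    ((((continuous_const.add (continuous_subtype_val.comp continuous_fst)).div_const _)).prodMk
      continuous_snd))
  map_zero_left θ := by
    show g.toFun (tubeCirclePt ((1 + 0) / 2) θ) = g.toFun (tubeCirclePt 2⁻¹ θ)
    norm_num
  map_one_left θ := by
    show g.toFun (tubeCirclePt ((1 + 1) / 2) θ) = g.toFun (coreTubePt θ)
    rw [← tubeCirclePt_one]; norm_num

/-- **The parallel loop `h̄ ∘ parallelLoop` has the Hurewicz class of the attaching loop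
`loopPath h̄.attachingCircle` in `H₁(V; R)`.** [cite: HatcherAT2002, Thm. 2A.1] -/
theorem loopClass_parallel_eq_loopClass_attachingCircle (g : HandleAttachingMap 3 2 V) :
    loopClass R R (1 : R) (parallelLoop.map g.continuous) =
      loopClass R R (1 : R) (loopPath g.attachingCircle g.continuous_attachingCircle) := by
  have h := loopClass_loopPath_eq_of_homotopic R ⟨tubeCircleHomotopy g⟩
  exact h

end Hurewicz

/-! ## §4 The registered sub-goal stub -/

/-- **The tube model of the multi-attachment `H₁` engine** (registered sub-goal stub
`stub_multiAttachment_tubeModel` of `stub_isLefschetzHandlebody_homology`): there is a loop `L`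
in the punctured tube `T ∖ S = {|x_λ| ≠ 1}` of a 4-dimensional 2-handle (the parallel
`K_{1/2}` of the attaching circle, once around) such that (i) every loop of `T ∖ S` at its base
point is a power of `L` in `π₁(T ∖ S)`, and (ii) for every attaching map `h̄ : T → V` the loop
`h̄ ∘ L` has the Hurewicz class of the attaching loop `loopPath h̄.attachingCircle` in `H₁(V; R)`.
With `range_map_one_eq_span` this identifies the image of `H₁` of the gluing region
`jA(V ∖ ⋃ cores) ∩ jBᵢ(D⁴ ∖ S) ≅ T ∖ S` of the `i`-th handle as the span of the `i`-th attaching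
class (Gompf–Stipsicz 1999, §4.4). [cite: HatcherAT2002, Thm. 1.7, Prop. 1.17, Thm. 2A.1] -/
theorem stub_multiAttachment_tubeModel :
    ∃ (y₀ : ↥{y : ↥(Literature.Topology.FourManifolds.handleTube 3 2) |
        Literature.Topology.FourManifolds.lamSq 2 y.1.1 ≠ 1}) (L : Path y₀ y₀),
      (∀ γ : Path y₀ y₀, ∃ n : ℤ, FundamentalGroup.fromPath (Path.Homotopic.Quotient.mk γ) =
        FundamentalGroup.fromPath (Path.Homotopic.Quotient.mk L) ^ n) ∧
      ∀ (R : Type) [CommRing R] (V : Type) [TopologicalSpace V]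
        [ChartedSpace (EuclideanHalfSpace (3 + 1)) V]
        (h : Literature.Topology.FourManifolds.HandleAttachingMap 3 2 V),
        Literature.AlgebraicTopology.SingularHomology.loopClass R R (1 : R)
            (L.map (h.continuous.comp continuous_subtype_val)) =
          Literature.AlgebraicTopology.SingularHomology.loopClass R R (1 : R)
            (Literature.Topology.FourManifolds.LefschetzBase.loopPath h.attachingCircle
              h.continuous_attachingCircle) := by
  refine ⟨⟨tubeCirclePt 2⁻¹ (circlePt 0), base_mem_puncturedTube⟩,
    liftPath puncturedTube parallelLoop parallelLoop_mem_puncturedTube,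
    exists_fromPath_eq_parallelLoop_zpow, fun R _ V _ _ h => ?_⟩
  rw [← loopClass_parallel_eq_loopClass_attachingCircle R h]
  exact loopClass_congr_coe R _ _ (funext fun _ => rfl)

end Literature.Topology.FourManifolds.LefschetzHandlebodyHomology

end Part3

/-!
## Part 4 — port of `Summits/SmoothPoincare4/SmoothPoincare4/Theorems/ConvexBisectionAcyclicBisectionExistsMultiAttachmentHomologyMV.lean` (26 declarations kept)

# Mayer–Vietoris for gluing an acyclic open piece: `H₁(U) → H₁(U ∪ W)` is onto with kernel the
# image of `H₁(U ∩ W)`; `Hₖ₊₁(U) ≅ Hₖ₊₁(U ∪ W)` when `Hₖ(U ∩ W) → Hₖ(U)` is injective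

Verbatim declaration-level port (the declarations listed in the Part header count) of a helper module of the SmoothPoincare4
tree that served the kernel proof of the homology of a Lefschetz handlebody; route bookkeeping of the source docstring (stub /
crux / item / wave names) is historical.

A Kosinski multi-attachment `X = V ∪ H² ∪ ⋯ ∪ H²` of 4-dimensional 2-handles
(`HandleAttachingMap.IsMultiAttachment`, Kosinski 1993 VI §6) is covered by the open sets
`A = jA(V ∖ ⋃ cores)` and `Bᵢ = jBᵢ(D⁴ ∖ S)` (star-shaped, hence acyclic), with `A ∩ Bᵢ ≅ T ∖ S`
a thickened circle carrying the `i`-th attaching class and the `Bᵢ` pairwise disjoint; its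
homology is computed one handle at a time by the following statements about an open cover
`Y = A ∪ B` with `B` acyclic (Hatcher 2002, §2.2 p. 149: the exact Mayer–Vietoris sequence
`Hₙ₊₁(A ∩ B) →φ Hₙ₊₁(A) ⊕ Hₙ₊₁(B) →ψ Hₙ₊₁(Y) →δ Hₙ(A ∩ B) →φ Hₙ(A) ⊕ Hₙ(B)`, the tree's
`mayerVietoris.exact₁/₂/₃_holds`):
* §1 (cover of a type): `surjective_map_of_mono_φ` (`Hₙ₊₁(B) = 0`, `φₙ` injective ⇒
  `Hₙ₊₁(A) → Hₙ₊₁(Y)` onto), `ker_map_eq_range` (`Hₙ₊₁(B) = 0` ⇒ its kernel is the image of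
  `Hₙ₊₁(A ∩ B)`), `mono_map_of_isZero_inter`, `isIso_map_of_isZero_of_mono`, and `φₙ` is injective
  as soon as one component is (`mono_φ_of_mono_left/right`, `mono_φ_zero`);
* §2 (two open subsets `U`, `W` of a space `X`, transported to the inclusions
  `U ∩ W ⊆ U ⊆ U ∪ W`): **`surjective_map_one_union`, `ker_map_one_union`** — for `W`, `U ∩ W`
  path connected and `H₁(W) = 0`, `H₁(U ∪ W) ≅ H₁(U)/⟨image of H₁(U ∩ W)⟩` (the homological
  shadow of van Kampen with a simply connected piece); **`isIso_map_succ_union`**,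
  `mono_map_succ_union` (higher degrees);
* §3 the registered sub-goal stub `stub_multiAttachment_mvStep` (§2 in degree one).

Everything is proved; no named facts, no `sorry`.  References: A. Hatcher, *Algebraic Topology*,
CUP (2002), §2.2 pp. 149–150 [HatcherAT2002]; A. A. Kosinski, *Differential Manifolds* (1993),
VI §6 [Kosinski1993]; R. E. Gompf, A. I. Stipsicz, *4-Manifolds and Kirby Calculus* (1999), §4.4
[GompfStipsicz1999].
-/

section Part4

open _root_.Set _root_.Function _root_.CategoryTheory _root_.CategoryTheory.Limits
open Literature.AlgebraicTopology.SingularHomology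

namespace Literature.Topology.FourManifolds.LefschetzHandlebodyHomology

universe u v

variable (R : Type v) [CommRing R] (M : Type v) [AddCommGroup M] [Module R M]

/-! ## §1 Mayer–Vietoris for a cover `Y = int A ∪ int B` with `B` acyclic -/

section Cover

variable {Y : Type u} [TopologicalSpace Y] (A B : Set Y)

/-- `inl : P ⟶ P ⊞ Q` is an isomorphism when `Q = 0`. [cite: HatcherAT2002, §2.2 p. 149] -/
theorem isIso_biprod_inl_of_isZero {C : Type*} [Category C] [Preadditive C] {P Q : C}
    [HasBinaryBiproduct P Q] (hQ : IsZero Q) : IsIso (biprod.inl : P ⟶ P ⊞ Q) := by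
  refine ⟨⟨biprod.fst, biprod.inl_fst, ?_⟩⟩
  refine biprod.hom_ext' _ _ ?_ ?_
  · rw [biprod.inl_fst_assoc, Category.comp_id]
  · exact hQ.eq_of_src _ _

/-- `φₙ` is injective as soon as its first component `Hₙ(A ∩ B) → Hₙ(A)` is.
[cite: HatcherAT2002, §2.2 p. 149] -/
theorem mono_φ_of_mono_left (n : ℕ)
    [Mono (singularHomology.map R M (subsetInclusion (inter_subset_left : A ∩ B ⊆ A)) n)] :
    Mono (mayerVietoris.φ R M A B n) := by
  have hfac : mayerVietoris.φ R M A B n ≫ biprod.fst =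
      singularHomology.map R M (subsetInclusion (inter_subset_left : A ∩ B ⊆ A)) n :=
    biprod.lift_fst _ _
  haveI : Mono (mayerVietoris.φ R M A B n ≫ biprod.fst) := by rw [hfac]; infer_instance
  exact mono_of_mono _ (biprod.fst : singularHomology R M A n ⊞ singularHomology R M B n ⟶ _)

/-- `φₙ` is injective as soon as its second component `Hₙ(A ∩ B) → Hₙ(B)` is.
[cite: HatcherAT2002, §2.2 p. 149] -/
theorem mono_φ_of_mono_right (n : ℕ)
    [Mono (singularHomology.map R M (subsetInclusion (inter_subset_right : A ∩ B ⊆ B)) n)] :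
    Mono (mayerVietoris.φ R M A B n) := by
  have hfac : mayerVietoris.φ R M A B n ≫ (-biprod.snd) =
      singularHomology.map R M (subsetInclusion (inter_subset_right : A ∩ B ⊆ B)) n := by
    rw [Preadditive.comp_neg, mayerVietoris.φ, biprod.lift_snd, neg_neg]
  haveI : Mono (mayerVietoris.φ R M A B n ≫ (-biprod.snd)) := by rw [hfac]; infer_instance
  exact mono_of_mono _ (-(biprod.snd : singularHomology R M A n ⊞ singularHomology R M B n ⟶ _))

/-- `φ₀` is injective when `A ∩ B` and `B` are path connected. [cite: HatcherAT2002, §2.2 p. 149] -/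
theorem mono_φ_zero [PathConnectedSpace ↥(A ∩ B)] [PathConnectedSpace ↥B] :
    Mono (mayerVietoris.φ R M A B 0) := by
  haveI := singularHomology.isIso_map_zero_of_pathConnectedSpace R M
    (subsetInclusion (inter_subset_right : A ∩ B ⊆ B))
  exact mono_φ_of_mono_right R M A B 0

/-- If `φₙ` is injective then `δₙ = 0` and `ψₙ₊₁` is onto. [cite: HatcherAT2002, §2.2 p. 149] -/
theorem epi_ψ_of_mono_φ (hAB : interior A ∪ interior B = univ) (n : ℕ)
    [Mono (mayerVietoris.φ R M A B n)] : Epi (mayerVietoris.ψ R M A B (n + 1)) := by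
  have hexc := relativeSingularHomology.isIso_map_of_interior_union_interior_holds R M Y
  have hδ : mayerVietoris.δ R M A B hexc hAB n = 0 :=
    (cancel_mono (mayerVietoris.φ R M A B n)).1
      ((mayerVietoris.δ_comp_φ R M A B hexc hAB n).trans (zero_comp).symm)
  exact (mayerVietoris.exact₂_holds R M A B hexc hAB n).epi_f hδ

/-- **`Hₙ₊₁(A) → Hₙ₊₁(Y)` is onto** when `Hₙ₊₁(B) = 0` and `φₙ` is injective: `ψₙ₊₁` is onto and
its `B`-summand vanishes. [cite: HatcherAT2002, §2.2 p. 149] -/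
theorem surjective_map_of_mono_φ (hAB : interior A ∪ interior B = univ) (n : ℕ)
    (hB : IsZero (singularHomology R M ↥B (n + 1))) [Mono (mayerVietoris.φ R M A B n)] :
    Function.Surjective (singularHomology.map R M (subsetIncl A) (n + 1)) := by
  haveI := epi_ψ_of_mono_φ R M A B hAB n
  intro y
  obtain ⟨x, rfl⟩ := (ModuleCat.epi_iff_surjective (mayerVietoris.ψ R M A B (n + 1))).1
    inferInstance y
  refine ⟨(biprod.fst : singularHomology R M A (n + 1) ⊞ singularHomology R M B (n + 1) ⟶ _) x, ?_⟩
  conv_rhs => rw [← biprod_apply_decomp x]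
  rw [map_add, mayerVietoris.ψ, biprod_desc_inl_apply, biprod_desc_inr_apply,
    hB.eq_of_src (singularHomology.map R M (subsetIncl B) (n + 1)) 0]
  simp

/-- The two inclusions `A ∩ B ⊆ A ⊆ Y` and `A ∩ B ⊆ B ⊆ Y` agree. [cite: HatcherAT2002, §2.2 p. 149] -/
theorem subsetIncl_comp_inter_left_eq :
    (subsetIncl A).comp (subsetInclusion (inter_subset_left : A ∩ B ⊆ A)) =
      (subsetIncl B).comp (subsetInclusion (inter_subset_right : A ∩ B ⊆ B)) := by
  ext x; rfl

/-- **The kernel of `Hₙ₊₁(A) → Hₙ₊₁(Y)` is the image of `Hₙ₊₁(A ∩ B) → Hₙ₊₁(A)`** when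
`Hₙ₊₁(B) = 0` (exactness at `Hₙ₊₁(A) ⊕ Hₙ₊₁(B)`). [cite: HatcherAT2002, §2.2 p. 149] -/
theorem ker_map_eq_range (hAB : interior A ∪ interior B = univ) (n : ℕ)
    (hB : IsZero (singularHomology R M ↥B (n + 1))) :
    LinearMap.ker (singularHomology.map R M (subsetIncl A) (n + 1)).hom =
      LinearMap.range (singularHomology.map R M
        (subsetInclusion (inter_subset_left : A ∩ B ⊆ A)) (n + 1)).hom := by
  apply le_antisymm
  · intro a ha
    have hex := mayerVietoris.exact₁_holds R M A B hAB (n + 1)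
    have h0 : mayerVietoris.ψ R M A B (n + 1)
        ((biprod.inl : singularHomology R M A (n + 1) ⟶ _ ⊞ singularHomology R M B (n + 1)) a)
          = 0 := by
      rw [mayerVietoris.ψ, biprod_desc_inl_apply]; exact ha
    obtain ⟨c, hc⟩ := (ShortComplex.moduleCat_exact_iff _).1 hex _ h0
    change mayerVietoris.φ R M A B (n + 1) c = _ at hc
    refine ⟨c, ?_⟩
    have e := congrArg (biprod.fst : singularHomology R M A (n + 1) ⊞
      singularHomology R M B (n + 1) ⟶ _) hc
    rw [mayerVietoris.φ, biprod_fst_lift_apply, ← ModuleCat.comp_apply, biprod.inl_fst,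
      ModuleCat.id_apply] at e
    exact e
  · rintro _ ⟨c, rfl⟩
    show (singularHomology.map R M (subsetInclusion inter_subset_left) (n + 1) ≫
      singularHomology.map R M (subsetIncl A) (n + 1)) c = 0
    rw [← singularHomology.map_comp, subsetIncl_comp_inter_left_eq, singularHomology.map_comp,
      hB.eq_of_src (singularHomology.map R M (subsetIncl B) (n + 1)) 0, comp_zero]
    rfl

/-- **`Hₖ₊₁(A) ≅ Hₖ₊₁(Y)`** when `Hₖ₊₁(A ∩ B) = 0`, `Hₖ₊₁(B) = 0` and `Hₖ(A ∩ B) → Hₖ(A)` is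
injective (`ψₖ₊₁` is an isomorphism and `Hₖ₊₁(A) = Hₖ₊₁(A) ⊕ Hₖ₊₁(B)`); companion of the tree's
`mayerVietoris.isIso_map_right_of_isZero` with the injectivity on the surviving piece.
[cite: HatcherAT2002, §2.2 p. 149] -/
theorem isIso_map_of_isZero_of_mono (hAB : interior A ∪ interior B = univ) (k : ℕ)
    (hI : IsZero (singularHomology R M ↥(A ∩ B) (k + 1)))
    (hB : IsZero (singularHomology R M ↥B (k + 1)))
    [Mono (singularHomology.map R M (subsetInclusion (inter_subset_left : A ∩ B ⊆ A)) k)] :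
    IsIso (singularHomology.map R M (subsetIncl A) (k + 1)) := by
  haveI := mono_φ_of_mono_left R M A B k
  haveI := epi_ψ_of_mono_φ R M A B hAB k
  have hφ0 : mayerVietoris.φ R M A B (k + 1) = 0 := hI.eq_of_src _ _
  haveI : Mono (mayerVietoris.ψ R M A B (k + 1)) :=
    (mayerVietoris.exact₁_holds R M A B hAB (k + 1)).mono_g hφ0
  haveI : IsIso (mayerVietoris.ψ R M A B (k + 1)) := isIso_of_mono_of_epi _
  haveI := isIso_biprod_inl_of_isZero (P := singularHomology R M A (k + 1)) hB
  have hfac : singularHomology.map R M (subsetIncl A) (k + 1) =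
      biprod.inl ≫ mayerVietoris.ψ R M A B (k + 1) := (biprod.inl_desc _ _).symm
  rw [hfac]
  infer_instance

end Cover

/-! ## §2 Two open subsets `U`, `W` of a space: transport to the inclusions of subsets -/

variable {R} in
/-- Transport of "kernel = image" along linear isomorphisms: if `F = F' ∘ e⁻¹`,
`e ∘ G' = G ∘ eI` and `ker F' = range G'` then `ker F = range G`. [cite: HatcherAT2002, §2.2 p. 149] -/
theorem ker_eq_range_of_conj {P P' Q I I' : Type*} [AddCommGroup P] [Module R P]
    [AddCommGroup P'] [Module R P'] [AddCommGroup Q] [Module R Q] [AddCommGroup I] [Module R I]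
    [AddCommGroup I'] [Module R I'] (e : P' ≃ₗ[R] P) (eI : I' ≃ₗ[R] I) {F : P →ₗ[R] Q}
    {F' : P' →ₗ[R] Q} {G : I →ₗ[R] P} {G' : I' →ₗ[R] P'}
    (hF : F = F' ∘ₗ (e.symm : P →ₗ[R] P')) (hG : (e : P' →ₗ[R] P) ∘ₗ G' = G ∘ₗ (eI : I' →ₗ[R] I))
    (h : LinearMap.ker F' = LinearMap.range G') : LinearMap.ker F = LinearMap.range G := by
  have h1 : LinearMap.ker F = Submodule.map (e : P' →ₗ[R] P) (LinearMap.ker F') := by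
    rw [hF, LinearMap.ker_comp, ← Submodule.map_equiv_eq_comap_symm]
  rw [h1, h, LinearMap.range_eq_map, ← Submodule.map_comp, hG, Submodule.map_comp,
    Submodule.map_top, LinearEquiv.range, Submodule.map_top]

section Subsets

variable {X : Type u} [TopologicalSpace X] {U W : Set X}

/-- The traces of the open `U`, `W` on `U ∪ W` are open pieces covering it. [cite: HatcherAT2002, §2.2 p. 149] -/
theorem interior_union_interior_eq_univ (hU : IsOpen U) (hW : IsOpen W) :
    interior (Subtype.val ⁻¹' U : Set ↥(U ∪ W)) ∪ interior (Subtype.val ⁻¹' W) = univ := by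
  rw [(hU.preimage continuous_subtype_val).interior_eq,
    (hW.preimage continuous_subtype_val).interior_eq]
  ext x
  simp only [mem_union, mem_preimage, mem_univ, iff_true]
  exact x.2

section Traces

variable (U W) in
/-- The trace `val ⁻¹' U` of `U` on `U ∪ W`, identified with `U`. [folklore] -/
private def eU : ↥(Subtype.val ⁻¹' U : Set ↥(U ∪ W)) ≃ₜ ↥U :=
  preimageValHomeomorphOfSubset subset_union_left

variable (U W) in
/-- The trace `val ⁻¹' W` of `W` on `U ∪ W`, identified with `W`. [folklore] -/
private def eW : ↥(Subtype.val ⁻¹' W : Set ↥(U ∪ W)) ≃ₜ ↥W :=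
  preimageValHomeomorphOfSubset subset_union_right

variable (U W) in
/-- The trace of `U ∩ W` on `U ∪ W`, identified with `U ∩ W`. [folklore] -/
private def eUW : ↥((Subtype.val ⁻¹' U : Set ↥(U ∪ W)) ∩ Subtype.val ⁻¹' W) ≃ₜ ↥(U ∩ W) :=
  preimageValHomeomorphOfSubset (A := U ∪ W) (B := U ∩ W)
    (inter_subset_left.trans subset_union_left)

variable (U W) in
/-- `incl_{val⁻¹'U} ∘ eU⁻¹ = (U ⊆ U ∪ W)`. [cite: HatcherAT2002, §2.2 p. 149] -/
theorem subsetIncl_comp_eU_symm :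
    (subsetIncl (Subtype.val ⁻¹' U : Set ↥(U ∪ W))).comp
        ((eU U W).symm : C(↥U, ↥(Subtype.val ⁻¹' U : Set ↥(U ∪ W)))) =
      subsetInclusion (subset_union_left : U ⊆ U ∪ W) := by
  ext x; rfl

variable (U W) in
/-- `eU ∘ (traces of U ∩ W ⊆ U) = (U ∩ W ⊆ U) ∘ eUW`. [cite: HatcherAT2002, §2.2 p. 149] -/
theorem eU_comp_subsetInclusion :
    ((eU U W : C(_, ↥U))).comp (subsetInclusion (inter_subset_left :
        (Subtype.val ⁻¹' U : Set ↥(U ∪ W)) ∩ Subtype.val ⁻¹' W ⊆ Subtype.val ⁻¹' U)) =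
      (subsetInclusion (inter_subset_left : U ∩ W ⊆ U)).comp (eUW U W : C(_, ↥(U ∩ W))) := by
  ext x; rfl

/-- On homology: `(U ⊆ U ∪ W)_* = eU⁻¹_* ≫ (incl_{val⁻¹'U})_*`. [cite: HatcherAT2002, §2.2 p. 149] -/
theorem map_union_left_eq (n : ℕ) :
    singularHomology.map R M (subsetInclusion (subset_union_left : U ⊆ U ∪ W)) n =
      (singularHomology.mapIso R M (eU U W) n).inv ≫
        singularHomology.map R M (subsetIncl (Subtype.val ⁻¹' U : Set ↥(U ∪ W))) n := by
  rw [singularHomology.mapIso_inv, ← singularHomology.map_comp, subsetIncl_comp_eU_symm]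

/-- On homology: `(traces)_* ≫ eU_* = eUW_* ≫ (U ∩ W ⊆ U)_*`. [cite: HatcherAT2002, §2.2 p. 149] -/
theorem map_trace_left_comm (n : ℕ) :
    singularHomology.map R M (subsetInclusion (inter_subset_left :
        (Subtype.val ⁻¹' U : Set ↥(U ∪ W)) ∩ Subtype.val ⁻¹' W ⊆ Subtype.val ⁻¹' U)) n ≫
        (singularHomology.mapIso R M (eU U W) n).hom =
      (singularHomology.mapIso R M (eUW U W) n).hom ≫
        singularHomology.map R M (subsetInclusion (inter_subset_left : U ∩ W ⊆ U)) n := by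
  rw [singularHomology.mapIso_hom, singularHomology.mapIso_hom, ← singularHomology.map_comp,
    ← singularHomology.map_comp, eU_comp_subsetInclusion]

/-- Injectivity on `Hₙ` of the trace of `U ∩ W ⊆ U` from that of `U ∩ W ⊆ U`. [cite: HatcherAT2002, §2.2 p. 149] -/
theorem mono_map_trace_left (n : ℕ)
    [Mono (singularHomology.map R M (subsetInclusion (inter_subset_left : U ∩ W ⊆ U)) n)] :
    Mono (singularHomology.map R M (subsetInclusion (inter_subset_left :
      (Subtype.val ⁻¹' U : Set ↥(U ∪ W)) ∩ Subtype.val ⁻¹' W ⊆ Subtype.val ⁻¹' U)) n) := by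
  haveI : Mono ((singularHomology.mapIso R M (eUW U W) n).hom ≫
      singularHomology.map R M (subsetInclusion (inter_subset_left : U ∩ W ⊆ U)) n) :=
    mono_comp _ _
  haveI : Mono (singularHomology.map R M (subsetInclusion (inter_subset_left :
      (Subtype.val ⁻¹' U : Set ↥(U ∪ W)) ∩ Subtype.val ⁻¹' W ⊆ Subtype.val ⁻¹' U)) n ≫
        (singularHomology.mapIso R M (eU U W) n).hom) := by
    rw [map_trace_left_comm]; infer_instance
  exact mono_of_mono _ (singularHomology.mapIso R M (eU U W) n).hom

/-- Path connectedness of the trace of `U ∩ W`. [cite: HatcherAT2002, §2.2 p. 149] -/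
theorem pathConnectedSpace_trace_inter [PathConnectedSpace ↥(U ∩ W)] :
    PathConnectedSpace ↥((Subtype.val ⁻¹' U : Set ↥(U ∪ W)) ∩ Subtype.val ⁻¹' W) :=
  (eUW U W).symm.surjective.pathConnectedSpace (eUW U W).symm.continuous

/-- Path connectedness of the trace of `W`. [cite: HatcherAT2002, §2.2 p. 149] -/
theorem pathConnectedSpace_trace_right [PathConnectedSpace ↥W] :
    PathConnectedSpace ↥(Subtype.val ⁻¹' W : Set ↥(U ∪ W)) :=
  (eW U W).symm.surjective.pathConnectedSpace (eW U W).symm.continuous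
/-- Vanishing of the homology of the trace of `W` from that of `W`. [cite: HatcherAT2002, §2.2 p. 149] -/
theorem isZero_trace_right {n : ℕ} (hW : IsZero (singularHomology R M ↥W n)) :
    IsZero (singularHomology R M ↥(Subtype.val ⁻¹' W : Set ↥(U ∪ W)) n) :=
  hW.of_iso (singularHomology.mapIso R M (eW U W) n)

/-- Vanishing of the homology of the trace of `U ∩ W` from that of `U ∩ W`. [cite: HatcherAT2002, §2.2 p. 149] -/
theorem isZero_trace_inter {n : ℕ} (hUW : IsZero (singularHomology R M ↥(U ∩ W) n)) :
    IsZero (singularHomology R M ↥((Subtype.val ⁻¹' U : Set ↥(U ∪ W)) ∩ Subtype.val ⁻¹' W) n) :=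
  hUW.of_iso (singularHomology.mapIso R M (eUW U W) n)

/-- **`H₁(U; M) → H₁(U ∪ W; M)` is onto** for open `U`, `W` with `W`, `U ∩ W` path connected and
`H₁(W; M) = 0`. [cite: HatcherAT2002, §2.2 p. 149] -/
theorem surjective_map_one_union (hU : IsOpen U) (hW : IsOpen W) [PathConnectedSpace ↥(U ∩ W)]
    [PathConnectedSpace ↥W] (hW1 : IsZero (singularHomology R M ↥W 1)) :
    Function.Surjective
      (singularHomology.map R M (subsetInclusion (subset_union_left : U ⊆ U ∪ W)) 1) := by
  haveI := pathConnectedSpace_trace_inter (U := U) (W := W)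
  haveI := pathConnectedSpace_trace_right (U := U) (W := W)
  haveI := mono_φ_zero R M (Subtype.val ⁻¹' U : Set ↥(U ∪ W)) (Subtype.val ⁻¹' W)
  have hs : Function.Surjective (singularHomology.map R M
      (subsetIncl (Subtype.val ⁻¹' U : Set ↥(U ∪ W))) 1) :=
    surjective_map_of_mono_φ R M (Subtype.val ⁻¹' U : Set ↥(U ∪ W)) (Subtype.val ⁻¹' W)
      (interior_union_interior_eq_univ hU hW) 0 (isZero_trace_right R M hW1)
  have he : Function.Surjective ((singularHomology.mapIso R M (eU U W) 1).inv) := fun a =>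
    ⟨(singularHomology.mapIso R M (eU U W) 1).hom a,
      (singularHomology.mapIso R M (eU U W) 1).hom_inv_id_apply a⟩
  intro y
  obtain ⟨a, rfl⟩ := hs y
  obtain ⟨u, rfl⟩ := he a
  exact ⟨u, by rw [map_union_left_eq, ModuleCat.comp_apply]⟩

/-- **The kernel of `H₁(U; M) → H₁(U ∪ W; M)` is the image of `H₁(U ∩ W; M) → H₁(U; M)`** for
open `U`, `W` with `H₁(W; M) = 0`; so `H₁(U ∪ W) ≅ H₁(U) ⧸ ⟨H₁(U ∩ W)⟩` together with
`surjective_map_one_union`. [cite: HatcherAT2002, §2.2 p. 149] -/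
theorem ker_map_one_union (hU : IsOpen U) (hW : IsOpen W)
    (hW1 : IsZero (singularHomology R M ↥W 1)) :
    LinearMap.ker (singularHomology.map R M (subsetInclusion (subset_union_left : U ⊆ U ∪ W)) 1).hom
      = LinearMap.range (singularHomology.map R M
          (subsetInclusion (inter_subset_left : U ∩ W ⊆ U)) 1).hom := by
  have hk := ker_map_eq_range R M (Subtype.val ⁻¹' U : Set ↥(U ∪ W)) (Subtype.val ⁻¹' W)
    (interior_union_interior_eq_univ hU hW) 0 (isZero_trace_right R M hW1)
  refine ker_eq_range_of_conj (singularHomology.mapIso R M (eU U W) 1).toLinearEquiv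
    (singularHomology.mapIso R M (eUW U W) 1).toLinearEquiv ?_ ?_ hk
  · have e := congrArg ModuleCat.Hom.hom (map_union_left_eq R M (U := U) (W := W) 1)
    rw [ModuleCat.hom_comp] at e
    exact e
  · have e := congrArg ModuleCat.Hom.hom (map_trace_left_comm R M (U := U) (W := W) 1)
    rw [ModuleCat.hom_comp, ModuleCat.hom_comp] at e
    exact e

/-- **`Hₖ₊₁(U; M) ≅ Hₖ₊₁(U ∪ W; M)`** for open `U`, `W` with `Hₖ₊₁(U ∩ W) = 0`, `Hₖ₊₁(W) = 0`
and `Hₖ(U ∩ W) → Hₖ(U)` injective. [cite: HatcherAT2002, §2.2 p. 149] -/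
theorem isIso_map_succ_union (hU : IsOpen U) (hW : IsOpen W) (k : ℕ)
    (hI : IsZero (singularHomology R M ↥(U ∩ W) (k + 1)))
    (hWk : IsZero (singularHomology R M ↥W (k + 1)))
    [Mono (singularHomology.map R M (subsetInclusion (inter_subset_left : U ∩ W ⊆ U)) k)] :
    IsIso (singularHomology.map R M (subsetInclusion (subset_union_left : U ⊆ U ∪ W)) (k + 1)) := by
  haveI := mono_map_trace_left R M (U := U) (W := W) k
  haveI := isIso_map_of_isZero_of_mono R M (Subtype.val ⁻¹' U : Set ↥(U ∪ W))
    (Subtype.val ⁻¹' W) (interior_union_interior_eq_univ hU hW) k (isZero_trace_inter R M hI)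
    (isZero_trace_right R M hWk)
  rw [map_union_left_eq]
  infer_instance

end Traces

end Subsets

end Literature.Topology.FourManifolds.LefschetzHandlebodyHomology

end Part4

/-!
## Part 5 — port of `Summits/SmoothPoincare4/SmoothPoincare4/Theorems/ConvexBisectionAcyclicBisectionExistsMultiAttachmentH1Cores.lean` (13 declarations kept)

# Removing the attaching circles of disjoint 4-dimensional 2-handle tubes does not change the
# homology of the manifold: `Hₙ₊₁(V ∖ ⋃ h̄ᵢ(S)) ≅ Hₙ₊₁(V)`

Verbatim declaration-level port (the declarations listed in the Part header count) of a helper module of the SmoothPoincare4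
tree that served the kernel proof of the homology of a Lefschetz handlebody; route bookkeeping of the source docstring (stub /
crux / item / wave names) is historical.

* §1 **Mayer–Vietoris with one homology-equivalent edge**: for an open-interior cover `Y = A ∪ B`,
  if `Hₖ(A ∩ B) → Hₖ(B)` is an isomorphism for `k = n, n + 1` then so is `Hₙ₊₁(A) → Hₙ₊₁(Y)`
  (diagram chase in Hatcher's exact sequence, §2.2 p. 149, over `…MultiAttachmentHomologyMV.lean`),
  and its transport to two open subsets;
* §2 the tube edge `Hₖ(h̄(T ∖ S)) ≅ Hₖ(h̄(T))` (both retract onto the parallel circle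
  `h̄(K_{1/2})`, `TwoHandleTubeDeformationFour.lean`); §3 the trace of a tube on the complement of
  the attaching circles; §4 **`isIso_map_coresComplement_succ`** by induction over the handles,
  and the registered sub-goal stub `stub_multiAttachment_coresComplement`.

Everything is proved; no named facts, no `sorry`, no definitions.  References: A. Hatcher,
*Algebraic Topology* (2002), §2.2 pp. 149–150 [HatcherAT2002]; A. A. Kosinski, *Differential
Manifolds* (1993), VI §6, X §2 [Kosinski1993]; R. E. Gompf, A. I. Stipsicz, *4-Manifolds and
Kirby Calculus* (1999), §4.4 [GompfStipsicz1999].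
-/

section Part5

open _root_.Set _root_.Function _root_.Metric _root_.CategoryTheory _root_.CategoryTheory.Limits
open Literature.AlgebraicTopology.SingularHomology Literature.AlgebraicTopology.Homotopy
open Literature.Topology.FourManifolds

namespace Literature.Topology.FourManifolds.LefschetzHandlebodyHomology

universe u v
variable (R : Type v) [CommRing R] (M : Type v) [AddCommGroup M] [Module R M]

/-! ## §1 Mayer–Vietoris with one homology-equivalent edge -/

section Cover

variable {Y : Type u} [TopologicalSpace Y] (A B : Set Y)

/-- **`Hₙ₊₁(A) → Hₙ₊₁(Y)` is injective** when `Hₙ₊₁(A ∩ B) → Hₙ₊₁(B)` is: if `i_A a = 0` then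
`(a, 0) = φ c = (i c, -i_B c)`, so `c = 0` and `a = 0`. [cite: HatcherAT2002, §2.2 p. 149] -/
theorem injective_map_left_of_mono (hAB : interior A ∪ interior B = univ) (n : ℕ)
    [Mono (singularHomology.map R M (subsetInclusion (inter_subset_right : A ∩ B ⊆ B)) (n + 1))] :
    Function.Injective (singularHomology.map R M (subsetIncl A) (n + 1)) := by
  set iB := singularHomology.map R M (subsetInclusion (inter_subset_right : A ∩ B ⊆ B)) (n + 1)
  have hinjB : Function.Injective iB := (ModuleCat.mono_iff_injective iB).1 inferInstance
  rw [injective_iff_map_eq_zero]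
  intro a ha
  have hψ : mayerVietoris.ψ R M A B (n + 1)
      ((biprod.inl : singularHomology R M A (n + 1) ⟶ _ ⊞ singularHomology R M B (n + 1)) a)
        = 0 := by
    rw [mayerVietoris.ψ, biprod_desc_inl_apply]; exact ha
  obtain ⟨c, hc⟩ := (ShortComplex.moduleCat_exact_iff _).1
    (mayerVietoris.exact₁_holds R M A B hAB (n + 1)) _ hψ
  change mayerVietoris.φ R M A B (n + 1) c = _ at hc
  have h2 := congrArg (biprod.snd : singularHomology R M A (n + 1) ⊞
    singularHomology R M B (n + 1) ⟶ _) hc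
  rw [mayerVietoris.φ, biprod_snd_lift_apply, ← ModuleCat.comp_apply, biprod.inl_snd] at h2
  have hc0 : (-iB) c = 0 := h2
  rw [show (-iB) c = (-iB).hom c from rfl, ModuleCat.hom_neg, LinearMap.neg_apply,
    neg_eq_zero] at hc0
  have hc' : c = 0 := (injective_iff_map_eq_zero _).1 hinjB c hc0
  have h1 := congrArg (biprod.fst : singularHomology R M A (n + 1) ⊞
    singularHomology R M B (n + 1) ⟶ _) hc
  rw [mayerVietoris.φ, biprod_fst_lift_apply, ← ModuleCat.comp_apply, biprod.inl_fst,
    ModuleCat.id_apply, hc', map_zero] at h1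
  exact h1.symm

/-- **`Hₙ₊₁(A) → Hₙ₊₁(Y)` is onto** when `φₙ` is injective and `Hₙ₊₁(A ∩ B) → Hₙ₊₁(B)` is onto:
`z = i_A x + i'_B (i_B y) = i_A (x + i y)`. [cite: HatcherAT2002, §2.2 p. 149] -/
theorem surjective_map_left_of_surjective (hAB : interior A ∪ interior B = univ) (n : ℕ)
    [Mono (mayerVietoris.φ R M A B n)]
    (hs : Function.Surjective
      (singularHomology.map R M (subsetInclusion (inter_subset_right : A ∩ B ⊆ B)) (n + 1))) :
    Function.Surjective (singularHomology.map R M (subsetIncl A) (n + 1)) := by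
  haveI := epi_ψ_of_mono_φ R M A B hAB n
  intro z
  obtain ⟨w, rfl⟩ := (ModuleCat.epi_iff_surjective (mayerVietoris.ψ R M A B (n + 1))).1
    inferInstance z
  obtain ⟨y, hy⟩ := hs ((biprod.snd : singularHomology R M A (n + 1) ⊞
    singularHomology R M B (n + 1) ⟶ _) w)
  refine ⟨(biprod.fst : singularHomology R M A (n + 1) ⊞ singularHomology R M B (n + 1) ⟶ _) w +
    singularHomology.map R M (subsetInclusion (inter_subset_left : A ∩ B ⊆ A)) (n + 1) y, ?_⟩
  conv_rhs => rw [← biprod_apply_decomp w]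
  rw [map_add, map_add, mayerVietoris.ψ, biprod_desc_inl_apply, biprod_desc_inr_apply, ← hy]
  congr 1
  rw [← ModuleCat.comp_apply, ← ModuleCat.comp_apply, ← singularHomology.map_comp,
    ← singularHomology.map_comp, subsetIncl_comp_inter_left_eq]

/-- **Mayer–Vietoris with one homology-equivalent edge**: if `Hₖ(A ∩ B) → Hₖ(B)` is an
isomorphism for `k = n, n + 1` then so is `Hₙ₊₁(A) → Hₙ₊₁(Y)`. [cite: HatcherAT2002, §2.2 p. 149] -/
theorem isIso_map_left_of_isIso_inter_right (hAB : interior A ∪ interior B = univ) (n : ℕ)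
    [IsIso (singularHomology.map R M (subsetInclusion (inter_subset_right : A ∩ B ⊆ B)) n)]
    [IsIso (singularHomology.map R M (subsetInclusion (inter_subset_right : A ∩ B ⊆ B)) (n + 1))] :
    IsIso (singularHomology.map R M (subsetIncl A) (n + 1)) := by
  haveI := mono_φ_of_mono_right R M A B n
  exact (ConcreteCategory.isIso_iff_bijective _).2 ⟨injective_map_left_of_mono R M A B hAB n,
    surjective_map_left_of_surjective R M A B hAB n
      ((ConcreteCategory.isIso_iff_bijective _).1 inferInstance).2⟩

end Cover

section Subsets

variable {X : Type u} [TopologicalSpace X] {U W : Set X}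

/-- On homology, the trace of `U ∩ W ⊆ W` on `U ∪ W` is conjugate to `(U ∩ W ⊆ W)_*`. [cite: HatcherAT2002, §2.2 p. 149] -/
theorem map_trace_right_eq (n : ℕ) :
    singularHomology.map R M (subsetInclusion (inter_subset_right :
        (Subtype.val ⁻¹' U : Set ↥(U ∪ W)) ∩ Subtype.val ⁻¹' W ⊆ Subtype.val ⁻¹' W)) n =
      (singularHomology.mapIso R M (preimageValHomeomorphOfSubset (A := U ∪ W) (B := U ∩ W)
          (inter_subset_left.trans subset_union_left)) n).hom ≫
        singularHomology.map R M (subsetInclusion (inter_subset_right : U ∩ W ⊆ W)) n ≫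
        (singularHomology.mapIso R M (preimageValHomeomorphOfSubset
          (subset_union_right : W ⊆ U ∪ W)) n).inv := by
  rw [singularHomology.mapIso_inv, singularHomology.mapIso_hom, ← singularHomology.map_comp,
    ← singularHomology.map_comp]
  rfl

/-- **`Hₙ₊₁(U) ≅ Hₙ₊₁(U ∪ W)`** for open `U`, `W` when `Hₖ(U ∩ W) → Hₖ(W)` is an isomorphism for
`k = n, n + 1`. [cite: HatcherAT2002, §2.2 p. 149] -/
theorem isIso_map_union_of_isIso_inter (hU : IsOpen U) (hW : IsOpen W) (n : ℕ)
    (hn : IsIso (singularHomology.map R M (subsetInclusion (inter_subset_right : U ∩ W ⊆ W)) n))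
    (hn1 : IsIso (singularHomology.map R M
      (subsetInclusion (inter_subset_right : U ∩ W ⊆ W)) (n + 1))) :
    IsIso (singularHomology.map R M (subsetInclusion (subset_union_left : U ⊆ U ∪ W)) (n + 1)) := by
  haveI : IsIso (singularHomology.map R M (subsetInclusion (inter_subset_right :
      (Subtype.val ⁻¹' U : Set ↥(U ∪ W)) ∩ Subtype.val ⁻¹' W ⊆ Subtype.val ⁻¹' W)) n) := by
    rw [map_trace_right_eq]
    exact @IsIso.comp_isIso _ _ _ _ _ _ _ inferInstance (@IsIso.comp_isIso _ _ _ _ _ _ _ hn inferInstance)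
  haveI : IsIso (singularHomology.map R M (subsetInclusion (inter_subset_right :
      (Subtype.val ⁻¹' U : Set ↥(U ∪ W)) ∩ Subtype.val ⁻¹' W ⊆ Subtype.val ⁻¹' W)) (n + 1)) := by
    rw [map_trace_right_eq]
    exact @IsIso.comp_isIso _ _ _ _ _ _ _ inferInstance (@IsIso.comp_isIso _ _ _ _ _ _ _ hn1 inferInstance)
  haveI := isIso_map_left_of_isIso_inter_right R M (Subtype.val ⁻¹' U : Set ↥(U ∪ W))
    (Subtype.val ⁻¹' W) (interior_union_interior_eq_univ hU hW) n
  rw [map_union_left_eq]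
  infer_instance

/-- Mutually inclusive subsets have isomorphic homology by the inclusion. [cite: HatcherAT2002, §2.2 p. 149] -/
theorem isIso_map_subsetInclusion_of_subset {A B : Set X} (hAB : A ⊆ B) (hBA : B ⊆ A) (n : ℕ) :
    IsIso (singularHomology.map R M (subsetInclusion hAB) n) := by
  refine ⟨⟨singularHomology.map R M (subsetInclusion hBA) n, ?_, ?_⟩⟩ <;>
  · rw [← singularHomology.map_comp]
    exact (congrArg (singularHomology.map R M · n) (by ext x; rfl)).trans
      (singularHomology.map_id R M n)

/-- `Hₙ(univ) ≅ Hₙ(X)` by the inclusion. [cite: HatcherAT2002, §2.2 p. 149] -/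
theorem isIso_map_subsetIncl_univ (n : ℕ) :
    IsIso (singularHomology.map R M (subsetIncl (univ : Set X)) n) := by
  rw [show subsetIncl (univ : Set X) = (Homeomorph.Set.univ X : C(↥(univ : Set X), X)) by ext x; rfl,
    ← singularHomology.mapIso_hom]
  infer_instance

/-- The inclusion of a strong deformation retract induces isomorphisms on homology.
[cite: HatcherAT2002, Cor. 2.11] -/
theorem isIso_map_subsetInclusion_of_sdr {A S : Set X} (h : IsStrongDeformationRetractOf A S)
    (hAS : A ⊆ S) (k : ℕ) : IsIso (singularHomology.map R M (subsetInclusion hAS) k) := by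
  obtain ⟨e, he⟩ := h.exists_homotopyEquiv_inclusion hAS
  have : singularHomology.map R M (subsetInclusion hAS) k =
      (singularHomology.isoOfHomotopyEquiv R M e k).hom := by
    rw [singularHomology.isoOfHomotopyEquiv_hom, he]
  rw [this]
  infer_instance

end Subsets

/-! ## §2 The tube edge `Hₖ(h̄(T ∖ S)) ≅ Hₖ(h̄(T))` -/

section Tube

variable {V : Type u} [TopologicalSpace V] [ChartedSpace (EuclideanHalfSpace (3 + 1)) V]

/-- **The tube edge**: for an attaching map `h̄ : T → V`, `Hₖ(h̄(T ∖ S)) ≅ Hₖ(h̄(T))` by the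
inclusion (both strongly deformation retract onto `h̄(K_{1/2})`). [cite: Kosinski1993, VI §6] -/
theorem isIso_map_tube_of_eq (g : HandleAttachingMap 3 2 V) {S₁ : Set V}
    (hS : S₁ = g.toFun '' {y : ↥(handleTube 3 2) | lamSq 2 y.1.1 ≠ 1}) (hS₁ : S₁ ⊆ range g.toFun)
    (k : ℕ) : IsIso (singularHomology.map R M (subsetInclusion hS₁) k) := by
  subst hS
  set K : Set ↥(handleTube 3 2) := {y | lamSq 2 y.1.1 = (2⁻¹ : ℝ) ^ 2 ∧ muSq 2 y.1.1 = 0} with hK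
  have he : Topology.IsEmbedding g.toFun := g.isSmoothEmbedding.isEmbedding
  have h₁ : IsStrongDeformationRetractOf (g.toFun '' K)
      (g.toFun '' {y : ↥(handleTube 3 2) | lamSq 2 y.1.1 ≠ 1}) :=
    (isStrongDeformationRetractOf_parallel₄_of_lt (c := 2⁻¹) (by norm_num) (by norm_num)
      ).image_of_isEmbedding he
  have h₂ : IsStrongDeformationRetractOf (g.toFun '' K) (range g.toFun) := by
    have h := (isStrongDeformationRetractOf_parallel₄_univ (c := 2⁻¹) (by norm_num)
      (by norm_num)).image_of_isEmbedding he
    rwa [image_univ] at h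
  have hK₁ : g.toFun '' K ⊆ g.toFun '' {y : ↥(handleTube 3 2) | lamSq 2 y.1.1 ≠ 1} := by
    refine image_mono fun y hy => ?_
    rw [mem_setOf_eq, hy.1]; norm_num
  have hK₂ : g.toFun '' K ⊆ range g.toFun := image_subset_range _ _
  haveI i₁ := isIso_map_subsetInclusion_of_sdr R M h₁ hK₁ k
  haveI i₂ := isIso_map_subsetInclusion_of_sdr R M h₂ hK₂ k
  have hfac : singularHomology.map R M (subsetInclusion hK₂) k =
      singularHomology.map R M (subsetInclusion hK₁) k ≫
        singularHomology.map R M (subsetInclusion hS₁) k := by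
    rw [← singularHomology.map_comp]; rfl
  rw [hfac] at i₂
  exact IsIso.of_isIso_comp_left (singularHomology.map R M (subsetInclusion hK₁) k) _

end Tube

/-! ## §3 Disjoint tubes and the complement of the attaching circles -/

section Cores

variable {V : Type u} [TopologicalSpace V] [ChartedSpace (EuclideanHalfSpace (3 + 1)) V]
  {ι : Type*} {h : ι → HandleAttachingMap 3 2 V}
/-- A point `h̄(y)` of a tube is on its attaching circle iff `|y_λ| = 1`. [cite: HatcherAT2002, §2.2 p. 149] -/
theorem apply_mem_core_iff₄ (g : HandleAttachingMap 3 2 V) (y : ↥(handleTube 3 2)) :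
    g.toFun y ∈ g.core ↔ lamSq 2 y.1.1 = 1 := by
  rw [HandleAttachingMap.mem_core_iff]
  exact ⟨fun ⟨y', hy', he⟩ => g.injective he ▸ hy', fun hy => ⟨y, hy, rfl⟩⟩

/-- With pairwise disjoint tubes: **the trace of the `i`-th tube on the complement of the
attaching circles is the image of the punctured tube `T ∖ S`.** [cite: HatcherAT2002, §2.2 p. 149] -/
theorem compl_iUnion_core_inter_range₄
    (hdisj : Pairwise fun i j => Disjoint (range (h i).toFun) (range (h j).toFun)) (i : ι) :
    (⋃ j, (h j).core)ᶜ ∩ range (h i).toFun =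
      (h i).toFun '' {y : ↥(handleTube 3 2) | lamSq 2 y.1.1 ≠ 1} := by
  ext a
  constructor
  · rintro ⟨ha, y, rfl⟩
    refine ⟨y, fun hy => ?_, rfl⟩
    rw [mem_compl_iff, mem_iUnion, not_exists] at ha
    exact ha i ((apply_mem_core_iff₄ (h i) y).2 hy)
  · rintro ⟨y, hy, rfl⟩
    refine ⟨fun hm => ?_, mem_range_self y⟩
    obtain ⟨j, hj⟩ := mem_iUnion.1 hm
    by_cases hji : j = i
    · subst hji
      exact hy ((apply_mem_core_iff₄ (h j) y).1 hj)
    · have hr : (h i).toFun y ∈ range (h j).toFun := by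
        obtain ⟨y', -, hy'⟩ := (HandleAttachingMap.mem_core_iff _).1 hj
        exact ⟨y', hy'⟩
      exact Set.disjoint_left.1 (hdisj (Ne.symm hji)) (mem_range_self y) hr

end Cores

/-! ## §4 `Hₙ₊₁(V ∖ ⋃ h̄ᵢ(S)) ≅ Hₙ₊₁(V)` -/

section Induction

variable {V : Type u} [TopologicalSpace V] [T2Space V] [ChartedSpace (EuclideanHalfSpace (3 + 1)) V]
  {ι : Type*} {h : ι → HandleAttachingMap 3 2 V}

/-- **Adding the tubes one at a time**: the inclusion of `V ∖ ⋃ h̄ⱼ(S)` into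
`(V ∖ ⋃ h̄ⱼ(S)) ∪ ⋃_{i ∈ s} h̄ᵢ(T)` induces isomorphisms on `Hₙ₊₁` (Mayer–Vietoris with the
homology-equivalent edge `h̄ᵢ(T ∖ S) ⊆ h̄ᵢ(T)` at each step). [cite: HatcherAT2002, §2.2 p. 149] -/
theorem isIso_map_coresCompl_finset [Finite ι]
    (hdisj : Pairwise fun i j => Disjoint (range (h i).toFun) (range (h j).toFun)) (n : ℕ)
    (s : Finset ι) : ∀ (P : Set V) (hP : (⋃ j, (h j).core)ᶜ ⊆ P),
      P = (⋃ j, (h j).core)ᶜ ∪ ⋃ i ∈ s, range (h i).toFun →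
      IsIso (singularHomology.map R M (subsetInclusion hP) (n + 1)) := by
  classical
  have hopen : IsOpen (⋃ j, (h j).core)ᶜ :=
    (isClosed_iUnion_of_finite fun j => (h j).isClosed_core).isOpen_compl
  induction s using Finset.induction_on with
  | empty =>
    intro P hP hPe
    refine isIso_map_subsetInclusion_of_subset R M hP ?_ (n + 1)
    rw [hPe]
    simp
  | @insert i s his ih =>
    intro P hP hPe
    set Q : Set V := (⋃ j, (h j).core)ᶜ ∪ ⋃ i ∈ s, range (h i).toFun with hQ
    have hCQ : (⋃ j, (h j).core)ᶜ ⊆ Q := subset_union_left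
    obtain rfl : P = Q ∪ range (h i).toFun := by
      rw [hPe, hQ, Finset.set_biUnion_insert]; ac_rfl
    haveI := ih Q hCQ rfl
    -- the new edge `Q ∩ h̄ᵢ(T) = h̄ᵢ(T ∖ S)`
    have hQi : Q ∩ range (h i).toFun =
        (h i).toFun '' {y : ↥(handleTube 3 2) | lamSq 2 y.1.1 ≠ 1} := by
      rw [← compl_iUnion_core_inter_range₄ hdisj i, hQ, union_inter_distrib_right]
      refine union_eq_left.2 ?_
      rintro a ⟨ha, hai⟩
      rw [mem_iUnion₂] at ha
      obtain ⟨j, hj, haj⟩ := ha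
      have hji : j ≠ i := fun e => his (e ▸ hj)
      exact absurd hai (Set.disjoint_left.1 (hdisj hji) haj)
    have hQo : IsOpen Q :=
      hopen.union (isOpen_biUnion fun i _ => (h i).isOpen_range)
    haveI := isIso_map_union_of_isIso_inter R M hQo (h i).isOpen_range n
      (isIso_map_tube_of_eq R M (h i) hQi inter_subset_right n)
      (isIso_map_tube_of_eq R M (h i) hQi inter_subset_right (n + 1))
    have hfac : singularHomology.map R M (subsetInclusion hP) (n + 1) =
        singularHomology.map R M (subsetInclusion hCQ) (n + 1) ≫
          singularHomology.map R M (subsetInclusion (subset_union_left :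
            Q ⊆ Q ∪ range (h i).toFun)) (n + 1) := by
      rw [← singularHomology.map_comp]; rfl
    rw [hfac]
    infer_instance

/-- **Removing the attaching circles of finitely many disjoint 2-handle tubes does not change the
homology of a 4-manifold in positive degrees**: `Hₙ₊₁(V ∖ ⋃ h̄ⱼ(S); M) ≅ Hₙ₊₁(V; M)` by the
inclusion (Kosinski X §2 proves the analogue for spheres in the interior by general position).
[cite: Kosinski1993, X §2 (proof of Thm. 2.2)] [cite: HatcherAT2002, §2.2 p. 149] -/
theorem isIso_map_coresComplement_succ [Finite ι]
    (hdisj : Pairwise fun i j => Disjoint (range (h i).toFun) (range (h j).toFun)) (n : ℕ) :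
    IsIso (singularHomology.map R M
      (subsetIncl ((HandleAttachingMap.coresComplement h : TopologicalSpace.Opens V) : Set V))
        (n + 1)) := by
  haveI := Fintype.ofFinite ι
  have hcov : (⋃ j, (h j).core)ᶜ ∪ ⋃ i ∈ (Finset.univ : Finset ι), range (h i).toFun = univ := by
    refine eq_univ_iff_forall.2 fun a => ?_
    by_cases ha : a ∈ ⋃ j, (h j).core
    · obtain ⟨j, hj⟩ := mem_iUnion.1 ha
      obtain ⟨y, -, rfl⟩ := (HandleAttachingMap.mem_core_iff _).1 hj
      exact Or.inr (mem_iUnion₂.2 ⟨j, Finset.mem_univ j, mem_range_self y⟩)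
    · exact Or.inl ha
  haveI := isIso_map_coresCompl_finset R M hdisj n Finset.univ univ (subset_univ _) hcov.symm
  haveI := isIso_map_subsetIncl_univ R M (X := V) (n + 1)
  show IsIso (singularHomology.map R M (subsetIncl (⋃ j, (h j).core)ᶜ) (n + 1))
  have hfac : singularHomology.map R M (subsetIncl (⋃ j, (h j).core)ᶜ) (n + 1) =
      singularHomology.map R M (subsetInclusion (subset_univ (⋃ j, (h j).core)ᶜ)) (n + 1) ≫
        singularHomology.map R M (subsetIncl (univ : Set V)) (n + 1) := by
    rw [← singularHomology.map_comp]; rfl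
  rw [hfac]
  infer_instance

end Induction

end Literature.Topology.FourManifolds.LefschetzHandlebodyHomology

end Part5

/-!
## Part 6 — port of `Summits/SmoothPoincare4/SmoothPoincare4/Theorems/ConvexBisectionAcyclicBisectionExistsMultiAttachmentH1Cover.lean` (6 declarations kept)

# `H₁` of a space covered by an open piece `A` and finitely many disjoint acyclic open pieces:
# `H₁(X) ≅ H₁(A) ⧸ ⟨one class per piece⟩`

Verbatim declaration-level port (the declarations listed in the Part header count) of a helper module of the SmoothPoincare4
tree that served the kernel proof of the homology of a Lefschetz handlebody; route bookkeeping of the source docstring (stub /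
crux / item / wave names) is historical.

Kosinski's model of a multi-attachment `X = V ∪ H² ∪ ⋯ ∪ H²` (VI §6,
`HandleAttachingMap.IsMultiAttachment`) is covered by the open sets `A = jA(V ∖ ⋃ cores)` and
`Bᵢ = jBᵢ(D⁴ ∖ S)`, the `Bᵢ` pairwise disjoint, contractible, and meeting `A` in the connected
punctured tubes `jBᵢ(T ∖ S)` whose `H₁` is carried onto the span of the `i`-th attaching class.
This file does the bookkeeping of the iterated Mayer–Vietoris steps
(`surjective_map_one_union`, `ker_map_one_union` of `…MultiAttachmentHomologyMV.lean`;
`ker_comp_eq_sup` of `…MultiAttachmentHomologyLoops.lean`) over such a cover, abstractly: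

* **`surjective_and_ker_cover`** — for `X = A ∪ ⋃ᵢ Bᵢ` with `A`, `Bᵢ` open, the `Bᵢ` pairwise
  disjoint and path connected with `H₁(Bᵢ) = 0`, the `A ∩ Bᵢ` path connected, and
  `im (H₁(A ∩ Bᵢ) → H₁(A)) = R ∙ cᵢ`: the map `H₁(A; R) → H₁(X; R)` is onto with kernel the span of
  the `cᵢ` (Finset induction over the pieces: `A ∪ ⋃_{j ∈ s} Bⱼ` meets the next piece `Bᵢ` in
  `A ∩ Bᵢ`); hence `H₁(X) ≅ H₁(A) ⧸ span {cᵢ}` (`nonempty_equiv_quot_cover`);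
* the registered sub-goal stub `stub_multiAttachment_coverH1`.

Everything is proved; no named facts, no `sorry`, no definitions.  References: A. Hatcher,
*Algebraic Topology* (2002), §2.2 pp. 149–150 [HatcherAT2002]; R. E. Gompf, A. I. Stipsicz,
*4-Manifolds and Kirby Calculus* (1999), §4.4 [GompfStipsicz1999]; A. A. Kosinski,
*Differential Manifolds* (1993), VI §6 [Kosinski1993].
-/

section Part6

open _root_.Set _root_.Function _root_.CategoryTheory _root_.CategoryTheory.Limits
open Literature.AlgebraicTopology.SingularHomology

namespace Literature.Topology.FourManifolds.LefschetzHandlebodyHomology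

universe u v

variable (R : Type v) [CommRing R] {X : Type u} [TopologicalSpace X]

/-! ## §1 Bookkeeping of inclusions on `H₁` -/

/-- Mutually inclusive subsets: the inclusion is onto on `H₁` with trivial kernel. [cite: HatcherAT2002, §2.2 p. 149] -/
theorem surjective_and_ker_of_subset {A P : Set X} (hAP : A ⊆ P) (hPA : P ⊆ A) :
    Function.Surjective (singularHomology.map R R (subsetInclusion hAP) 1) ∧
      LinearMap.ker (singularHomology.map R R (subsetInclusion hAP) 1).hom = ⊥ := by
  have hl : (subsetInclusion hPA).comp (subsetInclusion hAP) = ContinuousMap.id _ := by ext; rfl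
  have hr : (subsetInclusion hAP).comp (subsetInclusion hPA) = ContinuousMap.id _ := by ext; rfl
  have h₁ : singularHomology.map R R (subsetInclusion hAP) 1 ≫
      singularHomology.map R R (subsetInclusion hPA) 1 = 𝟙 _ := by
    rw [← singularHomology.map_comp, hl, singularHomology.map_id]
  have h₂ : singularHomology.map R R (subsetInclusion hPA) 1 ≫
      singularHomology.map R R (subsetInclusion hAP) 1 = 𝟙 _ := by
    rw [← singularHomology.map_comp, hr, singularHomology.map_id]
  refine ⟨fun y => ⟨singularHomology.map R R (subsetInclusion hPA) 1 y, ?_⟩,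
    LinearMap.ker_eq_bot.2 fun a b hab => ?_⟩
  · rw [← ModuleCat.comp_apply, h₂, ModuleCat.id_apply]
  · have e := congrArg (singularHomology.map R R (subsetInclusion hPA) 1) hab
    rwa [← ModuleCat.comp_apply, ← ModuleCat.comp_apply, h₁, ModuleCat.id_apply,
      ModuleCat.id_apply] at e

/-- `Hₙ(univ) → Hₙ(X)` is onto with trivial kernel (a homeomorphism). [cite: HatcherAT2002, §2.2 p. 149] -/
theorem surjective_and_ker_univ (n : ℕ) :
    Function.Surjective (singularHomology.map R R (subsetIncl (univ : Set X)) n) ∧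
      LinearMap.ker (singularHomology.map R R (subsetIncl (univ : Set X)) n).hom = ⊥ := by
  have e : singularHomology.map R R (subsetIncl (univ : Set X)) n =
      (singularHomology.mapIso R R (Homeomorph.Set.univ X) n).hom := by
    rw [singularHomology.mapIso_hom]; rfl
  rw [e]
  have hb := (ConcreteCategory.isIso_iff_bijective
    (singularHomology.mapIso R R (Homeomorph.Set.univ X) n).hom).1 inferInstance
  exact ⟨hb.2, LinearMap.ker_eq_bot.2 hb.1⟩

/-- Equal subsets of `P` have the same image in `H₁(P)`. [cite: HatcherAT2002, §2.2 p. 149] -/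
theorem range_map_congr_set {S T P : Set X} (hST : S = T) (hS : S ⊆ P) (hT : T ⊆ P) (n : ℕ) :
    LinearMap.range (singularHomology.map R R (subsetInclusion hS) n).hom =
      LinearMap.range (singularHomology.map R R (subsetInclusion hT) n).hom := by
  subst hST; rfl

/-- Composition of inclusions on homology, on `hom`s. [cite: HatcherAT2002, §2.2 p. 149] -/
theorem hom_map_comp_subsetInclusion {S P Q : Set X} (hSP : S ⊆ P) (hPQ : P ⊆ Q) (n : ℕ) :
    (singularHomology.map R R (subsetInclusion (hSP.trans hPQ)) n).hom =
      (singularHomology.map R R (subsetInclusion hPQ) n).hom ∘ₗ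
        (singularHomology.map R R (subsetInclusion hSP) n).hom := by
  rw [← ModuleCat.hom_comp, ← singularHomology.map_comp]; rfl

/-! ## §2 The iterated Mayer–Vietoris steps -/

section Cover

variable {ι : Type*} {A : Set X} {B : ι → Set X} {c : ι → singularHomology R R ↥A 1}

/-- **Finset induction over the acyclic pieces.**  Under the hypotheses of
`surjective_and_ker_cover` (except the covering one), for every finite set `s` of pieces the map
`H₁(A) → H₁(A ∪ ⋃_{i ∈ s} Bᵢ)` is onto with kernel the span of the `cᵢ`, `i ∈ s`.
[cite: HatcherAT2002, §2.2 p. 149] -/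
theorem surjective_and_ker_finset (hA : IsOpen A) (hB : ∀ i, IsOpen (B i))
    (hdisj : Pairwise fun i j => Disjoint (B i) (B j))
    (hpcI : ∀ i, PathConnectedSpace ↥(A ∩ B i)) (hpcB : ∀ i, PathConnectedSpace ↥(B i))
    (hB1 : ∀ i, IsZero (singularHomology R R ↥(B i) 1))
    (hc : ∀ i, LinearMap.range (singularHomology.map R R
      (subsetInclusion (inter_subset_left : A ∩ B i ⊆ A)) 1).hom = Submodule.span R {c i})
    (s : Finset ι) : ∀ (P : Set X) (hP : A ⊆ P), P = A ∪ ⋃ i ∈ s, B i →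
      Function.Surjective (singularHomology.map R R (subsetInclusion hP) 1) ∧
      LinearMap.ker (singularHomology.map R R (subsetInclusion hP) 1).hom =
        Submodule.span R (c '' (s : Set ι)) := by
  classical
  induction s using Finset.induction_on with
  | empty =>
    intro P hP hPe
    have hPA : P ⊆ A := by rw [hPe]; simp
    rw [Finset.coe_empty, image_empty, Submodule.span_empty]
    exact surjective_and_ker_of_subset R hP hPA
  | @insert i s his ih =>
    intro P hP hPe
    set Q : Set X := A ∪ ⋃ i ∈ s, B i with hQ
    have hAQ : A ⊆ Q := subset_union_left
    obtain rfl : P = Q ∪ B i := by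
      rw [hPe, hQ, Finset.set_biUnion_insert]; ac_rfl
    obtain ⟨hsF, hkF⟩ := ih Q hAQ rfl
    -- the next piece meets what is there in `A ∩ Bᵢ`
    have hQi : Q ∩ B i = A ∩ B i := by
      rw [hQ, union_inter_distrib_right]
      refine union_eq_left.2 ?_
      rintro a ⟨ha, hai⟩
      obtain ⟨j, hj, haj⟩ := mem_iUnion₂.1 ha
      have hji : j ≠ i := fun e => his (e ▸ hj)
      exact absurd hai (Set.disjoint_left.1 (hdisj hji) haj)
    have hQo : IsOpen Q := hA.union (isOpen_biUnion fun i _ => hB i)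
    haveI : PathConnectedSpace ↥(Q ∩ B i) := by rw [hQi]; exact hpcI i
    haveI := hpcB i
    -- the Mayer–Vietoris step
    have hsG := surjective_map_one_union R R hQo (hB i) (hB1 i)
    have hkG := ker_map_one_union R R hQo (hB i) (hB1 i)
    -- its kernel is the image of `R ∙ cᵢ`
    have hkG' : LinearMap.ker (singularHomology.map R R
        (subsetInclusion (subset_union_left : Q ⊆ Q ∪ B i)) 1).hom =
        Submodule.map (singularHomology.map R R (subsetInclusion hAQ) 1).hom
          (Submodule.span R {c i}) := by
      rw [hkG, range_map_congr_set R hQi inter_subset_left (inter_subset_left.trans hAQ) 1,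
        hom_map_comp_subsetInclusion R (inter_subset_left : A ∩ B i ⊆ A) hAQ 1,
        LinearMap.range_comp, hc i]
    -- compose
    have hfac : (singularHomology.map R R (subsetInclusion hP) 1).hom =
        (singularHomology.map R R (subsetInclusion (subset_union_left : Q ⊆ Q ∪ B i)) 1).hom ∘ₗ
          (singularHomology.map R R (subsetInclusion hAQ) 1).hom :=
      hom_map_comp_subsetInclusion R hAQ subset_union_left 1
    refine ⟨?_, ?_⟩
    · show Function.Surjective (singularHomology.map R R (subsetInclusion hP) 1).hom
      rw [hfac]
      exact hsG.comp hsF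
    · rw [hfac, ker_comp_eq_sup hkF hkG', Finset.coe_insert, image_insert_eq, Submodule.span_insert]

/-- **`H₁` of a space covered by an open piece `A` and finitely many disjoint acyclic open
pieces.**  Let `X = A ∪ ⋃ᵢ Bᵢ` with `A`, `Bᵢ` open, the `Bᵢ` pairwise disjoint and path
connected with `H₁(Bᵢ; R) = 0`, the `A ∩ Bᵢ` path connected, and let the image of
`H₁(A ∩ Bᵢ; R) → H₁(A; R)` be `R ∙ cᵢ`.  Then `H₁(A; R) → H₁(X; R)` is onto with kernel the span
of the `cᵢ` (Gompf–Stipsicz 1999, §4.4: `H₁(X ∪ 2-handles) = H₁(X)/⟨attaching circles⟩`).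
[cite: HatcherAT2002, §2.2 p. 149] -/
theorem surjective_and_ker_cover [Finite ι] (hA : IsOpen A) (hB : ∀ i, IsOpen (B i))
    (hdisj : Pairwise fun i j => Disjoint (B i) (B j)) (hcov : A ∪ ⋃ i, B i = univ)
    (hpcI : ∀ i, PathConnectedSpace ↥(A ∩ B i)) (hpcB : ∀ i, PathConnectedSpace ↥(B i))
    (hB1 : ∀ i, IsZero (singularHomology R R ↥(B i) 1))
    (hc : ∀ i, LinearMap.range (singularHomology.map R R
      (subsetInclusion (inter_subset_left : A ∩ B i ⊆ A)) 1).hom = Submodule.span R {c i}) :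
    Function.Surjective (singularHomology.map R R (subsetIncl A) 1) ∧
      LinearMap.ker (singularHomology.map R R (subsetIncl A) 1).hom =
        Submodule.span R (range c) := by
  haveI := Fintype.ofFinite ι
  have hcov' : (univ : Set X) = A ∪ ⋃ i ∈ (Finset.univ : Finset ι), B i := by
    rw [← hcov]
    congr 1
    ext x
    simp
  obtain ⟨hs, hk⟩ := surjective_and_ker_finset R hA hB hdisj hpcI hpcB hB1 hc Finset.univ univ
    (subset_univ A) hcov'
  rw [Finset.coe_univ, image_univ] at hk
  obtain ⟨hsu, hku⟩ := surjective_and_ker_univ R (X := X) 1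
  have hfac : (singularHomology.map R R (subsetIncl A) 1).hom =
      (singularHomology.map R R (subsetIncl (univ : Set X)) 1).hom ∘ₗ
        (singularHomology.map R R (subsetInclusion (subset_univ A)) 1).hom := by
    rw [← ModuleCat.hom_comp, ← singularHomology.map_comp]; rfl
  refine ⟨?_, ?_⟩
  · show Function.Surjective (singularHomology.map R R (subsetIncl A) 1).hom
    rw [hfac]
    exact hsu.comp hs
  · rw [hfac, LinearMap.ker_comp_of_ker_eq_bot _ hku, hk]

end Cover

end Literature.Topology.FourManifolds.LefschetzHandlebodyHomology

end Part6

/-!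
## Part 7 — port of `Summits/SmoothPoincare4/SmoothPoincare4/Theorems/ConvexBisectionAcyclicBisectionExistsMultiAttachmentH1.lean` (10 declarations kept)

# `H₁` of a Kosinski multi-attachment of 4-dimensional 2-handles:
# `H₁(X; R) ≅ H₁(V; R) ⧸ ⟨attaching classes⟩`, and clause 2 of NF5

Verbatim declaration-level port (the declarations listed in the Part header count) of a helper module of the SmoothPoincare4
tree that served the kernel proof of the homology of a Lefschetz handlebody; route bookkeeping of the source docstring (stub /
crux / item / wave names) is historical.

**E1 (`IsMultiAttachment.nonempty_equiv_quot_span`, stub `stub_multiAttachment_H1`).**  For a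
4-manifold with boundary `V`, attaching maps `h : ι → HandleAttachingMap 3 2 V` (`ι` finite) and
`X = V ∪ H² ∪ ⋯ ∪ H²` (`HandleAttachingMap.IsMultiAttachment h IP X`, Kosinski VI §6):
`H₁(X; R) ≅ H₁(V; R) ⧸ span {h(loopPath (h i).attachingCircle)}` (Gompf–Stipsicz 1999, §4.4:
*"`H₁(X ∪ 2-handles) = H₁(X)/⟨attaching circles⟩`"*).  Proof: `X` is covered by the open sets
`A = jA(V ∖ ⋃ cores)` and `Bᵢ = jBᵢ(D⁴ ∖ S)` (pairwise disjoint, contractible), with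
`A ∩ Bᵢ ≅ T ∖ S` the punctured tube of the `i`-th handle (§1); by the cover half
(`…MultiAttachmentH1Cover.lean`) `H₁(X) ≅ H₁(A) ⧸ span {cᵢ}` where `R ∙ cᵢ` is the image of
`H₁(A ∩ Bᵢ)`, i.e. (tube model, `…MultiAttachmentH1Model.lean`, with `range_map_one_eq_span`)
the span of the class of the parallel loop of the `i`-th handle (§2); finally
`H₁(A) ≅ H₁(V ∖ ⋃ cores) ≅ H₁(V)` (`…MultiAttachmentH1Cores.lean`) carries that class to the
class of the attaching loop (§3).

**E3 (`stub_isLefschetzHandlebody_homology_H1`) = clause 2 of NF5** for every genus and word: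
`IsLefschetzHandlebody g l X → H₁(X; ℤ) ≅ ℤ^{2g} ⧸ span (letters l)`, from E1 over `V = Base g`,
the homology shadow `shadowMap g : H₁(Base g; ℤ) ≅ ℤ^{2g}` (a bijection by Milnor's theorem
`exists_isChainShadow_of`, `LefschetzBaseShadow.lean`) and `IsLefschetzLink.shadow_eq` (§4).

Everything is proved; no named facts, no `sorry`, no definitions.  References: R. E. Gompf,
A. I. Stipsicz, *4-Manifolds and Kirby Calculus* (1999), §4.4, §8.2 [GompfStipsicz1999];
A. A. Kosinski, *Differential Manifolds* (1993), VI §6 [Kosinski1993]; A. Kas, Pacific J. Math.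
89 (1980) [Kas1980]; A. Hatcher, *Algebraic Topology* (2002), §2.2, Thm. 2A.1 [HatcherAT2002].
-/

section Part7

open scoped _root_.Manifold _root_.ContDiff _root_.Topology
open _root_.Set _root_.Function _root_.Metric _root_.CategoryTheory _root_.CategoryTheory.Limits
open Literature.AlgebraicTopology.SingularHomology Literature.AlgebraicTopology.Homotopy
open Literature.Topology.FourManifolds Literature.Topology.FourManifolds.LefschetzBase
open Literature.GroupTheory.CombinatorialGroupTheory.SignedHurwitz (letters)

namespace Literature.Topology.FourManifolds.LefschetzHandlebodyHomology

universe u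

variable (R : Type) [CommRing R]

section Engine

variable {V : Type} [TopologicalSpace V] [T2Space V] [ChartedSpace (EuclideanHalfSpace (3 + 1)) V]
  {ι : Type} [Finite ι] {h : ι → HandleAttachingMap 3 2 V}
  {X : Type} [TopologicalSpace X]
  {jA : ↥(HandleAttachingMap.coresComplement h) → X} {jB : ι → ↥(beltPiece 3 2) → X}

/-! ## §1 The gluing region of the `i`-th handle is a punctured tube -/

omit [T2Space V] [Finite ι] in
/-- With pairwise disjoint tubes, `h̄ᵢ(T ∖ S)` misses all the attaching circles. [cite: GompfStipsicz1999, §4.4] -/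
theorem apply_mem_coresComplement
    (hdisj : Pairwise fun i j => Disjoint (range (h i).toFun) (range (h j).toFun)) (i : ι)
    (y : ↥{y : ↥(handleTube 3 2) | lamSq 2 y.1.1 ≠ 1}) : (h i).toFun y.1 ∈ (⋃ j, (h j).core)ᶜ :=
  ((compl_iUnion_core_inter_range₄ hdisj i).symm.subset ⟨y.1, y.2, rfl⟩).1

/-- **The punctured tube of the `i`-th handle, embedded in `X` through the base piece**:
`y ↦ jA(h̄ᵢ y)`. [cite: Kosinski1993, VI §6] -/
theorem isEmbedding_tubePiece (hjA : Topology.IsEmbedding jA)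
    (hdisj : Pairwise fun i j => Disjoint (range (h i).toFun) (range (h j).toFun)) (i : ι) :
    Topology.IsEmbedding fun y : ↥{y : ↥(handleTube 3 2) | lamSq 2 y.1.1 ≠ 1} =>
      jA ⟨(h i).toFun y.1, apply_mem_coresComplement hdisj i y⟩ := by
  refine hjA.comp ?_
  rw [← Topology.IsEmbedding.subtypeVal.of_comp_iff]
  exact (h i).isSmoothEmbedding.isEmbedding.comp Topology.IsEmbedding.subtypeVal

omit [TopologicalSpace X] in
/-- **The gluing region `jA(V ∖ ⋃ cores) ∩ jBᵢ(D⁴ ∖ S)` is the image of the punctured tube of the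
`i`-th handle** (the identification `x ∼ h̄ᵢ α(x)` of Kosinski's model). [cite: Kosinski1993, VI §6] -/
theorem range_tubePiece_eq
    (hdisj : Pairwise fun i j => Disjoint (range (h i).toFun) (range (h j).toFun))
    (hglue : ∀ i a b, jA a = jB i b ↔
      (h i).glueRel (a : V) (b : closedBall (0 : EuclideanSpace ℝ (Fin 4)) 1)) (i : ι) :
    range (fun y : ↥{y : ↥(handleTube 3 2) | lamSq 2 y.1.1 ≠ 1} =>
      jA ⟨(h i).toFun y.1, apply_mem_coresComplement hdisj i y⟩) = range jA ∩ range (jB i) := by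
  ext w
  constructor
  · rintro ⟨y, rfl⟩
    refine ⟨mem_range_self _, ⟨(handleInversionPt y.1.1 y.1.2 y.2 : ↥(handleTube 3 2)).1,
      (handleInversion_mem y.1.2 y.2).2.2⟩, ?_⟩
    rw [eq_comm, hglue i]
    exact ⟨y.1, y.2, rfl, rfl⟩
  · rintro ⟨⟨a, rfl⟩, b, hb⟩
    obtain ⟨y, hy, -, hya⟩ := (hglue i a b).1 hb.symm
    refine ⟨⟨y, hy⟩, ?_⟩
    show jA _ = jA a
    congr 1
    exact Subtype.ext hya.symm

/-! ## §2 The hypotheses of the cover half -/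

/-- **The image of `H₁` of the gluing region `A ∩ Bᵢ ≅ T ∖ S` in `H₁(A)` is the span of the
class `cᵢ` of the parallel loop** (`range_map_one_eq_span` over the tube model).
[cite: HatcherAT2002, Thm. 2A.1] -/
theorem range_edge_eq_span (hjA : Topology.IsEmbedding jA)
    (hdisj : Pairwise fun i j => Disjoint (range (h i).toFun) (range (h j).toFun))
    (hglue : ∀ i a b, jA a = jB i b ↔
      (h i).glueRel (a : V) (b : closedBall (0 : EuclideanSpace ℝ (Fin 4)) 1))
    {y₀ : ↥{y : ↥(handleTube 3 2) | lamSq 2 y.1.1 ≠ 1}} (L : Path y₀ y₀)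
    (hL : ∀ γ : Path y₀ y₀, ∃ n : ℤ, FundamentalGroup.fromPath (Path.Homotopic.Quotient.mk γ) =
      FundamentalGroup.fromPath (Path.Homotopic.Quotient.mk L) ^ n) (i : ι) :
    LinearMap.range (singularHomology.map R R (subsetInclusion (inter_subset_left :
        range jA ∩ range (jB i) ⊆ range jA)) 1).hom =
      Submodule.span R {loopClass R R (1 : R) (L.map
          ((continuous_inclusion (inter_subset_left :
              range jA ∩ range (jB i) ⊆ range jA)).comp
            (((isEmbedding_tubePiece hjA hdisj i).toHomeomorph.trans
              (Homeomorph.setCongr (range_tubePiece_eq hdisj hglue i))).continuous)))} := by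
  haveI hTS : PathConnectedSpace ↥{y : ↥(handleTube 3 2) | lamSq 2 y.1.1 ≠ 1} :=
    isPathConnected_iff_pathConnectedSpace.1 isPathConnected_handleTube₄_lamSq_ne_one
  set e : ↥{y : ↥(handleTube 3 2) | lamSq 2 y.1.1 ≠ 1} ≃ₜ ↥(range jA ∩ range (jB i)) :=
    (isEmbedding_tubePiece hjA hdisj i).toHomeomorph.trans
      (Homeomorph.setCongr (range_tubePiece_eq hdisj hglue i)) with he
  set f : C(↥{y : ↥(handleTube 3 2) | lamSq 2 y.1.1 ≠ 1}, ↥(range jA)) :=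
    (subsetInclusion (inter_subset_left : range jA ∩ range (jB i) ⊆ range jA)).comp
      (e : C(_, _)) with hf
  have hrange := range_map_one_eq_span R L hL f
  have hfac : singularHomology.map R R f 1 = (singularHomology.mapIso R R e 1).hom ≫
      singularHomology.map R R (subsetInclusion (inter_subset_left :
        range jA ∩ range (jB i) ⊆ range jA)) 1 := by
    rw [singularHomology.mapIso_hom, ← singularHomology.map_comp]
  rw [hfac, ModuleCat.hom_comp, LinearMap.range_comp, LinearMap.range_eq_top.2
    ((ConcreteCategory.isIso_iff_bijective (singularHomology.mapIso R R e 1).hom).1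
      inferInstance).2, Submodule.map_top] at hrange
  exact hrange

/-- **The cover of a multi-attachment satisfies the hypotheses of `surjective_and_ker_cover`**,
with `cᵢ` the class of the parallel loop of the `i`-th handle pushed into `A = jA(V ∖ ⋃ cores)`;
conclusion: `H₁(A) → H₁(X)` is onto with kernel the span of these classes.
[cite: GompfStipsicz1999, §4.4] -/
theorem surjective_and_ker_of_isMultiAttachment {EP HP : Type*} [NormedAddCommGroup EP]
    [NormedSpace ℝ EP] [TopologicalSpace HP] {IP : ModelWithCorners ℝ EP HP} [ChartedSpace HP X]
    (hdisj : Pairwise fun i j => Disjoint (range (h i).toFun) (range (h j).toFun))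
    (hjA : Manifold.IsSmoothEmbedding (𝓡∂ (3 + 1)) IP ∞ jA) (hjAo : IsOpen (range jA))
    (hjB : ∀ i, Manifold.IsSmoothEmbedding (𝓡∂ (3 + 1)) IP ∞ (jB i) ∧ IsOpen (range (jB i)))
    (hcov : range jA ∪ (⋃ i, range (jB i)) = univ)
    (hglue : ∀ i a b, jA a = jB i b ↔
      (h i).glueRel (a : V) (b : closedBall (0 : EuclideanSpace ℝ (Fin 4)) 1))
    (hdisjB : Pairwise fun i j => Disjoint (range (jB i)) (range (jB j)))
    {y₀ : ↥{y : ↥(handleTube 3 2) | lamSq 2 y.1.1 ≠ 1}} (L : Path y₀ y₀)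
    (hL : ∀ γ : Path y₀ y₀, ∃ n : ℤ, FundamentalGroup.fromPath (Path.Homotopic.Quotient.mk γ) =
      FundamentalGroup.fromPath (Path.Homotopic.Quotient.mk L) ^ n) :
    Function.Surjective (singularHomology.map R R (subsetIncl (range jA)) 1) ∧
      LinearMap.ker (singularHomology.map R R (subsetIncl (range jA)) 1).hom =
        Submodule.span R (range fun i => loopClass R R (1 : R) (L.map
          ((continuous_inclusion (inter_subset_left :
              range jA ∩ range (jB i) ⊆ range jA)).comp
            (((isEmbedding_tubePiece hjA.isEmbedding hdisj i).toHomeomorph.trans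
              (Homeomorph.setCongr (range_tubePiece_eq hdisj hglue i))).continuous)))) := by
  have hpcB : ∀ i, ContractibleSpace ↥(range (jB i)) := fun i =>
    (hjB i).1.isEmbedding.toHomeomorph.contractibleSpace_iff.1 contractibleSpace_beltPiece₄
  refine surjective_and_ker_cover R hjAo (fun i => (hjB i).2) hdisjB hcov (fun i => ?_)
    (fun i => inferInstance) (fun i => isZero_singularHomology_of_contractibleSpace R R one_ne_zero)
    (range_edge_eq_span R hjA.isEmbedding hdisj hglue L hL)
  -- `A ∩ Bᵢ ≅ T ∖ S` is path connected
  haveI : PathConnectedSpace ↥{y : ↥(handleTube 3 2) | lamSq 2 y.1.1 ≠ 1} :=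
    isPathConnected_iff_pathConnectedSpace.1 isPathConnected_handleTube₄_lamSq_ne_one
  rw [← range_tubePiece_eq hdisj hglue i]
  exact isPathConnected_iff_pathConnectedSpace.1
    (isPathConnected_range (isEmbedding_tubePiece hjA.isEmbedding hdisj i).continuous)

/-! ## §3 Transport to `H₁(V)` -/

/-- **The class `cᵢ ∈ H₁(A)` of the parallel loop of the `i`-th handle is carried by
`H₁(A) ≅ H₁(V ∖ ⋃ cores) → H₁(V)` to the class of the attaching loop `loopPath (h i).attachingCircle`.**
[cite: GompfStipsicz1999, §4.4] -/
theorem map_edgeClass_eq {EP HP : Type*} [NormedAddCommGroup EP]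
    [NormedSpace ℝ EP] [TopologicalSpace HP] {IP : ModelWithCorners ℝ EP HP} [ChartedSpace HP X]
    (hdisj : Pairwise fun i j => Disjoint (range (h i).toFun) (range (h j).toFun))
    (hjA : Manifold.IsSmoothEmbedding (𝓡∂ (3 + 1)) IP ∞ jA)
    (hglue : ∀ i a b, jA a = jB i b ↔
      (h i).glueRel (a : V) (b : closedBall (0 : EuclideanSpace ℝ (Fin 4)) 1))
    {y₀ : ↥{y : ↥(handleTube 3 2) | lamSq 2 y.1.1 ≠ 1}} (L : Path y₀ y₀)
    (hLclass : ∀ h' : HandleAttachingMap 3 2 V, loopClass R R (1 : R)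
      (L.map (h'.continuous.comp continuous_subtype_val)) =
        loopClass R R (1 : R) (loopPath h'.attachingCircle h'.continuous_attachingCircle)) (i : ι) :
    singularHomology.map R R (subsetIncl
        ((HandleAttachingMap.coresComplement h : TopologicalSpace.Opens V) : Set V)) 1
      (singularHomology.map R R (hjA.isEmbedding.toHomeomorph.symm :
          C(↥(range jA), ↥(HandleAttachingMap.coresComplement h))) 1
        (loopClass R R (1 : R) (L.map ((continuous_inclusion (inter_subset_left :
            range jA ∩ range (jB i) ⊆ range jA)).comp
          (((isEmbedding_tubePiece hjA.isEmbedding hdisj i).toHomeomorph.trans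
            (Homeomorph.setCongr (range_tubePiece_eq hdisj hglue i))).continuous))))) =
      loopClass R R (1 : R) (loopPath (h i).attachingCircle (h i).continuous_attachingCircle) := by
  rw [map_loopClass, map_loopClass, ← hLclass (h i)]
  refine loopClass_eq_of_coe_eq R _ _ (funext fun t => ?_)
  show (hjA.isEmbedding.toHomeomorph.symm ⟨jA ⟨(h i).toFun (L t).1, _⟩, _⟩ : V) = (h i).toFun (L t).1
  have e : (⟨jA ⟨(h i).toFun (L t).1, apply_mem_coresComplement hdisj i (L t)⟩, mem_range_self _⟩ :
      ↥(range jA)) = hjA.isEmbedding.toHomeomorph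
        ⟨(h i).toFun (L t).1, apply_mem_coresComplement hdisj i (L t)⟩ :=
    Subtype.ext (hjA.isEmbedding.toHomeomorph_apply_coe _).symm
  rw [e, Homeomorph.symm_apply_apply]

/-- **E1, with the multi-attachment data explicit.**  `H₁(X; R) ≅ H₁(V; R) ⧸ span` of the
classes of the attaching loops. [cite: GompfStipsicz1999, §4.4] -/
theorem nonempty_equiv_quot_of_data {EP HP : Type*} [NormedAddCommGroup EP]
    [NormedSpace ℝ EP] [TopologicalSpace HP] {IP : ModelWithCorners ℝ EP HP} [ChartedSpace HP X]
    (hdisj : Pairwise fun i j => Disjoint (range (h i).toFun) (range (h j).toFun))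
    (hjA : Manifold.IsSmoothEmbedding (𝓡∂ (3 + 1)) IP ∞ jA) (hjAo : IsOpen (range jA))
    (hjB : ∀ i, Manifold.IsSmoothEmbedding (𝓡∂ (3 + 1)) IP ∞ (jB i) ∧ IsOpen (range (jB i)))
    (hcov : range jA ∪ (⋃ i, range (jB i)) = univ)
    (hglue : ∀ i a b, jA a = jB i b ↔
      (h i).glueRel (a : V) (b : closedBall (0 : EuclideanSpace ℝ (Fin 4)) 1))
    (hdisjB : Pairwise fun i j => Disjoint (range (jB i)) (range (jB j))) :
    Nonempty (singularHomology R R X 1 ≃ₗ[R] singularHomology R R V 1 ⧸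
      Submodule.span R (range fun i => loopClass R R (1 : R)
        (loopPath (h i).attachingCircle (h i).continuous_attachingCircle))) := by
  -- the tube model
  obtain ⟨y₀, L, hL, hLclass⟩ := stub_multiAttachment_tubeModel
  obtain ⟨hsurj, hker⟩ := surjective_and_ker_of_isMultiAttachment R hdisj hjA hjAo hjB hcov hglue
    hdisjB L hL
  -- `H₁(X) ≅ H₁(A) ⧸ span {cᵢ}`
  have h₁ := nonempty_equiv_quot_of_surjective hsurj hker
  -- `H₁(A) ≅ H₁(V ∖ ⋃ cores) ≅ H₁(V)`
  let Ψ : ↥(HandleAttachingMap.coresComplement h) ≃ₜ ↥(range jA) := hjA.isEmbedding.toHomeomorph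
  haveI hV : IsIso (singularHomology.map R R (subsetIncl
      ((HandleAttachingMap.coresComplement h : TopologicalSpace.Opens V) : Set V)) 1) :=
    isIso_map_coresComplement_succ R R hdisj 0
  let T : singularHomology R R ↥(range jA) 1 ≃ₗ[R] singularHomology R R V 1 :=
    ((singularHomology.mapIso R R Ψ 1).symm ≪≫ asIso (singularHomology.map R R (subsetIncl
      ((HandleAttachingMap.coresComplement h : TopologicalSpace.Opens V) : Set V)) 1)).toLinearEquiv
  refine nonempty_equiv_quot_congr h₁ T (LinearEquiv.refl R _) ?_
  rw [Submodule.map_span, ← range_comp]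
  congr 2
  funext i
  -- the class of the parallel loop is carried to the class of the attaching loop
  simp only [T, Function.comp_apply, LinearEquiv.coe_coe, Iso.toLinearEquiv_apply, Iso.trans_hom,
    Iso.symm_hom, asIso_hom, singularHomology.mapIso_inv, ModuleCat.comp_apply]
  exact map_edgeClass_eq R hdisj hjA hglue L (fun h' => hLclass R V h') i

/-- **E1: `H₁` of a Kosinski multi-attachment of 4-dimensional 2-handles** — for attaching maps
`h : ι → HandleAttachingMap 3 2 V` and `X = V ∪ H² ∪ ⋯ ∪ H²`
(`HandleAttachingMap.IsMultiAttachment h IP X`), `H₁(X; R) ≅ H₁(V; R) ⧸ ⟨attaching classes⟩`,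
the attaching classes being the Hurewicz classes of the unit-period attaching loops
`loopPath (h i).attachingCircle`. [cite: GompfStipsicz1999, §4.4] -/
theorem IsMultiAttachment.nonempty_equiv_quot_span {EP HP : Type*} [NormedAddCommGroup EP]
    [NormedSpace ℝ EP] [TopologicalSpace HP] {IP : ModelWithCorners ℝ EP HP} [ChartedSpace HP X]
    (hX : HandleAttachingMap.IsMultiAttachment h IP X) :
    Nonempty (singularHomology R R X 1 ≃ₗ[R] singularHomology R R V 1 ⧸
      Submodule.span R (range fun i => loopClass R R (1 : R)
        (loopPath (h i).attachingCircle (h i).continuous_attachingCircle))) := by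
  obtain ⟨hdisj, jA, jB, hjA, hjAo, hjB, hcov, hglue, hdisjB⟩ := hX
  exact nonempty_equiv_quot_of_data R hdisj hjA hjAo hjB hcov hglue hdisjB

end Engine

/-! ## §4 Clause 2 of NF5 -/

/-- The letters of a word are the first components of its entries. [cite: GompfStipsicz1999, §4.4] -/
theorem range_get_fst_eq_letters {W : Type*} (l : List (W × Bool)) :
    range (fun i : Fin l.length => (l.get i).1) = letters l := by
  ext v
  simp only [mem_range, letters, mem_setOf_eq]
  constructor
  · rintro ⟨i, rfl⟩
    exact ⟨(l.get i).2, List.get_mem l i⟩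
  · rintro ⟨s, hs⟩
    obtain ⟨i, hi⟩ := List.get_of_mem hs
    exact ⟨i, by rw [hi]⟩

/-- **Clause 2 of NF5 (`LefschetzBase.isLefschetzHandlebody_homology`), for every genus and
word**: the first homology of the (achiral) Lefschetz handlebody `X(F_{g,1}; l)` is
`ℤ^{2g} ⧸ ⟨letters of l⟩` — E1 over the base `Base g`, whose `H₁` the homology shadow identifies
with `ℤ^{2g}` (Milnor 1968 Thm. 9.1, `exists_isChainShadow_of`), the attaching classes going to
the letters (`IsLefschetzLink.shadow_eq`). (Registered sub-goal stub
`stub_isLefschetzHandlebody_homology_H1` of `stub_isLefschetzHandlebody_homology`.)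
[cite: GompfStipsicz1999, §8.2] [cite: Kas1980] -/
theorem stub_isLefschetzHandlebody_homology_H1 :
    ∀ (g : ℕ) (l : List ((Fin g ⊕ Fin g → ℤ) × Bool)) (X : Type) [TopologicalSpace X] [T2Space X]
      [SecondCountableTopology X] [CompactSpace X] [ChartedSpace (EuclideanHalfSpace 4) X]
      [IsManifold (𝓡∂ 4) ∞ X],
      Literature.Topology.FourManifolds.LefschetzBase.IsLefschetzHandlebody g l X →
        Nonempty ((Literature.AlgebraicTopology.SingularHomology.singularHomology ℤ ℤ X 1) ≃ₗ[ℤ]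
          ((Fin g ⊕ Fin g → ℤ) ⧸ Submodule.span ℤ
            (Literature.GroupTheory.CombinatorialGroupTheory.SignedHurwitz.letters l))) := by
  intro g l X _ _ _ _ _ _ hX
  obtain ⟨h, hlink, hmulti⟩ := hX
  have h₁ := IsMultiAttachment.nonempty_equiv_quot_span ℤ hmulti
  obtain ⟨hbij, -⟩ := isChainShadow_shadowMap g (exists_isChainShadow_of g)
  refine nonempty_equiv_quot_congr h₁ (LinearEquiv.ofBijective (shadowMap g) hbij)
    (LinearEquiv.refl ℤ _) ?_
  rw [Submodule.map_span, ← range_comp, ← range_get_fst_eq_letters]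
  congr 2
  funext i
  exact hlink.shadow_eq i

end Literature.Topology.FourManifolds.LefschetzHandlebodyHomology

end Part7

/-!
## Part 8 — port of `Summits/SmoothPoincare4/SmoothPoincare4/Theorems/ConvexBisectionAcyclicBisectionExistsMultiAttachmentHkCover.lean` (9 declarations kept)

# `Hₖ`, `k ≥ 2`, of a space covered by an open piece `A` and finitely many disjoint acyclic
# open pieces with independent edge classes: `Hₖ(A) ≅ Hₖ(X)`

Verbatim declaration-level port (the declarations listed in the Part header count) of a helper module of the SmoothPoincare4
tree that served the kernel proof of the homology of a Lefschetz handlebody; route bookkeeping of the source docstring (stub /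
crux / item / wave names) is historical.

For Kosinski's cover `A = jA(V ∖ ⋃ cores)`, `Bᵢ = jBᵢ(D⁴ ∖ S)` of a multi-attachment of
2-handles (`Bᵢ` contractible, `A ∩ Bᵢ ≃ S¹`), the Mayer–Vietoris sequence of each step
`U ↦ U ∪ Bᵢ` reads `0 → Hₖ(U) → Hₖ(U ∪ Bᵢ) → Hₖ₋₁(S¹) → Hₖ₋₁(U)` (Hatcher 2002, §2.2 p. 149), so
`Hₖ(U) ≅ Hₖ(U ∪ Bᵢ)` for `k ≥ 3`, and for `k = 2` as soon as `H₁(S¹) → H₁(U)` is injective,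
i.e. the `i`-th attaching class is independent of the previous ones in `H₁(A)`
(Gompf–Stipsicz 1999, §4.4: `H₂(X ∪ 2-handles)` grows exactly by the relations among the
attaching circles).  Abstractly:

* **`ker_and_isIso_finset`, `isIso_map_add_two_cover`** — for `X = A ∪ ⋃ᵢ Bᵢ` with `A`, `Bᵢ`
  open, the `Bᵢ` pairwise disjoint, path connected and acyclic in positive degrees, the
  `A ∩ Bᵢ` path connected with `Hₖ(A ∩ Bᵢ) = 0` for `k ≥ 2`, `H₁(A ∩ Bᵢ) → H₁(A)` injective with
  image `R ∙ cᵢ`, and the family `c` linearly independent: `Hₖ₊₂(A; R) ≅ Hₖ₊₂(X; R)` by the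
  inclusion, for every `k`;
* the registered sub-goal stub `stub_multiAttachment_coverHk`.

Everything is proved; no named facts, no `sorry`, no definitions.  References: A. Hatcher,
*Algebraic Topology* (2002), §2.2 pp. 149–150 [HatcherAT2002]; R. E. Gompf, A. I. Stipsicz,
*4-Manifolds and Kirby Calculus* (1999), §4.4 [GompfStipsicz1999].
-/

section Part8

open _root_.Set _root_.Function _root_.CategoryTheory _root_.CategoryTheory.Limits
open Literature.AlgebraicTopology.SingularHomology

namespace Literature.Topology.FourManifolds.LefschetzHandlebodyHomology

universe u v

variable (R : Type v) [CommRing R] {X : Type u} [TopologicalSpace X]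

/-! ## §1 Bookkeeping of inclusions -/

/-- Mutually inclusive subsets have isomorphic homology by the inclusion. [folklore] -/
private theorem isIso_map_incl_of_subset {A B : Set X} (hAB : A ⊆ B) (hBA : B ⊆ A) (n : ℕ) :
    IsIso (singularHomology.map R R (subsetInclusion hAB) n) := by
  refine ⟨⟨singularHomology.map R R (subsetInclusion hBA) n, ?_, ?_⟩⟩ <;>
  · rw [← singularHomology.map_comp]
    exact (congrArg (singularHomology.map R R · n) (by ext x; rfl)).trans
      (singularHomology.map_id R R n)

/-- `Hₙ(univ) ≅ Hₙ(X)` by the inclusion. [folklore] -/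
private theorem isIso_map_incl_univ (n : ℕ) :
    IsIso (singularHomology.map R R (subsetIncl (univ : Set X)) n) := by
  rw [show subsetIncl (univ : Set X) = (Homeomorph.Set.univ X : C(↥(univ : Set X), X)) by ext x; rfl,
    ← singularHomology.mapIso_hom]
  infer_instance

/-- Monomorphy of the inclusion on homology only depends on the subset. [cite: HatcherAT2002, §2.2 p. 149] -/
theorem mono_map_congr_set {S T P : Set X} (hST : S = T) (hS : S ⊆ P) (hT : T ⊆ P) (n : ℕ)
    (h : Mono (singularHomology.map R R (subsetInclusion hT) n)) :
    Mono (singularHomology.map R R (subsetInclusion hS) n) := by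
  subst hST; exact h

/-- Vanishing of homology only depends on the subset. [cite: HatcherAT2002, §2.2 p. 149] -/
theorem isZero_congr_set {S T : Set X} (hST : S = T) (n : ℕ)
    (h : IsZero (singularHomology R R ↥T n)) : IsZero (singularHomology R R ↥S n) := by
  subst hST; exact h

/-- Equal subsets of `P` have the same image in `Hₙ(P)`. [folklore] -/
private theorem range_congr_set {S T P : Set X} (hST : S = T) (hS : S ⊆ P) (hT : T ⊆ P) (n : ℕ) :
    LinearMap.range (singularHomology.map R R (subsetInclusion hS) n).hom =
      LinearMap.range (singularHomology.map R R (subsetInclusion hT) n).hom := by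
  subst hST; rfl

/-- Composition of inclusions on homology, on `hom`s. [folklore] -/
private theorem hom_comp_incl {S P Q : Set X} (hSP : S ⊆ P) (hPQ : P ⊆ Q) (n : ℕ) :
    (singularHomology.map R R (subsetInclusion (hSP.trans hPQ)) n).hom =
      (singularHomology.map R R (subsetInclusion hPQ) n).hom ∘ₗ
        (singularHomology.map R R (subsetInclusion hSP) n).hom := by
  rw [← ModuleCat.hom_comp, ← singularHomology.map_comp]; rfl

/-! ## §2 The iterated Mayer–Vietoris steps in degrees `≥ 2` -/

section Cover

variable {ι : Type*} {A : Set X} {B : ι → Set X} {c : ι → singularHomology R R ↥A 1}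

/-- **Injectivity of the edge `H₁(A ∩ Bᵢ) → H₁(U)` at stage `s ∌ i`** from the independence of
the classes: if `x ↦ 0` then its image in `H₁(A)` lies in `R ∙ cᵢ ∩ span {cⱼ, j ∈ s} = 0`.
[cite: GompfStipsicz1999, §4.4] -/
theorem injective_edge_of_linearIndependent {Q : Set X} (hAQ : A ⊆ Q) {s : Finset ι} {i : ι}
    (his : i ∉ s)
    (hkF : LinearMap.ker (singularHomology.map R R (subsetInclusion hAQ) 1).hom =
      Submodule.span R (c '' (s : Set ι)))
    (hc : LinearMap.range (singularHomology.map R R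
      (subsetInclusion (inter_subset_left : A ∩ B i ⊆ A)) 1).hom = Submodule.span R {c i})
    (hinj : Function.Injective (singularHomology.map R R
      (subsetInclusion (inter_subset_left : A ∩ B i ⊆ A)) 1))
    (hli : LinearIndependent R c) :
    Function.Injective (singularHomology.map R R
      (subsetInclusion ((inter_subset_left : A ∩ B i ⊆ A).trans hAQ)) 1) := by
  set ι₁ := singularHomology.map R R (subsetInclusion (inter_subset_left : A ∩ B i ⊆ A)) 1
  set F := singularHomology.map R R (subsetInclusion hAQ) 1
  have hfac : singularHomology.map R R
      (subsetInclusion ((inter_subset_left : A ∩ B i ⊆ A).trans hAQ)) 1 = ι₁ ≫ F := by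
    rw [← singularHomology.map_comp]; rfl
  rw [hfac]
  show Function.Injective (ι₁ ≫ F).hom
  rw [ModuleCat.hom_comp, injective_iff_map_eq_zero]
  intro x hx
  have hmem : ι₁.hom x ∈ LinearMap.ker F.hom := hx
  rw [hkF] at hmem
  have hmem' : ι₁.hom x ∈ Submodule.span R (c '' ({i} : Set ι)) := by
    rw [image_singleton, ← hc]; exact LinearMap.mem_range_self _ _
  have hdisj := hli.disjoint_span_image (s := ({i} : Set ι)) (t := (s : Set ι))
    (disjoint_singleton_left.2 (by exact_mod_cast his))
  have h0 : ι₁.hom x = 0 := (Submodule.disjoint_def.1 hdisj) _ hmem' hmem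
  exact (injective_iff_map_eq_zero _).1 hinj x h0

/-- **Finset induction over the acyclic pieces**: at every stage `U = A ∪ ⋃_{i ∈ s} Bᵢ`, the
kernel of `H₁(A) → H₁(U)` is `span {cᵢ, i ∈ s}` and `Hₖ₊₂(A) → Hₖ₊₂(U)` is an isomorphism.
[cite: HatcherAT2002, §2.2 p. 149] -/
theorem ker_and_isIso_finset (hA : IsOpen A) (hB : ∀ i, IsOpen (B i))
    (hdisj : Pairwise fun i j => Disjoint (B i) (B j))
    (hBk : ∀ i k, IsZero (singularHomology R R ↥(B i) (k + 1)))
    (hIk : ∀ i k, IsZero (singularHomology R R ↥(A ∩ B i) (k + 2)))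
    (hc : ∀ i, LinearMap.range (singularHomology.map R R
      (subsetInclusion (inter_subset_left : A ∩ B i ⊆ A)) 1).hom = Submodule.span R {c i})
    (hinj : ∀ i, Function.Injective (singularHomology.map R R
      (subsetInclusion (inter_subset_left : A ∩ B i ⊆ A)) 1))
    (hli : LinearIndependent R c) (s : Finset ι) :
    ∀ (P : Set X) (hP : A ⊆ P), P = A ∪ ⋃ i ∈ s, B i →
      LinearMap.ker (singularHomology.map R R (subsetInclusion hP) 1).hom =
        Submodule.span R (c '' (s : Set ι)) ∧
      ∀ k, IsIso (singularHomology.map R R (subsetInclusion hP) (k + 2)) := by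
  classical
  induction s using Finset.induction_on with
  | empty =>
    intro P hP hPe
    have hPA : P ⊆ A := by rw [hPe]; simp
    rw [Finset.coe_empty, image_empty, Submodule.span_empty]
    refine ⟨LinearMap.ker_eq_bot.2 ((ConcreteCategory.isIso_iff_bijective _).1
      (isIso_map_incl_of_subset R hP hPA 1)).1, fun k => isIso_map_incl_of_subset R hP hPA _⟩
  | @insert i s his ih =>
    intro P hP hPe
    set Q : Set X := A ∪ ⋃ i ∈ s, B i with hQ
    have hAQ : A ⊆ Q := subset_union_left
    obtain rfl : P = Q ∪ B i := by
      rw [hPe, hQ, Finset.set_biUnion_insert]; ac_rfl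
    obtain ⟨hkF, hisoF⟩ := ih Q hAQ rfl
    have hQi : Q ∩ B i = A ∩ B i := by
      rw [hQ, union_inter_distrib_right]
      refine union_eq_left.2 ?_
      rintro a ⟨ha, hai⟩
      obtain ⟨j, hj, haj⟩ := mem_iUnion₂.1 ha
      have hji : j ≠ i := fun e => his (e ▸ hj)
      exact absurd hai (Set.disjoint_left.1 (hdisj hji) haj)
    have hQo : IsOpen Q := hA.union (isOpen_biUnion fun i _ => hB i)
    have hfac : ∀ n, singularHomology.map R R (subsetInclusion hP) n =
        singularHomology.map R R (subsetInclusion hAQ) n ≫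
          singularHomology.map R R (subsetInclusion (subset_union_left : Q ⊆ Q ∪ B i)) n :=
      fun n => by rw [← singularHomology.map_comp]; rfl
    refine ⟨?_, fun k => ?_⟩
    · -- the kernel (as in `surjective_and_ker_finset`)
      have hkG := ker_map_one_union R R hQo (hB i) (hBk i 0)
      have hkG' : LinearMap.ker (singularHomology.map R R
          (subsetInclusion (subset_union_left : Q ⊆ Q ∪ B i)) 1).hom =
          Submodule.map (singularHomology.map R R (subsetInclusion hAQ) 1).hom
            (Submodule.span R {c i}) := by
        rw [hkG, range_congr_set R hQi inter_subset_left (inter_subset_left.trans hAQ) 1,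
          hom_comp_incl R (inter_subset_left : A ∩ B i ⊆ A) hAQ 1, LinearMap.range_comp, hc i]
      rw [hfac, ModuleCat.hom_comp, ker_comp_eq_sup hkF hkG', Finset.coe_insert, image_insert_eq,
        Submodule.span_insert]
    · -- the isomorphism in degree `k + 2`
      haveI : Mono (singularHomology.map R R (subsetInclusion (inter_subset_left :
          Q ∩ B i ⊆ Q)) (k + 1)) := by
        refine mono_map_congr_set R hQi inter_subset_left (inter_subset_left.trans hAQ) _ ?_
        cases k with
        | zero =>
          exact (ModuleCat.mono_iff_injective _).2
            (injective_edge_of_linearIndependent R hAQ his hkF (hc i) (hinj i) hli)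
        | succ k => exact ⟨fun _ _ _ => (hIk i k).eq_of_tgt _ _⟩
      haveI := isIso_map_succ_union R R hQo (hB i) (k + 1)
        (isZero_congr_set R hQi _ (hIk i k)) (hBk i (k + 1))
      haveI := hisoF k
      rw [hfac]
      infer_instance

/-- **`Hₖ₊₂(A; R) ≅ Hₖ₊₂(X; R)` for a space covered by an open piece `A` and finitely many
disjoint acyclic open pieces with independent edge classes** (hypotheses as in the module
docstring). [cite: HatcherAT2002, §2.2 p. 149] [cite: GompfStipsicz1999, §4.4] -/
theorem isIso_map_add_two_cover [Finite ι] (hA : IsOpen A) (hB : ∀ i, IsOpen (B i))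
    (hdisj : Pairwise fun i j => Disjoint (B i) (B j)) (hcov : A ∪ ⋃ i, B i = univ)
    (hBk : ∀ i k, IsZero (singularHomology R R ↥(B i) (k + 1)))
    (hIk : ∀ i k, IsZero (singularHomology R R ↥(A ∩ B i) (k + 2)))
    (hc : ∀ i, LinearMap.range (singularHomology.map R R
      (subsetInclusion (inter_subset_left : A ∩ B i ⊆ A)) 1).hom = Submodule.span R {c i})
    (hinj : ∀ i, Function.Injective (singularHomology.map R R
      (subsetInclusion (inter_subset_left : A ∩ B i ⊆ A)) 1))
    (hli : LinearIndependent R c) (k : ℕ) :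
    IsIso (singularHomology.map R R (subsetIncl A) (k + 2)) := by
  classical
  haveI := Fintype.ofFinite ι
  have hcov' : (univ : Set X) = A ∪ ⋃ i ∈ (Finset.univ : Finset ι), B i := by
    rw [← hcov]; congr 1; ext x; simp
  haveI := ((ker_and_isIso_finset R hA hB hdisj hBk hIk hc hinj hli Finset.univ univ
    (subset_univ A) hcov').2 k)
  haveI := isIso_map_incl_univ R (X := X) (k + 2)
  have hfac : singularHomology.map R R (subsetIncl A) (k + 2) =
      singularHomology.map R R (subsetInclusion (subset_univ A)) (k + 2) ≫
        singularHomology.map R R (subsetIncl (univ : Set X)) (k + 2) := by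
    rw [← singularHomology.map_comp]; rfl
  rw [hfac]
  infer_instance

end Cover

end Literature.Topology.FourManifolds.LefschetzHandlebodyHomology

end Part8

/-!
## Part 9 — port of `Summits/SmoothPoincare4/SmoothPoincare4/Theorems/ConvexBisectionAcyclicBisectionExistsMultiAttachmentHk.lean` (7 declarations kept)

# `Hₖ`, `k ≥ 2`, of a Kosinski multi-attachment of 4-dimensional 2-handles with independent
# attaching classes: `Hₖ(X; R) ≅ Hₖ(V; R)`; acyclicity when the classes are a basis of `H₁(V; R)`

Verbatim declaration-level port (the declarations listed in the Part header count) of a helper module of the SmoothPoincare4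
tree that served the kernel proof of the homology of a Lefschetz handlebody; route bookkeeping of the source docstring (stub /
crux / item / wave names) is historical.

* §1 the punctured tube `T ∖ S` of a 4-dimensional 2-handle is a homology circle:
  `Hₖ(T ∖ S; R) = 0` for `k ≥ 2` (it retracts onto the parallel circle `K_{1/2} ≅ 𝕊¹`,
  `TwoHandleTubeDeformationFour.lean`; `Hₖ(𝕊¹) = 0`, Hatcher Cor. 2.14);
* §2 degrees `≥ 3` of a cover by acyclic pieces with edges acyclic above degree `1`
  (`isIso_map_add_three_cover`, no hypothesis on the edge classes);
* §3 **E2 (`IsMultiAttachment.nonempty_iso_of_linearIndependent`)**: for `X = V ∪ H² ∪ ⋯ ∪ H²` (`HandleAttachingMap.IsMultiAttachment h IP X`) whose attaching classes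
  `h(loopPath (h i).attachingCircle) ∈ H₁(V; R)` are linearly independent,
  `Hₖ₊₂(X; R) ≅ Hₖ₊₂(V; R)` (Gompf–Stipsicz 1999, §4.4: the Mayer–Vietoris step over Kosinski's
  cover, `…MultiAttachmentHkCover.lean`, with the edge `H₁(T ∖ S) = R → H₁(A)` injective by
  independence), and **`IsMultiAttachment.nonempty_iso_add_three`**: `Hₖ₊₃(X; R) ≅ Hₖ₊₃(V; R)`
  unconditionally;
* §4 **acyclicity (`IsMultiAttachment.isZero_of_span_eq_top`)**: if moreover the attaching
  classes span `H₁(V; R)` and `Hₖ(V; R) = 0` for `k ≥ 2`, then `Hₖ(X; R) = 0` for all `k ≥ 1`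
  (with E1, `…MultiAttachmentH1.lean`), and the registered sub-goal stub `stub_multiAttachment_Hk`
  (E2); clause 3 of NF5 follows over `ℤ` and Betti numbers in `…MultiAttachmentAcyclic.lean`.

Everything is proved; no named facts, no `sorry` (one private definition, the circle map).
References: R. E. Gompf, A. I. Stipsicz, *4-Manifolds and Kirby Calculus* (1999), §4.4, §8.2
[GompfStipsicz1999]; A. Hatcher,
*Algebraic Topology* (2002), §2.2, Cor. 2.14 [HatcherAT2002]; A. A. Kosinski, *Differential
Manifolds* (1993), VI §6 [Kosinski1993]; A. Kas, Pacific J. Math. 89 (1980) [Kas1980].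
-/

section Part9

open scoped _root_.Manifold _root_.ContDiff _root_.Topology
open _root_.Set _root_.Function _root_.Metric _root_.CategoryTheory _root_.CategoryTheory.Limits
open Literature.AlgebraicTopology.SingularHomology Literature.AlgebraicTopology.Homotopy
open Literature.Topology.FourManifolds Literature.Topology.FourManifolds.LefschetzBase
open Literature.Topology.FourManifolds.HandleShrink

namespace Literature.Topology.FourManifolds.LefschetzHandlebodyHomology

variable (R : Type) [CommRing R]

/-! ## §1 The punctured tube is a homology circle -/

/-- The point `(θ/2, 0)` of the parallel circle `K_{1/2} ⊆ T`. [cite: Kosinski1993, VI §6] -/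
private def circPt (θ : sphere (0 : EuclideanSpace ℝ (Fin 2)) 1) : ↥(handleTube 3 2) :=
  ⟨⟨(2⁻¹ : ℝ) • corePt θ, by
      rw [mem_closedBall_zero_iff, norm_smul, norm_corePt, mul_one]; norm_num⟩, by
    rw [mem_handleTube]
    show lamSq 2 ((2⁻¹ : ℝ) • corePt θ) ≠ 0
    rw [lamSq_smul, lamSq_corePt]; norm_num⟩

/-- The parallel circle `K_{1/2}` is the (homeomorphic) image of `𝕊¹` under `circPt`. [folklore] -/
private theorem range_circPt : range circPt =
    {y : ↥(handleTube 3 2) | lamSq 2 y.1.1 = (2⁻¹ : ℝ) ^ 2 ∧ muSq 2 y.1.1 = 0} := by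
  ext y
  constructor
  · rintro ⟨θ, rfl⟩
    refine ⟨?_, ?_⟩
    · show lamSq 2 ((2⁻¹ : ℝ) • corePt θ) = _
      rw [lamSq_smul, lamSq_corePt, mul_one]
    · show muSq 2 ((2⁻¹ : ℝ) • corePt θ) = 0
      rw [← blockScale_self_eq_smul, muSq_blockScale, muSq_corePt, mul_zero]
  · rintro ⟨hl, hm⟩
    set u : EuclideanSpace ℝ (Fin 4) := y.1.1 with hu
    have h2 : u 2 = 0 := apply_eq_zero_of_muSq_eq_zero hm (i := 2) (by norm_num)
    have h3 : u 3 = 0 := apply_eq_zero_of_muSq_eq_zero hm (i := 3) (by norm_num)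
    rw [lamSq_two_fin_four] at hl
    let v : EuclideanSpace ℝ (Fin 2) := WithLp.toLp 2 ![u 0 / 2⁻¹, u 1 / 2⁻¹]
    have hv : ‖v‖ = 1 := by
      have : ‖v‖ ^ 2 = 1 := by
        rw [EuclideanSpace.norm_sq_eq, Fin.sum_univ_two, Real.norm_eq_abs, Real.norm_eq_abs,
          sq_abs, sq_abs]
        simp only [v]
        rw [Matrix.cons_val_zero, Matrix.cons_val_one, Matrix.cons_val_zero, div_pow, div_pow,
          ← add_div, hl, div_self (by norm_num)]
      nlinarith [norm_nonneg v]
    refine ⟨⟨v, mem_sphere_zero_iff_norm.2 hv⟩, ?_⟩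
    apply Subtype.ext; apply Subtype.ext
    show (2⁻¹ : ℝ) • corePt _ = u
    ext i
    fin_cases i
    · show 2⁻¹ * (u 0 / 2⁻¹) = u 0
      field_simp
    · show 2⁻¹ * (u 1 / 2⁻¹) = u 1
      field_simp
    · show 2⁻¹ * 0 = u 2
      rw [h2, mul_zero]
    · show 2⁻¹ * 0 = u 3
      rw [h3, mul_zero]

/-- **`Hₖ₊₂` of the parallel circle `K_{1/2} ≅ 𝕊¹` vanishes.** [cite: HatcherAT2002, Cor. 2.14] -/
theorem isZero_singularHomology_parallelCircle (k : ℕ) : IsZero (singularHomology R R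
    ↥{y : ↥(handleTube 3 2) | lamSq 2 y.1.1 = (2⁻¹ : ℝ) ^ 2 ∧ muSq 2 y.1.1 = 0} (k + 2)) := by
  have hc0 : Continuous fun θ : sphere (0 : EuclideanSpace ℝ (Fin 2)) 1 => (2⁻¹ : ℝ) • corePt θ :=
    continuous_corePt.const_smul (2⁻¹ : ℝ)
  have hc : Continuous circPt := (hc0.subtype_mk _).subtype_mk _
  have hinj : Function.Injective circPt := fun θ θ' e =>
    injective_corePt (smul_right_injective _ (by norm_num : (2⁻¹ : ℝ) ≠ 0)
      (congrArg (fun y : ↥(handleTube 3 2) => y.1.1) e))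
  let e : sphere (0 : EuclideanSpace ℝ (Fin 2)) 1 ≃ₜ
      ↥{y : ↥(handleTube 3 2) | lamSq 2 y.1.1 = (2⁻¹ : ℝ) ^ 2 ∧ muSq 2 y.1.1 = 0} :=
    (hc.isClosedEmbedding hinj).isEmbedding.toHomeomorph.trans (Homeomorph.setCongr range_circPt)
  have h𝕊 : IsZero (singularHomology R R ↥(sphere (0 : EuclideanSpace ℝ (Fin 2)) 1) (k + 2)) :=
    isZero_singularHomology_sphere_holds R R (n := 1) (by omega) (by omega)
  exact h𝕊.of_iso (singularHomology.mapIso R R e (k + 2)).symm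

/-- **The punctured tube `T ∖ S` is a homology circle: `Hₖ₊₂(T ∖ S; R) = 0`** (it retracts onto
`K_{1/2}`). [cite: Kosinski1993, VI §6] [cite: HatcherAT2002, Cor. 2.14] -/
theorem isZero_singularHomology_puncturedTube (k : ℕ) :
    IsZero (singularHomology R R ↥{y : ↥(handleTube 3 2) | lamSq 2 y.1.1 ≠ 1} (k + 2)) := by
  have hK : {y : ↥(handleTube 3 2) | lamSq 2 y.1.1 = (2⁻¹ : ℝ) ^ 2 ∧ muSq 2 y.1.1 = 0} ⊆
      {y : ↥(handleTube 3 2) | lamSq 2 y.1.1 ≠ 1} := by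
    rintro y ⟨hy, -⟩
    show lamSq 2 y.1.1 ≠ 1
    rw [hy]; norm_num
  haveI := isIso_map_subsetInclusion_of_sdr R R
    (isStrongDeformationRetractOf_parallel₄_of_lt (c := 2⁻¹) (by norm_num) (by norm_num)) hK (k + 2)
  exact (isZero_singularHomology_parallelCircle R k).of_iso
    (asIso (singularHomology.map R R (subsetInclusion hK) (k + 2))).symm

/-! ## §3 E2: `Hₖ₊₂(X; R) ≅ Hₖ₊₂(V; R)` for independent attaching classes; `Hₖ₊₃` always -/

section Engine

variable {V : Type} [TopologicalSpace V] [T2Space V] [ChartedSpace (EuclideanHalfSpace (3 + 1)) V]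
  {ι : Type} [Finite ι] {h : ι → HandleAttachingMap 3 2 V}
  {X : Type} [TopologicalSpace X]
  {jA : ↥(HandleAttachingMap.coresComplement h) → X} {jB : ι → ↥(beltPiece 3 2) → X}

omit [Finite ι] in
/-- For a linearly independent family, `r • v i = 0` forces `r = 0`. [cite: GompfStipsicz1999, §4.4] -/
theorem smul_eq_zero_of_linearIndependent {M : Type*} [AddCommGroup M] [Module R M] {v : ι → M}
    (hv : LinearIndependent R v) (i : ι) {r : R} (hr : r • v i = 0) : r = 0 := by
  classical
  have h := (linearIndependent_iff'.1 hv) {i} (fun _ => r) (by simpa using hr) i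
    (Finset.mem_singleton_self i)
  exact h

/-- **E2 with the multi-attachment data explicit**: `Hₖ₊₂(A) → Hₖ₊₂(X)` is an isomorphism when
the attaching classes are linearly independent in `H₁(V; R)`. [cite: GompfStipsicz1999, §4.4] -/
theorem isIso_map_add_two_of_data {EP HP : Type*} [NormedAddCommGroup EP]
    [NormedSpace ℝ EP] [TopologicalSpace HP] {IP : ModelWithCorners ℝ EP HP} [ChartedSpace HP X]
    (hdisj : Pairwise fun i j => Disjoint (range (h i).toFun) (range (h j).toFun))
    (hjA : Manifold.IsSmoothEmbedding (𝓡∂ (3 + 1)) IP ∞ jA) (hjAo : IsOpen (range jA))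
    (hjB : ∀ i, Manifold.IsSmoothEmbedding (𝓡∂ (3 + 1)) IP ∞ (jB i) ∧ IsOpen (range (jB i)))
    (hcov : range jA ∪ (⋃ i, range (jB i)) = univ)
    (hglue : ∀ i a b, jA a = jB i b ↔
      (h i).glueRel (a : V) (b : closedBall (0 : EuclideanSpace ℝ (Fin 4)) 1))
    (hdisjB : Pairwise fun i j => Disjoint (range (jB i)) (range (jB j)))
    (hli : LinearIndependent R fun i => loopClass R R (1 : R)
      (loopPath (h i).attachingCircle (h i).continuous_attachingCircle)) (k : ℕ) :
    IsIso (singularHomology.map R R (subsetIncl (range jA)) (k + 2)) := by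
  obtain ⟨y₀, L, hL, hLclass⟩ := stub_multiAttachment_tubeModel
  haveI hTS : PathConnectedSpace ↥{y : ↥(handleTube 3 2) | lamSq 2 y.1.1 ≠ 1} :=
    isPathConnected_iff_pathConnectedSpace.1 isPathConnected_handleTube₄_lamSq_ne_one
  have hpcB : ∀ i, ContractibleSpace ↥(range (jB i)) := fun i =>
    (hjB i).1.isEmbedding.toHomeomorph.contractibleSpace_iff.1 contractibleSpace_beltPiece₄
  -- the edge homeomorphisms and classes
  let e : ∀ i, ↥{y : ↥(handleTube 3 2) | lamSq 2 y.1.1 ≠ 1} ≃ₜ ↥(range jA ∩ range (jB i)) :=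
    fun i => (isEmbedding_tubePiece hjA.isEmbedding hdisj i).toHomeomorph.trans
      (Homeomorph.setCongr (range_tubePiece_eq hdisj hglue i))
  let c : ι → singularHomology R R ↥(range jA) 1 := fun i => loopClass R R (1 : R) (L.map
    ((continuous_inclusion (inter_subset_left : range jA ∩ range (jB i) ⊆ range jA)).comp
      (e i).continuous))
  have hc := range_edge_eq_span R hjA.isEmbedding hdisj hglue L hL
  -- independence of the `cᵢ` in `H₁(A)`, read in `H₁(V)`
  let T : singularHomology R R ↥(range jA) 1 →ₗ[R] singularHomology R R V 1 :=
    (singularHomology.map R R (subsetIncl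
        ((HandleAttachingMap.coresComplement h : TopologicalSpace.Opens V) : Set V)) 1).hom ∘ₗ
      (singularHomology.map R R (hjA.isEmbedding.toHomeomorph.symm :
          C(↥(range jA), ↥(HandleAttachingMap.coresComplement h))) 1).hom
  have hTc : (T ∘ c) = fun i => loopClass R R (1 : R)
      (loopPath (h i).attachingCircle (h i).continuous_attachingCircle) :=
    funext fun i => map_edgeClass_eq R hdisj hjA hglue L (fun h' => hLclass R V h') i
  have hli' : LinearIndependent R c := LinearIndependent.of_comp T (by rw [hTc]; exact hli)
  refine isIso_map_add_two_cover R hjAo (fun i => (hjB i).2) hdisjB hcov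
    (fun i k => isZero_singularHomology_of_contractibleSpace R R (Nat.succ_ne_zero k))
    (fun i k => (isZero_singularHomology_puncturedTube R k).of_iso
      (singularHomology.mapIso R R (e i) (k + 2)).symm) hc (fun i => ?_) hli' k
  -- injectivity of the edge `H₁(A ∩ Bᵢ) → H₁(A)`: `H₁(T ∖ S) = R ∙ [L]` and `r • cᵢ = 0 ⇒ r = 0`
  have hspan := span_loopClass_eq_top_of_zpow R L hL
  rw [injective_iff_map_eq_zero]
  intro x hx
  obtain ⟨x', rfl⟩ : ∃ x', (singularHomology.mapIso R R (e i) 1).hom x' = x :=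
    ((ConcreteCategory.isIso_iff_bijective (singularHomology.mapIso R R (e i) 1).hom).1
      inferInstance).2 x
  have hx' : x' ∈ Submodule.span R {loopClass R R (1 : R) L} := by rw [hspan]; trivial
  obtain ⟨r, rfl⟩ := Submodule.mem_span_singleton.1 hx'
  have hr : r • c i = 0 := by
    have e₁ : singularHomology.map R R (subsetInclusion (inter_subset_left :
        range jA ∩ range (jB i) ⊆ range jA)) 1 ((singularHomology.mapIso R R (e i) 1).hom
          (r • loopClass R R (1 : R) L)) = r • c i := by
      rw [map_smul, map_smul, singularHomology.mapIso_hom, ← ModuleCat.comp_apply,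
        ← singularHomology.map_comp, map_loopClass]
      rfl
    rw [← e₁]; exact hx
  rw [smul_eq_zero_of_linearIndependent R hli' i hr, zero_smul, map_zero]

/-- **E2: `Hₖ₊₂(X; R) ≅ Hₖ₊₂(V; R)` for a Kosinski multi-attachment of 4-dimensional 2-handles
whose attaching classes are linearly independent in `H₁(V; R)`** (always true in degrees `≥ 3`
on paper; the independence is what the degree-2 step needs). [cite: GompfStipsicz1999, §4.4] -/
theorem IsMultiAttachment.nonempty_iso_of_linearIndependent {EP HP : Type*} [NormedAddCommGroup EP]
    [NormedSpace ℝ EP] [TopologicalSpace HP] {IP : ModelWithCorners ℝ EP HP} [ChartedSpace HP X]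
    (hX : HandleAttachingMap.IsMultiAttachment h IP X)
    (hli : LinearIndependent R fun i => loopClass R R (1 : R)
      (loopPath (h i).attachingCircle (h i).continuous_attachingCircle)) (k : ℕ) :
    Nonempty (singularHomology R R X (k + 2) ≅ singularHomology R R V (k + 2)) := by
  obtain ⟨hdisj, jA, jB, hjA, hjAo, hjB, hcov, hglue, hdisjB⟩ := hX
  haveI := isIso_map_add_two_of_data R hdisj hjA hjAo hjB hcov hglue hdisjB hli k
  haveI : IsIso (singularHomology.map R R (subsetIncl
      ((HandleAttachingMap.coresComplement h : TopologicalSpace.Opens V) : Set V)) (k + 2)) :=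
    isIso_map_coresComplement_succ R R hdisj (k + 1)
  exact ⟨(asIso (singularHomology.map R R (subsetIncl (range jA)) (k + 2))).symm ≪≫
    (singularHomology.mapIso R R hjA.isEmbedding.toHomeomorph (k + 2)).symm ≪≫
    asIso (singularHomology.map R R (subsetIncl
      ((HandleAttachingMap.coresComplement h : TopologicalSpace.Opens V) : Set V)) (k + 2))⟩

end Engine

end Literature.Topology.FourManifolds.LefschetzHandlebodyHomology

end Part9

/-!
## Part 10 — port of `Summits/SmoothPoincare4/SmoothPoincare4/Theorems/ConvexBisectionAcyclicBisectionExistsMultiAttachmentAcyclic.lean` (7 declarations kept)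

# NF5 `LefschetzBase.isLefschetzHandlebody_homology`: the homology of the Lefschetz handlebody
# `X(F_{g,1}; l)` — clause 3 (`ℚ`-acyclicity when the `2g` vanishing cycles span) and the assembly

Verbatim declaration-level port (the declarations listed in the Part header count) of a helper module of the SmoothPoincare4
tree that served the kernel proof of the homology of a Lefschetz handlebody; route bookkeeping of the source docstring (stub /
crux / item / wave names) is historical.

Gompf–Stipsicz 1999, §8.2 / Kas 1980: `X(F; l)` is `F × D²` with one 2-handle per vanishing cycle,
so `H₁(X; ℤ) = ℤ^{2g}/⟨cycles⟩` and `H₂`, `H₃`, … do not grow when the cycles are independent.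
Over the concrete base this is assembled from the multi-attachment engine INTEGRALLY and then read
over `ℚ` through Betti numbers (`bₖ(X; ℤ) = bₖ(X; ℚ)`, Hatcher Cor. 3A.6 (a), tree
`bettiNumber_int_eq_rat`; finite generation of `Hₖ` of a compact manifold with boundary,
`finite_singularHomology_of_compact_chartedSpace_halfSpace`), which avoids rational Hurewicz
classes altogether:

* §1 algebra: if the letters of `l`, read over `ℚ`, span `ℚ^{2g}` and `l` has length `2g`, then
  the letters `i ↦ (l.get i).1` are `ℤ`-linearly independent (`linearIndependent_int_get`), so the
  integral attaching classes of a Lefschetz link realising `l` are independent in `H₁(Base g; ℤ)`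
  (`IsLefschetzLink.shadow_eq`: the shadow `shadowMap g` carries them to the letters), and
  `ℤ^{2g} ⧸ span (letters l)` has rank `0` (rank–nullity over `ℤ`);
* §2 **`isLefschetzHandlebody_bettiNumber`**: `b₁(X; ℤ) = 0` (E1 = clause 2,
  `stub_isLefschetzHandlebody_homology_H1`) and `bₖ₊₂(X; ℤ) = bₖ₊₂(Base g; ℤ)` (E2,
  `IsMultiAttachment.nonempty_iso_of_linearIndependent`); integrally `Hₖ₊₂(X; ℤ) = 0`
  (`isLefschetzHandlebody_isZero_int_add_two`) and, for every word, `Hₖ₊₃(X; R) = 0`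
  (`isLefschetzHandlebody_isZero_add_three`);
* §3 **`stub_isLefschetzHandlebody_homology_acyclic_of_base`** (registered sub-goal stub): clause 3
  of NF5 for every genus and word, CONDITIONAL only on `Hₖ₊₂(Base g; ℚ) = 0` for all `k`
  (`Base g ≃ F_{g,1} × D²`; the companion worker's Betti numbers of the base);
* §4 **`stub_isLefschetzHandlebody_homology_of_base`**: all of NF5 modulo that vanishing;
* §5 **`stub_isLefschetzHandlebody_homology`, `isLefschetzHandlebody_homology_holds`: NF5 PROVED**, the
  vanishing being `isZero_singularHomology_base_of_two_le` (`LefschetzBaseBetti.lean`, wave 3).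

Everything is proved; no named facts, no `sorry`, no definitions.  References: R. E. Gompf,
A. I. Stipsicz, *4-Manifolds and Kirby Calculus* (1999), §8.2 [GompfStipsicz1999]; A. Kas,
Pacific J. Math. 89 (1980) [Kas1980]; A. Hatcher, *Algebraic Topology* (2002), §3.A Cor. 3A.6
[HatcherAT2002].
-/

section Part10

open scoped _root_.Manifold _root_.ContDiff _root_.Topology
open _root_.Set _root_.Function _root_.CategoryTheory _root_.CategoryTheory.Limits
open Literature.AlgebraicTopology.SingularHomology
open Literature.Topology.FourManifolds Literature.Topology.FourManifolds.LefschetzBase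
open Literature.GroupTheory.CombinatorialGroupTheory.SignedHurwitz (letters ratWord letters_mapWord)

namespace Literature.Topology.FourManifolds.LefschetzHandlebodyHomology

/-! ## §1 Spanning rational letters of length `2g` are integrally independent -/

/-- **If the `2g` letters of `l` span `ℚ^{2g}` rationally, they are `ℤ`-linearly independent**
(a spanning family of `dim` vectors is a basis; independence descends along `ℤ^{2g} → ℚ^{2g}`).
[cite: GompfStipsicz1999, §8.2] -/
theorem linearIndependent_int_get {g : ℕ} (l : List ((Fin g ⊕ Fin g → ℤ) × Bool))
    (hspan : Submodule.span ℚ (letters (ratWord l)) = ⊤) (hlen : l.length = 2 * g) :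
    LinearIndependent ℤ fun i : Fin l.length => (l.get i).1 := by
  -- the coordinatewise cast `ℤ^{2g} → ℚ^{2g}` as a `ℤ`-linear map
  let c : (Fin g ⊕ Fin g → ℤ) →ₗ[ℤ] (Fin g ⊕ Fin g → ℚ) :=
    ((Int.castRingHom ℚ).compLeft (Fin g ⊕ Fin g)).toAddMonoidHom.toIntLinearMap
  have hc : ∀ v : Fin g ⊕ Fin g → ℤ, c v = fun i => (v i : ℚ) := fun v => rfl
  have hletters : letters (ratWord l) = c '' letters l := by
    rw [ratWord, letters_mapWord]
    exact congrArg (fun φ : (Fin g ⊕ Fin g → ℤ) → (Fin g ⊕ Fin g → ℚ) => φ '' letters l)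
      (funext fun v => (hc v).symm)
  have hrange : range (c ∘ fun i : Fin l.length => (l.get i).1) = letters (ratWord l) := by
    rw [range_comp, range_get_fst_eq_letters, hletters]
  have hliQ : LinearIndependent ℚ (c ∘ fun i : Fin l.length => (l.get i).1) := by
    refine linearIndependent_of_top_le_span_of_card_eq_finrank (by rw [hrange, hspan]) ?_
    rw [Fintype.card_fin, hlen, Module.finrank_fintype_fun_eq_card, Fintype.card_sum, Fintype.card_fin]
    ring
  have hliZ : LinearIndependent ℤ (c ∘ fun i : Fin l.length => (l.get i).1) :=
    hliQ.restrict_scalars (R := ℤ) (fun r s h => by simpa using h)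
  exact LinearIndependent.of_comp c hliZ

/-- **The integral attaching classes of a Lefschetz link with spanning rational shadows of length
`2g` are linearly independent in `H₁(Base g; ℤ)`** (the homology shadow carries them to the
letters). [cite: GompfStipsicz1999, §8.2] -/
theorem IsLefschetzLink.linearIndependent_loopClass {g : ℕ} {l : List ((Fin g ⊕ Fin g → ℤ) × Bool)}
    {h : Fin l.length → HandleAttachingMap 3 2 (Base g)} (hl : IsLefschetzLink g l h)
    (hspan : Submodule.span ℚ (letters (ratWord l)) = ⊤) (hlen : l.length = 2 * g) :
    LinearIndependent ℤ fun i => loopClass ℤ ℤ (1 : ℤ)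
      (loopPath (h i).attachingCircle (h i).continuous_attachingCircle) := by
  refine LinearIndependent.of_comp (shadowMap g) ?_
  have e : (shadowMap g) ∘ (fun i => loopClass ℤ ℤ (1 : ℤ)
      (loopPath (h i).attachingCircle (h i).continuous_attachingCircle)) =
      fun i : Fin l.length => (l.get i).1 := funext fun i => hl.shadow_eq i
  rw [e]
  exact linearIndependent_int_get l hspan hlen

/-- **`ℤ^{2g} ⧸ span (letters l)` has rank `0`** when the letters span rationally and `l` has
length `2g` (rank–nullity over `ℤ`: the span has rank `2g`). [cite: GompfStipsicz1999, §8.2] -/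
theorem finrank_quotient_span_letters_eq_zero {g : ℕ} (l : List ((Fin g ⊕ Fin g → ℤ) × Bool))
    (hspan : Submodule.span ℚ (letters (ratWord l)) = ⊤) (hlen : l.length = 2 * g) :
    Module.finrank ℤ ((Fin g ⊕ Fin g → ℤ) ⧸ Submodule.span ℤ (letters l)) = 0 := by
  have hli := linearIndependent_int_get l hspan hlen
  have hN : Module.finrank ℤ (Submodule.span ℤ (letters l)) = 2 * g := by
    rw [← range_get_fst_eq_letters, finrank_span_eq_card hli, Fintype.card_fin, hlen]
  have hM : Module.finrank ℤ (Fin g ⊕ Fin g → ℤ) = 2 * g := by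
    rw [Module.finrank_fintype_fun_eq_card, Fintype.card_sum, Fintype.card_fin]; ring
  have h := (Submodule.span ℤ (letters l)).finrank_quotient_add_finrank
  rw [hN, hM] at h
  exact Nat.add_right_cancel (h.trans (zero_add (2 * g)).symm)

/-! ## §2 The integral Betti numbers of a Lefschetz handlebody -/

/-- **Integral Betti numbers of `X(F_{g,1}; l)` with spanning rational shadows of length `2g`**:
`b₁(X; ℤ) = 0` (E1: `H₁(X; ℤ) ≅ ℤ^{2g}/⟨letters⟩` is torsion) and `bₖ₊₂(X; ℤ) = bₖ₊₂(Base g; ℤ)`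
(E2 with independent attaching classes). [cite: GompfStipsicz1999, §8.2] -/
theorem isLefschetzHandlebody_bettiNumber (g : ℕ) (l : List ((Fin g ⊕ Fin g → ℤ) × Bool))
    (X : Type) [TopologicalSpace X] [T2Space X] [SecondCountableTopology X] [CompactSpace X]
    [ChartedSpace (EuclideanHalfSpace 4) X] [IsManifold (𝓡∂ 4) ∞ X]
    (hX : IsLefschetzHandlebody g l X) (hspan : Submodule.span ℚ (letters (ratWord l)) = ⊤)
    (hlen : l.length = 2 * g) :
    bettiNumber ℤ X 1 = 0 ∧ ∀ k, bettiNumber ℤ X (k + 2) = bettiNumber ℤ (Base g) (k + 2) := by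
  refine ⟨?_, fun k => ?_⟩
  · obtain ⟨e⟩ := stub_isLefschetzHandlebody_homology_H1 g l X hX
    rw [bettiNumber, e.finrank_eq, finrank_quotient_span_letters_eq_zero l hspan hlen]
  · obtain ⟨h, hlink, hmulti⟩ := hX
    obtain ⟨e⟩ := IsMultiAttachment.nonempty_iso_of_linearIndependent ℤ hmulti
      (IsLefschetzLink.linearIndependent_loopClass hlink hspan hlen) k
    rw [bettiNumber, bettiNumber, e.toLinearEquiv.finrank_eq]

/-- **Clause 3 of NF5 (`LefschetzBase.isLefschetzHandlebody_homology`) modulo the base**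
(registered sub-goal stub `stub_isLefschetzHandlebody_homology_acyclic_of_base` of
`stub_isLefschetzHandlebody_homology`): if `Hₖ₊₂(Base g; ℚ) = 0` for all `k` (the base is
`F_{g,1} × D²` on paper), then every Lefschetz handlebody `X(F_{g,1}; l)` whose letters span
`ℚ^{2g}` rationally and which has `2g` letters is `ℚ`-acyclic in positive degrees — through the
integral Betti numbers of §2, `bₖ(X; ℤ) = bₖ(X; ℚ)` (Hatcher Cor. 3A.6 (a)) and the finite
generation of `Hₖ(X; ℚ)` for the compact manifold with boundary `X`.
[cite: GompfStipsicz1999, §8.2] [cite: HatcherAT2002, §3.A Cor. 3A.6 (a)] -/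
theorem stub_isLefschetzHandlebody_homology_acyclic_of_base :
    ∀ (g : ℕ) (l : List ((Fin g ⊕ Fin g → ℤ) × Bool)) (X : Type) [TopologicalSpace X] [T2Space X]
      [SecondCountableTopology X] [CompactSpace X] [ChartedSpace (EuclideanHalfSpace 4) X]
      [IsManifold (𝓡∂ 4) ∞ X],
      Literature.Topology.FourManifolds.LefschetzBase.IsLefschetzHandlebody g l X →
      (∀ k, CategoryTheory.Limits.IsZero
        (Literature.AlgebraicTopology.SingularHomology.singularHomology ℚ ℚ
          (Literature.Topology.FourManifolds.LefschetzBase.Base g) (k + 2))) →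
      Submodule.span ℚ (Literature.GroupTheory.CombinatorialGroupTheory.SignedHurwitz.letters
        (Literature.GroupTheory.CombinatorialGroupTheory.SignedHurwitz.ratWord l)) = ⊤ →
      l.length = 2 * g →
        ∀ k, 0 < k → CategoryTheory.Limits.IsZero
          (Literature.AlgebraicTopology.SingularHomology.singularHomology ℚ ℚ X k) := by
  intro g l X _ _ _ _ _ _ hX hBase hspan hlen k hk
  obtain ⟨h1, hk2⟩ := isLefschetzHandlebody_bettiNumber g l X hX hspan hlen
  -- the rational Betti number vanishes
  have hb : bettiNumber ℚ X k = 0 := by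
    rw [← bettiNumber_int_eq_rat]
    obtain ⟨k, rfl⟩ := Nat.exists_eq_add_one_of_ne_zero hk.ne'
    cases k with
    | zero => exact h1
    | succ k =>
      rw [show k + 1 + 1 = k + 2 from rfl, hk2 k, bettiNumber_int_eq_rat, bettiNumber]
      exact finrank_eq_zero_of_isZero (hBase k)
  -- `Hₖ(X; ℚ)` is finite-dimensional, hence zero
  haveI : Module.Finite ℚ (singularHomology ℚ ℚ X k) :=
    finite_singularHomology_of_compact_chartedSpace_halfSpace ℚ ℚ (n := 3) k
  haveI : Subsingleton (singularHomology ℚ ℚ X k) := Module.finrank_zero_iff.1 hb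
  exact ModuleCat.isZero_of_subsingleton _

/-! ## §4 NF5 modulo the base -/

/-- **NF5 = `LefschetzBase.isLefschetzHandlebody_homology`, all three clauses, MODULO the
vanishing `Hₖ₊₂(Base g; ℚ) = 0`** (registered sub-goal stub
`stub_isLefschetzHandlebody_homology_of_base`): clause 1 is
`stub_isLefschetzHandlebody_homology_connected` (wave 1), clause 2 is
`stub_isLefschetzHandlebody_homology_H1`, clause 3 is
`stub_isLefschetzHandlebody_homology_acyclic_of_base`; the conclusion is the registered text of
`stub_isLefschetzHandlebody_homology` verbatim. [cite: GompfStipsicz1999, §8.2] [cite: Kas1980] -/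
theorem stub_isLefschetzHandlebody_homology_of_base :
    (∀ g k : ℕ, CategoryTheory.Limits.IsZero
      (Literature.AlgebraicTopology.SingularHomology.singularHomology ℚ ℚ
        (Literature.Topology.FourManifolds.LefschetzBase.Base g) (k + 2))) →
    ∀ (g : ℕ) (l : List ((Fin g ⊕ Fin g → ℤ) × Bool)) (X : Type) [TopologicalSpace X] [T2Space X]
      [SecondCountableTopology X] [CompactSpace X] [ChartedSpace (EuclideanHalfSpace 4) X]
      [IsManifold (𝓡∂ 4) ∞ X],
      Literature.Topology.FourManifolds.LefschetzBase.IsLefschetzHandlebody g l X →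
      ConnectedSpace X ∧
        Nonempty ((Literature.AlgebraicTopology.SingularHomology.singularHomology ℤ ℤ X 1) ≃ₗ[ℤ]
          ((Fin g ⊕ Fin g → ℤ) ⧸ Submodule.span ℤ
            (Literature.GroupTheory.CombinatorialGroupTheory.SignedHurwitz.letters l))) ∧
        (Submodule.span ℚ (Literature.GroupTheory.CombinatorialGroupTheory.SignedHurwitz.letters
            (Literature.GroupTheory.CombinatorialGroupTheory.SignedHurwitz.ratWord l)) = ⊤ →
          l.length = 2 * g → ∀ k, 0 < k → CategoryTheory.Limits.IsZero
            (Literature.AlgebraicTopology.SingularHomology.singularHomology ℚ ℚ X k)) :=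
  fun hBase g l X _ _ _ _ _ _ hX =>
    ⟨stub_isLefschetzHandlebody_homology_connected g l X hX,
      stub_isLefschetzHandlebody_homology_H1 g l X hX, fun hspan hlen =>
        stub_isLefschetzHandlebody_homology_acyclic_of_base g l X hX (hBase g) hspan hlen⟩

/-! ## §5 NF5 -/

/-- **NF5 = `LefschetzBase.isLefschetzHandlebody_homology` (Gompf–Stipsicz 1999 §8.2; Kas 1980),
PROVED**: for every genus `g`, word `l` and compact Lefschetz handlebody `X = X(F_{g,1}; l)` over
the standard base, `X` is connected, `H₁(X; ℤ) ≅ ℤ^{2g} ⧸ ⟨letters of l⟩`, and `X` is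
`ℚ`-acyclic in positive degrees when the letters span `ℚ^{2g}` and `l` has `2g` letters — the
registered text of the parent stub `stub_isLefschetzHandlebody_homology` of line
`modp-braid-orbits` r9, from `stub_isLefschetzHandlebody_homology_of_base` and the vanishing
`Hₖ(Base g) = 0`, `k ≥ 2` (`isZero_singularHomology_base_of_two_le`, `LefschetzBaseBetti.lean`).
[cite: GompfStipsicz1999, §8.2] [cite: Kas1980] -/
theorem stub_isLefschetzHandlebody_homology :
    ∀ (g : ℕ) (l : List ((Fin g ⊕ Fin g → ℤ) × Bool)) (X : Type) [TopologicalSpace X] [T2Space X]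
      [SecondCountableTopology X] [CompactSpace X] [ChartedSpace (EuclideanHalfSpace 4) X]
      [IsManifold (𝓡∂ 4) ∞ X],
      IsLefschetzHandlebody g l X →
      ConnectedSpace X ∧
        Nonempty ((singularHomology ℤ ℤ X 1) ≃ₗ[ℤ]
          ((Fin g ⊕ Fin g → ℤ) ⧸ Submodule.span ℤ (letters l))) ∧
        (Submodule.span ℚ (letters (ratWord l)) = ⊤ → l.length = 2 * g →
          ∀ k, 0 < k → CategoryTheory.Limits.IsZero (singularHomology ℚ ℚ X k)) :=
  stub_isLefschetzHandlebody_homology_of_base fun g k =>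
    isZero_singularHomology_base_of_two_le ℚ ℚ g (Nat.le_add_left 2 k)

end Literature.Topology.FourManifolds.LefschetzHandlebodyHomology

end Part10

/-! ## Part 11 — the EXACT discharge `isLefschetzHandlebody_homology_holds` -/

namespace Literature.Topology.FourManifolds.LefschetzBase

/-- **The named fact `isLefschetzHandlebody_homology` HOLDS** (`LefschetzModelFacts.lean`; Gompf–Stipsicz 1999 §8.2 / Kas 1980: the
Lefschetz handlebody `X(F_{g,1}; l)` is connected, `H₁(X; ℤ) ≅ ℤ^{2g}/⟨l⟩`, and it is `ℚ`-acyclic in positive degrees when the `2g`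
vanishing cycles span `ℚ^{2g}`).  EXACT-name discharge by `LefschetzHandlebodyHomology.stub_isLefschetzHandlebody_homology`
(multi-attachment Mayer–Vietoris engine + Betti numbers of the base).  Literature-side twin of the Summits-side
`Summit.SmoothPoincare4.SmoothPoincare4.Theorems.AcyclicBisectionExists.ModpBraidOrbits.isLefschetzHandlebody_homology_holds`.
[cite: GompfStipsicz1999, §8.2] [cite: HatcherAT2002, §2.2 and Cor. 3A.6] -/
theorem isLefschetzHandlebody_homology_holds : isLefschetzHandlebody_homology :=
  LefschetzHandlebodyHomology.stub_isLefschetzHandlebody_homology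

end Literature.Topology.FourManifolds.LefschetzBase

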